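import Literature.Analysis.FluidPDE.Seregin2020SingularSetAxis
import Literature.Analysis.FluidPDE.RusinSverakBackwardRegularityHolds
import Literature.Analysis.FluidPDE.SereginSverakPressureDecayBalls
import Literature.Analysis.FluidPDE.Seregin2022LogSwirlCriterion
import Literature.Analysis.FluidPDE.AxisymmetricTypeIBounded
import Literature.Analysis.FluidPDE.SuitableWeakRescaling
import Literature.Analysis.FluidPDE.ClassicalSuitable
import Literature.Analysis.FluidPDE.SereginSverakBlowupSelection
import Literature.Analysis.FluidPDE.LeiZhang2011ZoomIn
import Literature.Analysis.FluidPDE.NSVorticityOfSmoothRepresentative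
import Literature.Analysis.FluidPDE.SereginZajaczkowski2007
import Literature.Analysis.FluidPDE.AxisymNoSwirlLocalMaxPrinciple
import Literature.Analysis.FluidPDE.SingularKernelGradient
import Mathlib.Analysis.SpecialFunctions.SmoothTransition
import Literature.Analysis.Calculus.HardyLogarithmic
import Literature.Analysis.Calculus.PlanarPolarIntegral
import Literature.Analysis.FluidPDE.CylinderTenThirds
import Literature.Analysis.FluidPDE.AxisymQuotientEquationsJ
import Literature.Analysis.FluidPDE.AxisymGradientField
import Literature.Analysis.FluidPDE.KNSSNoAxisymmetricTypeIHolds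
import Literature.Analysis.FluidPDE.AxisymmetricSingularSetOnAxis
import Mathlib.Analysis.FunctionalSpaces.SobolevInequality
import Literature.Analysis.FluidPDE.NSBoundedHigherRegularityOfLemma61
import Literature.Analysis.FluidPDE.SereginEpsilonRegularityHigherHolds
import Mathlib.MeasureTheory.Integral.IntervalIntegral.Basic
import Literature.Analysis.FluidPDE.AxisymPoloidalCutoff
import Literature.Analysis.FluidPDE.Wei2016PoloidalCurl
import Literature.Analysis.FluidPDE.CollapseDebris
import Literature.Analysis.FluidPDE.AxisymPoloidalMoments
import Literature.Analysis.FluidPDE.SqIntegralBalance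
import Literature.Analysis.FluidPDE.HouLiSpaceTime
import Literature.Analysis.FluidPDE.Seregin2022LogSwirlOriginNormalisation
import HarnessLib

/-!
# Seregin 2022 local regularity of axisymmetric solutions, file 6 of 6: the first singular time, the final reduction, normalisation of the classical core, the local cut-off class and the key estimate for the Seregin–Zajaczkowski representative — `seregin2022_logSwirl_regularAtOrigin` HOLDS (re-homed proofs)

**G. Seregin, *A note on local regularity of axisymmetric solutions to the Navier–Stokes equations*, J. Math. Fluid Mech. 24
(2022), Paper 27 = arXiv:2201.00153, Theorem 1.2 via §2 from the swirl decay (2.2) [Seregin2022LocalAxisym]: for a suitable weak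
solution in the unit parabolic cylinder `Q = 𝒞 × ]-1,0[`, axisymmetric, with `v ∈ L_{2,∞}(Q)`, `∇v ∈ L₂(Q)`, `q ∈ L_{3/2}(Q)` and
`|v_θ(x,t)| ≤ C₁ |x'|⁻¹ / ln³(e/|x'|)` off the axis, the origin is a regular point.**  The named fact
`Literature.Analysis.FluidPDE.seregin2022_logSwirl_regularAtOrigin` (`Seregin2022LogSwirlCriterion.lean`) is PROVED in the tree by
the Navier–Stokes cell's `AxisymmetricKatoGlobal` line (Steps 1–4 of §2: reduction to a first singular time and a clean slab with a
smooth axisymmetric representative, the product cut-off, the Leray logarithmic Hardy inequality (Lemma 2.2), Lemma 2.1 and the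
Chen–Fang–Zhang / Lei–Zhang elliptic bounds for `u_r/r`, the `η⁶`-weighted energy estimates of `Γ = ω_θ/r` and `Φ = ω_r/r` with
the swirl source absorbed through (2.2), the key estimate, the Step-4 assembly `C(R) ≤ C R^{3/2} → 0` and ε-regularity) — until now
Summits-side only (`Summits/NavierStokesRegularity/NavierStokesRegularity/Theorems/AxisymmetricExtremalityAxisymmetricKatoGlobalStubSereginLogSwirlOrigin.lean`,
`seregin2022_logSwirl_regularAtOrigin_holds := stub_sereginLogSwirlOrigin`).  RE-HOMED into `Literature/` by the Hodge foundations
lane (`lit-hodgefound`, prover p20, generation 39) as SIX files: verbatim DECLARATION-LEVEL ports (the 312 declarations the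
discharge needs, in dependency order; each Part header lists the declarations of its source module that are NOT carried) of 55
Summits modules `Summits/NavierStokesRegularity/NavierStokesRegularity/Theorems/AxisymmetricExtremalityAxisymmetricKatoGlobalStub*.lean`,
namespaces `Summit.NavierStokesRegularity.NavierStokesRegularity.Theorems.AxisymmetricKatoGlobal{.EulerScaling,.Registered}` re-rooted
to `Literature.Analysis.SereginLogSwirlOrigin{.EulerScaling,.Registered}` (a root outside `Literature.Analysis.FluidPDE` on purpose:
namespace-prefix resolution would otherwise shadow the cone's lemmas by same-named `FluidPDE` lemmas); the sources' `local notation`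
`ℝ³` is expanded textually; imports from `Literature/` and Mathlib only; no `sorry`, no new axiom, NO named fact (D-0026).
PROVENANCE CONVENTION: docstrings are carried byte-for-byte; declarations the cell cites keep their cites; `[folklore]`-tagged and
untagged declarations (the cell's own lemmas) carry the Part's tag `[cite: <Key>, <loc> (source of the ARGUMENT this module
implements; this declaration is the cell's own lemma or plumbing, NOT a printed statement)]`, because the gate does not admit a
public Literature theorem without a cite tag.

THIS FILE (6 of 6) ports: …StubSereginLogSwirlOriginFirstSingular, …StubSereginLogSwirlOriginFinalReduction, …StubAxisBoundedOfLocalEnergyOrigin, …StubSereginLogSwirlOriginCoreNormalise, …StubSereginLogSwirlOriginStep3LocalClass, …StubSeregin2020TypeIINoSwirlCoreCutoff, …StubSereginLogSwirlOriginStep3LocalCutoff, …StubSereginLogSwirlOriginStep3LocalKeyEstimateSZ, …StubSereginLogSwirlOrigin.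
-/

noncomputable section

/-!
## Part 1 — port of `Summits/NavierStokesRegularity/NavierStokesRegularity/Theorems/AxisymmetricExtremalityAxisymmetricKatoGlobalStubSereginLogSwirlOriginFirstSingular.lean` (8 declarations kept)

# Seregin 2022, §2 Step 1, honest form: the first singular time — a backward-singular point of
# the axis with a clean past and the cut-off configuration of Step 1 around it —
# crux stmt-NavierStokesRegularity-15453 (`AxisymmetricExtremality.AxisymmetricKatoGlobal`), line registered, support for stub `stub_sereginLogSwirlOrigin`

Support file (`--supports stmt-NavierStokesRegularity-15453`; theorems only, everything proved)
toward the registered stub `stub_sereginLogSwirlOrigin` = the named fact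
`Literature.Analysis.FluidPDE.seregin2022_logSwirl_regularAtOrigin` (G. Seregin, J. Math. Fluid
Mech. 24 (2022), Paper 27 = arXiv:2201.00153, §2). Step 1 of the printed proof (arXiv p. 5)
chooses a cut-off `η = φ(r)ψ(x₃)ξ(t)` "that takes into account the well known partial regularity
of axisymmetric flows": singular points lie on the axis and form a `𝒫¹`-null set, so "there
exist at least two regular points `z₁ = (0, h₁, 0)` and `z₂ = (0, -h₂, 0)` … cylinders
`Q(zᵢ, δ)` [where `v` is smooth] … one can find `t₀` such that there is no singular point in
`𝒞̄(r₀) × [t₀, t₀ + δ₀²]`", whence `v`, `∇v`, `∇²v` are bounded on `supp ∇η`. Step 3 then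
multiplies the equations of `Φ = ω_r/r`, `Γ = ω_θ/r` by `Φη⁶`, `Γη⁶` and integrates over `𝒞`
up to the top time `t = 0` — which tacitly uses smoothness on `supp η`, not only on `supp ∇η`.
The honest form of the argument is the FIRST SINGULAR TIME: if the origin were singular, the
backward-singular set near it — closed, on the axis, `𝒫¹`-null — has a point `ẑ = (t̂, x̂)` of
least time in a compact box, below which (and around which, at regular heights of the top slice
`t = t̂`) the solution is regular; the energy estimates of Step 3 run on that clean slab with
uniform constants, Step 4 makes `C(R; ẑ) → 0`, and `ẑ` would be regular. This file supplies the
geometric half of that argument for the hypothesis class (H) of the fact (Def. 1.1 in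
`Q = 𝒞 × ]-1, 0[` + axisymmetric slices):

* `backwardSingular_structure` (registered sub-goal) — for `0 < T, X < 1` the set
  `S = {(t, x) | -T ≤ t ≤ 0, ‖x‖ ≤ X, v ∉ L_∞(Q((t,x), r)) ∀ r > 0}` is closed, lies on the axis
  and is `𝒫¹`-null (`Seregin2020.offAxis_regular`, `isParabolicNull_backwardSingular_top`,
  centred regularity of backward-bounded interior points
  `isRegularPoint_of_eLpNorm_parabolicCylinder_lt_top_holds`, nesting of backward cylinders at
  the top time);
* `exists_firstSingular_configuration` (registered sub-goal) — if the origin is backward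
  singular, there are an axis point `ẑ = (t̂, x̂)`, `-1/16 < t̂ ≤ 0`, `|x̂₃| ≤ 1/4`, a scale
  `0 < R ≤ 1/4`, heights `h₋ < x̂₃ < h₊` and `δ > 0` with `[h± - δ, h± + δ] ⊆ [x̂₃ - R, x̂₃ + R]`,
  `h₋ + δ < x̂₃ < h₊ - δ`, such that: `ẑ` is backward singular; every point of the closed
  coordinate cylinder `{r ≤ R, |x₃ - x̂₃| ≤ R}` at the times `t̂ - R² ≤ t < t̂` is a (centred)
  regular point of `v` (clean past); and at the top time `t̂` every point of that cylinder off the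
  axis, or of height within `δ` of `h₊` or `h₋`, is backward regular (the cylinders `Q(zᵢ, δ)` of
  the printed Step 1). First singular point: `exists_clean_first_singular_point_of_isParabolicNull`;
  regular heights: `exists_not_mem_line_of_isParabolicNull`.

The sibling `…StubSereginLogSwirlOriginFinalReduction` turns this into the reduction of the fact
to its classical core (Steps 2–4 on the clean configuration).

## References

* G. Seregin, J. Math. Fluid Mech. 24 (2022), Paper No. 27 = arXiv:2201.00153, §2 Step 1 (arXiv
  p. 5) and Step 3 (pp. 6–7). [`Seregin2022LocalAxisym`]
* L. Caffarelli, R. Kohn, L. Nirenberg, Comm. Pure Appl. Math. 35 (1982), §6 (Theorem B).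
  [`CaffarelliKohnNirenberg1982`]
-/

section Part1

open _root_.MeasureTheory _root_.Set _root_.Function _root_.Filter _root_.Topology _root_.TopologicalSpace
  _root_.Metric
open scoped _root_.NNReal _root_.ENNReal

namespace Literature.Analysis.SereginLogSwirlOrigin.EulerScaling

open Literature.Analysis.FluidPDE Literature.Analysis.FluidPDE.Seregin2020
  Literature.Analysis.FluidPDE.SereginSverak2009

/-! ### Backward boundedness near a point -/

/-- **Backward boundedness propagates to nearby points of no later time** (nesting
`Q(y, r/2) ⊆ Q(z, r)` for `t_z - r²/2 < t_y ≤ t_z`, `dist(x_y, x_z) < r/2`). [folklore]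
[cite: Seregin2022LocalAxisym, §2 proof of Thm. 1.2, Step 1 (arXiv:2201.00153 pp. 4–7) (source of the ARGUMENT this module implements; this declaration is the cell’s own lemma or plumbing, NOT a printed statement)] -/
theorem backwardRegular_of_near
    {v : ℝ → EuclideanSpace ℝ (Fin 3) → EuclideanSpace ℝ (Fin 3)}
    {z y : ℝ × EuclideanSpace ℝ (Fin 3)} {r : ℝ} (hr : 0 < r)
    (hfin : eLpNorm (uncurry v) ∞ (volume.restrict (parabolicCylinder r z)) < ∞)
    (ht : z.1 - r ^ 2 / 2 < y.1) (hty : y.1 ≤ z.1) (hx : dist y.2 z.2 < r / 2) :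
    ∃ ρ > 0, eLpNorm (uncurry v) ∞ (volume.restrict (parabolicCylinder ρ y)) < ∞ := by
  -- adapted from `ancientLimit_backwardSingular_structure` (top-point nesting)
  refine ⟨r / 2, by positivity,
    (eLpNorm_mono_measure _ (Measure.restrict_mono ?_ le_rfl)).trans_lt hfin⟩
  intro w hw
  rw [mem_parabolicCylinder] at hw ⊢
  refine ⟨⟨by nlinarith [hw.1.1], by linarith [hw.1.2]⟩, ?_⟩
  calc dist w.2 z.2 ≤ dist w.2 y.2 + dist y.2 z.2 := dist_triangle _ _ _
    _ < r / 2 + r / 2 := add_lt_add hw.2 hx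
    _ = r := by ring

/-- **Near a (centred) regular point every point is backward regular**: if `v ∈ L_∞(Q*(z, ρ))`
then `v ∈ L_∞(Q(y, ρ/2))` for all `y` with `|t_y - t_z| < ρ²/4`, `dist(x_y, x_z) < ρ/2`.
[folklore]
[cite: Seregin2022LocalAxisym, §2 proof of Thm. 1.2, Step 1 (arXiv:2201.00153 pp. 4–7) (source of the ARGUMENT this module implements; this declaration is the cell’s own lemma or plumbing, NOT a printed statement)] -/
theorem eventually_backwardRegular_of_isRegularPoint
    {v : ℝ → EuclideanSpace ℝ (Fin 3) → EuclideanSpace ℝ (Fin 3)}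
    {z : ℝ × EuclideanSpace ℝ (Fin 3)} (hreg : IsRegularPoint v z) :
    ∀ᶠ y in 𝓝 z, ∃ ρ > 0, eLpNorm (uncurry v) ∞ (volume.restrict (parabolicCylinder ρ y)) < ∞ := by
  -- adapted from `ancientLimit_backwardSingular_structure` (interior-point nesting)
  obtain ⟨ρ, hρ, hfin⟩ := hreg
  have hpos : 0 < min (ρ ^ 2 / 4) (ρ / 2) := lt_min (by positivity) (by positivity)
  filter_upwards [Metric.ball_mem_nhds z hpos] with y hy
  rw [mem_ball, Prod.dist_eq, max_lt_iff, Real.dist_eq, lt_min_iff, lt_min_iff] at hy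
  refine ⟨ρ / 2, by positivity,
    (eLpNorm_mono_measure _ (Measure.restrict_mono ?_ le_rfl)).trans_lt hfin⟩
  intro w hw
  rw [mem_parabolicCylinder] at hw
  rw [mem_parabolicCylinderCentered]
  have h1 := hy.1.1
  rw [abs_lt] at h1
  refine ⟨⟨by nlinarith [hw.1.1, h1.1], by nlinarith [hw.1.2, h1.2]⟩, ?_⟩
  calc dist w.2 z.2 ≤ dist w.2 y.2 + dist y.2 z.2 := dist_triangle _ _ _
    _ < ρ / 2 + ρ / 2 := add_lt_add hw.2 hy.2.2
    _ = ρ := by ring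

/-- A point with `-1 < t < 0` and `‖x‖ < 1` lies in the unit cylinder `Q = 𝒞 × ]-1, 0[`
(`B(0, 1) ⊆ 𝒞`). [folklore]
[cite: Seregin2022LocalAxisym, §2 proof of Thm. 1.2, Step 1 (arXiv:2201.00153 pp. 4–7) (source of the ARGUMENT this module implements; this declaration is the cell’s own lemma or plumbing, NOT a printed statement)] -/
theorem mem_unitParCyl_of_norm_lt {z : ℝ × EuclideanSpace ℝ (Fin 3)} (h1 : -1 < z.1)
    (h2 : z.1 < 0) (h3 : ‖z.2‖ < 1) :
    z ∈ parCyl (0 : ℝ × EuclideanSpace ℝ (Fin 3)) 1 := by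
  have hx : z.2 ∈ spaceCyl (0 : EuclideanSpace ℝ (Fin 3)) 1 :=
    Literature.Analysis.FluidPDE.ball_subset_spaceCyl 0 1 (by rwa [mem_ball, dist_zero_right])
  exact ⟨⟨by simpa using h1, by simpa using h2⟩, hx⟩

/-- **Backward-bounded interior points of `Q` are regular points** (centred cylinders): for the
suitable weak solution `(v, q)` on `Q = 𝒞 × ]-1, 0[`, if `z ∈ Q` and `v ∈ L_∞(Q(z, r))` for some
`r > 0`, then `z` is a regular point of `v` (`isRegularPoint_of_eLpNorm_parabolicCylinder_lt_top_holds`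
applied to a backward cylinder shrunk into `Q`). [folklore]
[cite: Seregin2022LocalAxisym, §2 proof of Thm. 1.2, Step 1 (arXiv:2201.00153 pp. 4–7) (source of the ARGUMENT this module implements; this declaration is the cell’s own lemma or plumbing, NOT a printed statement)] -/
theorem isRegularPoint_of_backwardRegular
    {v : ℝ → EuclideanSpace ℝ (Fin 3) → EuclideanSpace ℝ (Fin 3)}
    {q : ℝ → EuclideanSpace ℝ (Fin 3) → ℝ}
    (hsw : IsSuitableWeakSolutionOn (parCylOpens 0 1) 1 0 v q)
    {z : ℝ × EuclideanSpace ℝ (Fin 3)} (hz : z ∈ parCyl (0 : ℝ × EuclideanSpace ℝ (Fin 3)) 1)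
    {r : ℝ} (hr : 0 < r)
    (hfin : eLpNorm (uncurry v) ∞ (volume.restrict (parabolicCylinder r z)) < ∞) :
    IsRegularPoint v z := by
  -- adapted from `ancientLimit_backwardSingular_structure` (interior points)
  obtain ⟨ε, hε, hεsub⟩ := Metric.isOpen_iff.1 (isOpen_parCyl 0 1) z hz
  set r' : ℝ := min (min r ε) 1 with hr'
  have hr'pos : 0 < r' := lt_min (lt_min hr hε) one_pos
  have hr'r : r' ≤ r := (min_le_left _ _).trans (min_le_left _ _)
  have hr'ε : r' ≤ ε := (min_le_left _ _).trans (min_le_right _ _)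
  have hr'1 : r' ≤ 1 := min_le_right _ _
  have hQsub : parabolicCylinder r' z ⊆
      ((parCylOpens (0 : ℝ × EuclideanSpace ℝ (Fin 3)) 1 :
        Opens (ℝ × EuclideanSpace ℝ (Fin 3))) : Set (ℝ × EuclideanSpace ℝ (Fin 3))) := by
    intro y hy
    refine hεsub ?_
    rw [mem_parabolicCylinder] at hy
    rw [mem_ball, Prod.dist_eq, max_lt_iff, Real.dist_eq]
    have h1 : r' ^ 2 ≤ r' := by nlinarith
    refine ⟨?_, hy.2.trans_le hr'ε⟩
    rw [abs_lt]; constructor <;> linarith [hy.1.1, hy.1.2]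
  have hfin' : eLpNorm (uncurry v) ∞ (volume.restrict (parabolicCylinder r' z)) < ∞ :=
    (eLpNorm_mono_measure _ (Measure.restrict_mono
      (parabolicCylinder_mono hr'pos.le hr'r z) le_rfl)).trans_lt hfin
  exact isRegularPoint_of_eLpNorm_parabolicCylinder_lt_top_holds _ v q hsw z hz r' hr'pos
    hQsub hfin'

/-! ### Points near an axis point -/

/-- In the closed coordinate cylinder `{r ≤ R, |x₃ - c₃| ≤ R}` around an axis point `c`, every
point is within `2R` of `c` (indeed within `√2 R`). [folklore]
[cite: Seregin2022LocalAxisym, §2 proof of Thm. 1.2, Step 1 (arXiv:2201.00153 pp. 4–7) (source of the ARGUMENT this module implements; this declaration is the cell’s own lemma or plumbing, NOT a printed statement)] -/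
theorem norm_sub_le_of_cylRadius_le {x c : EuclideanSpace ℝ (Fin 3)} (hc : cylRadius c = 0)
    {R : ℝ} (h1 : cylRadius x ≤ R) (h2 : |x 2 - c 2| ≤ R) : ‖x - c‖ ≤ 2 * R := by
  obtain ⟨hc0, hc1⟩ := (cylRadius_eq_zero_iff c).1 hc
  have hR : 0 ≤ R := (cylRadius_nonneg x).trans h1
  have hsq : ‖x - c‖ ^ 2 = x 0 ^ 2 + x 1 ^ 2 + (x 2 - c 2) ^ 2 := by
    rw [EuclideanSpace.norm_eq, Real.sq_sqrt (by positivity), Fin.sum_univ_three]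
    simp [hc0, hc1, sq_abs]
  have hcyl : x 0 ^ 2 + x 1 ^ 2 ≤ R ^ 2 := by
    rw [← cylRadius_sq]
    exact pow_le_pow_left₀ (cylRadius_nonneg x) h1 2
  have h3 : (x 2 - c 2) ^ 2 ≤ R ^ 2 := by
    rw [← sq_abs]
    exact pow_le_pow_left₀ (abs_nonneg _) h2 2
  have hle : ‖x - c‖ ^ 2 ≤ (2 * R) ^ 2 := by rw [hsq]; nlinarith
  exact (pow_le_pow_iff_left₀ (norm_nonneg _) (by positivity) two_ne_zero).1 hle

/-- Points `c + h e₃` above an axis point `c` are axis points of height `c₃ + h`. [folklore]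
[cite: Seregin2022LocalAxisym, §2 proof of Thm. 1.2, Step 1 (arXiv:2201.00153 pp. 4–7) (source of the ARGUMENT this module implements; this declaration is the cell’s own lemma or plumbing, NOT a printed statement)] -/
theorem cylRadius_add_smul_eZ_eq_zero {c : EuclideanSpace ℝ (Fin 3)} (hc : cylRadius c = 0)
    (h : ℝ) : cylRadius (c + h • eZ) = 0 ∧ (c + h • eZ) 2 = c 2 + h := by
  obtain ⟨hc0, hc1⟩ := (cylRadius_eq_zero_iff c).1 hc
  refine ⟨(cylRadius_eq_zero_iff _).2 ⟨?_, ?_⟩, ?_⟩ <;> simp [eZ, hc0, hc1]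

/-! ### The backward-singular set near the origin: closed, on the axis, `𝒫¹`-null -/

/-- **Seregin 2022, §2 Step 1: structure of the backward-singular set of `𝒞 × ]-1, 0]` in a
compact box** ("if singular points of an axisymmetric velocity field `v` exist, they must belong
to the axis of symmetry … the 1D parabolic Hausdorff measure of the set of singular points is
equal to zero", top time included). For the Def.-1.1 class in `Q = 𝒞 × ]-1, 0[` with
axisymmetric slices and `0 < T, X < 1`, the set `S` of points `z = (t, x)` with `-T ≤ t ≤ 0`,
`‖x‖ ≤ X` at which `v` is essentially unbounded on every backward cylinder `Q(z, r)` is closed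
(interior points: a backward-bounded point is a centred regular point,
`isRegularPoint_of_eLpNorm_parabolicCylinder_lt_top_holds`, and regular points have backward
regular neighbours; top points `t = 0`: nesting of backward cylinders), lies on the axis
(`Seregin2020.offAxis_regular`) and is `𝒫¹`-null (`isParabolicNull_backwardSingular_top`).
[cite: Seregin2022LocalAxisym, §2 Step 1 (arXiv:2201.00153 p. 5)] -/
theorem backwardSingular_structure : ∀ (v : ℝ → EuclideanSpace ℝ (Fin 3) → EuclideanSpace ℝ (Fin 3)) (q : ℝ → EuclideanSpace ℝ (Fin 3) → ℝ) (G : ℝ → EuclideanSpace ℝ (Fin 3) → EuclideanSpace ℝ (Fin 3) →L[ℝ] EuclideanSpace ℝ (Fin 3)), IsSuitableWeakSolutionOn (SereginSverak2009.parCylOpens 0 1) 1 0 v q → (∃ C : ℝ≥0, ∀ᵐ t ∂(volume.restrict (Ioo (-1 : ℝ) 0)), ∫⁻ x in SereginSverak2009.spaceCyl 0 1, ‖v t x‖ₑ ^ 2 ≤ C) → HasWeakSpatialGradientOn (SereginSverak2009.parCylOpens 0 1) v G → (∫⁻ z in SereginSverak2009.parCyl 0 1, ENNReal.ofReal (frobeniusNormSq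 (G z.1 z.2)) < ∞) → (∫⁻ z in SereginSverak2009.parCyl 0 1, ‖q z.1 z.2‖ₑ ^ (3 / 2 : ℝ) < ∞) → (∀ t ∈ Ioo (-1 : ℝ) 0, IsAxisymmetric (v t)) → ∀ (T X : ℝ), 0 < T → T < 1 → 0 < X → X < 1 → IsClosed {z : ℝ × EuclideanSpace ℝ (Fin 3) | z.1 ∈ Icc (-T) 0 ∧ ‖z.2‖ ≤ X ∧ ¬ ∃ r > 0, eLpNorm (uncurry v) ∞ (volume.restrict (parabolicCylinder r z)) < ∞} ∧ (∀ z ∈ {z : ℝ × EuclideanSpace ℝ (Fin 3) | z.1 ∈ Icc (-T) 0 ∧ ‖z.2‖ ≤ X ∧ ¬ ∃ r > 0, eLpNorm (uncurry v) ∞ (volume.restrict (parabolicCylinder r z)) < ∞}, cylRadius z.2 = 0) ∧ IsParabolicNull 1 {z : ℝ × EuclideanSpace ℝ (Fin 3) | z.1 ∈ Icc (-T) 0 ∧ ‖z.2‖ ≤ X ∧ ¬ ∃ r > 0, eLpNorm (uncurry v) ∞ (volume.restrict (parabolicCylinder r z)) < ∞} := by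
  intro v q G hsw hA hG hE hq hax T X hT hT1 hX hX1
  -- the box lies in `𝒞 × ]-1, 0]`
  have hwin : ∀ z : ℝ × EuclideanSpace ℝ (Fin 3), z.1 ∈ Icc (-T) 0 → ‖z.2‖ ≤ X →
      z.1 ∈ Ioc (-1 : ℝ) 0 ∧ z.2 ∈ spaceCyl (0 : EuclideanSpace ℝ (Fin 3)) 1 := fun z hz1 hz2 =>
    ⟨⟨by linarith [hz1.1], hz1.2⟩, Literature.Analysis.FluidPDE.ball_subset_spaceCyl 0 1
      (by rw [mem_ball, dist_zero_right]; linarith)⟩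
  refine ⟨?_, fun z hz => ?_, ?_⟩
  · -- ### closedness: the complement is open
    rw [← isOpen_compl_iff, Metric.isOpen_iff]
    intro z hz
    rw [mem_compl_iff, mem_setOf_eq] at hz
    by_cases h1 : z.1 ∈ Icc (-T) 0
    swap
    · -- outside the time window (an open condition)
      have ho : IsOpen {y : ℝ × EuclideanSpace ℝ (Fin 3) | y.1 ∈ Icc (-T) 0}ᶜ :=
        (isClosed_Icc.preimage continuous_fst).isOpen_compl
      obtain ⟨ε, hε, hsub⟩ := Metric.isOpen_iff.1 ho z h1
      exact ⟨ε, hε, fun y hy hyS => hsub hy hyS.1⟩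
    by_cases h2 : ‖z.2‖ ≤ X
    swap
    · -- outside the ball (an open condition)
      have ho : IsOpen {y : ℝ × EuclideanSpace ℝ (Fin 3) | ‖y.2‖ ≤ X}ᶜ :=
        (isClosed_le (continuous_norm.comp continuous_snd) continuous_const).isOpen_compl
      obtain ⟨ε, hε, hsub⟩ := Metric.isOpen_iff.1 ho z h2
      exact ⟨ε, hε, fun y hy hyS => hsub hy hyS.2.1⟩
    have hreg : ∃ r > 0, eLpNorm (uncurry v) ∞ (volume.restrict (parabolicCylinder r z)) < ∞ := by
      by_contra hcon
      exact hz ⟨h1, h2, hcon⟩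
    obtain ⟨r, hr, hfin⟩ := hreg
    rcases h1.2.lt_or_eq with hlt | heq
    · -- interior point: centred regularity, then backward regular neighbours
      have hzQ : z ∈ parCyl (0 : ℝ × EuclideanSpace ℝ (Fin 3)) 1 :=
        mem_unitParCyl_of_norm_lt (by linarith [h1.1]) hlt (by linarith)
      have hregc : IsRegularPoint v z := isRegularPoint_of_backwardRegular hsw hzQ hr hfin
      obtain ⟨ε, hε, hsub⟩ := Metric.eventually_nhds_iff_ball.1
        (eventually_backwardRegular_of_isRegularPoint hregc)
      exact ⟨ε, hε, fun y hy hyS => hyS.2.2 (hsub y hy)⟩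
    · -- top point: nesting of backward cylinders
      refine ⟨min (r ^ 2 / 2) (r / 2), lt_min (by positivity) (by positivity), fun y hy hyS => ?_⟩
      rw [mem_ball, Prod.dist_eq, max_lt_iff, Real.dist_eq, lt_min_iff, lt_min_iff] at hy
      have ht := hy.1.1
      rw [abs_lt] at ht
      have hy0 : y.1 ≤ z.1 := heq ▸ hyS.1.2
      exact hyS.2.2 (backwardRegular_of_near hr hfin (by linarith [ht.1]) hy0 hy.2.2)
  · -- ### on the axis: off-axis points are backward regular up to the top
    obtain ⟨hz1, hz2, hsing⟩ := hz
    by_contra hoff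
    have hoff' : 0 < cylRadius z.2 := (cylRadius_nonneg _).lt_of_ne (Ne.symm hoff)
    obtain ⟨ht, hx⟩ := hwin z hz1 hz2
    obtain ⟨r, hr, hfin⟩ := offAxis_regular hsw hA hG hE hq hax ht hx hoff'
    exact hsing ⟨r, hr, hfin⟩
  · -- ### `𝒫¹`-nullity: a subset of the backward-singular set of `𝒞 × ]-1, 0]`
    refine (isParabolicNull_backwardSingular_top v q G hsw hA hG hE hq).mono ?_
    rintro z ⟨hz1, hz2, hsing⟩
    exact ⟨(hwin z hz1 hz2).1, (hwin z hz1 hz2).2, hsing⟩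

/-! ### The first singular point and the Step-1 configuration around it -/

/-- **Seregin 2022, §2 Step 1 in first-singular-time form.** Let `(v, q)` be in the Def.-1.1
class in `Q = 𝒞 × ]-1, 0[` with a weak gradient `G ∈ L₂(Q)` and axisymmetric slices, and suppose
the origin is backward singular (`v ∉ L_∞(Q((0,0), r))` for every `r > 0`). Then there are an
axis point `ẑ = (t̂, x̂)` with `-1/16 < t̂ ≤ 0`, `|x̂₃| ≤ 1/4`, a scale `0 < R ≤ 1/4`, heights
`h₊`, `h₋` and `δ > 0` with `x̂₃ - R ≤ h₋ - δ`, `h₋ + δ < x̂₃ < h₊ - δ`, `h₊ + δ ≤ x̂₃ + R`, such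
that (i) `ẑ` is backward singular; (ii) CLEAN PAST: every `z = (t, x)` with `t̂ - R² ≤ t < t̂`,
`|x'| ≤ R`, `|x₃ - x̂₃| ≤ R` is a regular point of `v` (first singular time in a compact box,
`exists_clean_first_singular_point_of_isParabolicNull` for the closed, axial, `𝒫¹`-null set of
`backwardSingular_structure`, then centred regularity of backward-bounded interior points);
(iii) TOP SLICE: every `x` with `|x'| ≤ R`, `|x₃ - x̂₃| ≤ R` which is off the axis
(`Seregin2020.offAxis_regular`) or has height within `δ` of `h₊` or of `h₋` (regular heights exist
on every segment since a `𝒫¹`-null set contains no segment, `exists_not_mem_line_of_isParabolicNull`;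
these are the printed "two regular points `z₁ = (0, h₁, 0)`, `z₂ = (0, -h₂, 0)` … cylinders
`Q(zᵢ, δ)`") is backward regular at time `t̂`. This is the configuration on which the cut-off
`η = φ(r)ψ(x₃)ξ(t)` of Step 1 is built with `v` smooth on `supp ∇η` up to the top time and on
`supp η` strictly below it.
[cite: Seregin2022LocalAxisym, §2 Step 1 (arXiv:2201.00153 p. 5)] -/
theorem exists_firstSingular_configuration : ∀ (v : ℝ → EuclideanSpace ℝ (Fin 3) → EuclideanSpace ℝ (Fin 3)) (q : ℝ → EuclideanSpace ℝ (Fin 3) → ℝ) (G : ℝ → EuclideanSpace ℝ (Fin 3) → EuclideanSpace ℝ (Fin 3) →L[ℝ] EuclideanSpace ℝ (Fin 3)), IsSuitableWeakSolutionOn (SereginSverak2009.parCylOpens 0 1) 1 0 v q → (∃ C : ℝ≥0, ∀ᵐ t ∂(volume.restrict (Ioo (-1 : ℝ) 0)), ∫⁻ x in SereginSverak2009.spaceCyl 0 1, ‖v t x‖ₑ ^ 2 ≤ C) → HasWeakSpatialGradientOn (SereginSverak2009.parCylOpens 0 1) v G → (∫⁻ z in SereginSverak2009.parCyl 0 1,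 ENNReal.ofReal (frobeniusNormSq (G z.1 z.2)) < ∞) → (∫⁻ z in SereginSverak2009.parCyl 0 1, ‖q z.1 z.2‖ₑ ^ (3 / 2 : ℝ) < ∞) → (∀ t ∈ Ioo (-1 : ℝ) 0, IsAxisymmetric (v t)) → (¬ ∃ r > 0, eLpNorm (uncurry v) ∞ (volume.restrict (parabolicCylinder r (0 : ℝ × EuclideanSpace ℝ (Fin 3)))) < ∞) → ∃ (zc : ℝ × EuclideanSpace ℝ (Fin 3)) (R hp hm δ : ℝ), zc.1 ∈ Ioc (-1 / 16 : ℝ) 0 ∧ cylRadius zc.2 = 0 ∧ |zc.2 2| ≤ 1 / 4 ∧ 0 < R ∧ R ≤ 1 / 4 ∧ (¬ ∃ r > 0, eLpNorm (uncurry v) ∞ (volume.restrict (parabolicCylinder r zc)) < ∞) ∧ (∀ z : ℝ × EuclideanSpace ℝ (Fin 3), zc.1 - R ^ 2 ≤ z.1 → z.1 < zc.1 → cylRadius z.2 ≤ R → |z.2 2 - zc.2 2| ≤ R → IsRegularPoint v z) ∧ 0 < δ ∧ zc.2 2 - R ≤ hm - δ ∧ hm + δ < zc.2 2 ∧ zc.2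 2 < hp - δ ∧ hp + δ ≤ zc.2 2 + R ∧ (∀ x : EuclideanSpace ℝ (Fin 3), cylRadius x ≤ R → |x 2 - zc.2 2| ≤ R → (0 < cylRadius x ∨ |x 2 - hp| < δ ∨ |x 2 - hm| < δ) → ∃ r > 0, eLpNorm (uncurry v) ∞ (volume.restrict (parabolicCylinder r (zc.1, x))) < ∞) := by
  intro v q G hsw hA hG hE hq hax hsing
  obtain ⟨hclosed, haxis, hnull⟩ := backwardSingular_structure v q G hsw hA hG hE hq hax
    (1 / 16) (1 / 2) (by norm_num) (by norm_num) (by norm_num) (by norm_num)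
  -- ### the first singular point below the origin
  obtain ⟨zc, hzcS, R, hR, hRδ, hzc1, hzcd, hclean⟩ :=
    exists_clean_first_singular_point_of_isParabolicNull _ hclosed haxis hnull 0
      ⟨⟨by norm_num, le_rfl⟩, by simp, hsing⟩ (1 / 8) (by norm_num)
  obtain ⟨hzc_t, hzc_n, hzc_sing⟩ := hzcS
  have hzc0 : cylRadius zc.2 = 0 := haxis zc ⟨hzc_t, hzc_n, hzc_sing⟩
  have ht1 : -(1 / 64 : ℝ) < zc.1 := by have h := hzc1.1; norm_num at h; linarith
  have ht2 : zc.1 ≤ 0 := hzc_t.2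
  have hxn : ‖zc.2‖ < 1 / 8 := by simpa using hzcd
  have hx3 : |zc.2 2| ≤ ‖zc.2‖ := by simpa using PiLp.norm_apply_le zc.2 2
  -- ### the scale
  set R' : ℝ := R / 2 with hR'
  have hR'pos : 0 < R' := by positivity
  have hR'le : R' ≤ 1 / 16 := by rw [hR']; linarith
  -- ### two regular heights on the top slice
  -- `‖e₃‖ = 1` (in tree as `Literature.Barriers.NavierStokesRegularity.norm_eZ_eq_one`, not imported)
  have norm_eZ : ‖(eZ : EuclideanSpace ℝ (Fin 3))‖ = 1 := by
    rw [EuclideanSpace.norm_eq, Fin.sum_univ_three]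
    simp [eZ]
  obtain ⟨a, ha, hnotS⟩ := exists_not_mem_line_of_isParabolicNull _ hnull zc.1 zc.2 eZ norm_eZ
    (R' / 4) (3 * R' / 4) (by linarith)
  obtain ⟨b, hb, hnotS'⟩ := exists_not_mem_line_of_isParabolicNull _ hnull zc.1 zc.2 eZ norm_eZ
    (-(3 * R' / 4)) (-(R' / 4)) (by linarith)
  obtain ⟨hpa0, hpa2⟩ := cylRadius_add_smul_eZ_eq_zero hzc0 a
  obtain ⟨hpb0, hpb2⟩ := cylRadius_add_smul_eZ_eq_zero hzc0 b
  have hsegreg : ∀ c : ℝ, |c| < R' → (zc.1, zc.2 + c • eZ) ∉ {z : ℝ × EuclideanSpace ℝ (Fin 3) |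
      z.1 ∈ Icc (-(1 / 16 : ℝ)) 0 ∧ ‖z.2‖ ≤ 1 / 2 ∧
        ¬ ∃ r > 0, eLpNorm (uncurry v) ∞ (volume.restrict (parabolicCylinder r z)) < ∞} →
      ∃ r > 0, eLpNorm (uncurry v) ∞
        (volume.restrict (parabolicCylinder r ((zc.1, zc.2 + c • eZ) : ℝ × _))) < ∞ := by
    intro c hc hnot
    by_contra hcon
    refine hnot ⟨⟨by linarith, ht2⟩, ?_, hcon⟩
    calc ‖zc.2 + c • eZ‖ ≤ ‖zc.2‖ + ‖c • eZ‖ := norm_add_le _ _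
      _ = ‖zc.2‖ + |c| := by rw [norm_smul, norm_eZ, mul_one, Real.norm_eq_abs]
      _ ≤ 1 / 2 := by linarith
  obtain ⟨rp, hrp, hfinp⟩ := hsegreg a (by rw [abs_lt]; constructor <;> linarith [ha.1, ha.2]) hnotS
  obtain ⟨rm, hrm, hfinm⟩ := hsegreg b (by rw [abs_lt]; constructor <;> linarith [hb.1, hb.2]) hnotS'
  -- ### the width of the strips
  set δ : ℝ := min (min (rp / 4) (rm / 4)) (R' / 8) with hδ
  have hδpos : 0 < δ := lt_min (lt_min (by positivity) (by positivity)) (by positivity)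
  have hδp : δ ≤ rp / 4 := (min_le_left _ _).trans (min_le_left _ _)
  have hδm : δ ≤ rm / 4 := (min_le_left _ _).trans (min_le_right _ _)
  have hδR : δ ≤ R' / 8 := min_le_right _ _
  refine ⟨zc, R', zc.2 2 + a, zc.2 2 + b, δ, ⟨by linarith, ht2⟩, hzc0,
    by linarith [hx3], hR'pos, by linarith, hzc_sing, ?_, hδpos, by linarith [hb.1],
    by linarith [hb.2], by linarith [ha.1], by linarith [ha.2], ?_⟩
  · -- ### (ii) the clean past
    intro z hzt1 hzt2 hzR hz3
    have hnorm : ‖z.2 - zc.2‖ ≤ 2 * R' := norm_sub_le_of_cylRadius_le hzc0 hzR hz3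
    have hzn : ‖z.2‖ ≤ 1 / 4 := by linarith [norm_sub_norm_le z.2 zc.2]
    have hR'sq1 : R' ^ 2 ≤ (1 / 16 : ℝ) ^ 2 := pow_le_pow_left₀ hR'pos.le hR'le 2
    have hreg : ∃ r > 0, eLpNorm (uncurry v) ∞ (volume.restrict (parabolicCylinder r z)) < ∞ := by
      by_contra hcon
      have hR'sq : R' ^ 2 ≤ R ^ 2 := by rw [hR']; nlinarith
      have hzS : z ∈ {z : ℝ × EuclideanSpace ℝ (Fin 3) | z.1 ∈ Icc (-(1 / 16 : ℝ)) 0 ∧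
          ‖z.2‖ ≤ 1 / 2 ∧
          ¬ ∃ r > 0, eLpNorm (uncurry v) ∞ (volume.restrict (parabolicCylinder r z)) < ∞} :=
        ⟨⟨by linarith, by linarith⟩, by linarith, hcon⟩
      have h := hclean z hzS (by rw [dist_eq_norm]; linarith) (by linarith) hzt2.le
      exact absurd h.1 hzt2.ne
    obtain ⟨r, hr, hfin⟩ := hreg
    exact isRegularPoint_of_backwardRegular hsw
      (mem_unitParCyl_of_norm_lt (by linarith) (by linarith) (by linarith)) hr hfin
  · -- ### (iii) the top slice: off the axis, and the two strips
    intro x hxR hx3' hdisj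
    by_cases hx0 : 0 < cylRadius x
    · have ht : ((zc.1, x) : ℝ × EuclideanSpace ℝ (Fin 3)).1 ∈ Ioc (-1 : ℝ) 0 :=
        ⟨by simp only; linarith, ht2⟩
      have hx : ((zc.1, x) : ℝ × EuclideanSpace ℝ (Fin 3)).2 ∈
          spaceCyl (0 : EuclideanSpace ℝ (Fin 3)) 1 := by
        rw [mem_spaceCyl, sub_zero]
        refine ⟨by simp only; linarith, ?_⟩
        have h3 : |x 2| ≤ |x 2 - zc.2 2| + |zc.2 2| := by
          simpa using abs_add_le (x 2 - zc.2 2) (zc.2 2)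
        simpa using (show |x 2| < 1 by linarith)
      obtain ⟨r, hr, hfin⟩ := offAxis_regular hsw hA hG hE hq hax ht hx hx0
      exact ⟨r, hr, hfin⟩
    · have hx0' : cylRadius x = 0 := le_antisymm (not_lt.1 hx0) (cylRadius_nonneg x)
      rcases hdisj with h | h | h
      · exact absurd h hx0
      · refine backwardRegular_of_near hrp hfinp (y := (zc.1, x)) ?_ le_rfl ?_
        · show zc.1 - rp ^ 2 / 2 < zc.1
          linarith [pow_pos hrp 2]
        · show dist x (zc.2 + a • eZ) < rp / 2
          rw [dist_eq_abs_sub_of_cylRadius_eq_zero hx0' hpa0, hpa2]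
          linarith
      · refine backwardRegular_of_near hrm hfinm (y := (zc.1, x)) ?_ le_rfl ?_
        · show zc.1 - rm ^ 2 / 2 < zc.1
          linarith [pow_pos hrm 2]
        · show dist x (zc.2 + b • eZ) < rm / 2
          rw [dist_eq_abs_sub_of_cylRadius_eq_zero hx0' hpb0, hpb2]
          linarith

end Literature.Analysis.SereginLogSwirlOrigin.EulerScaling

end Part1

/-!
## Part 2 — port of `Summits/NavierStokesRegularity/NavierStokesRegularity/Theorems/AxisymmetricExtremalityAxisymmetricKatoGlobalStubSereginLogSwirlOriginFinalReduction.lean` (4 declarations kept)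

# Seregin 2022, §2: reduction of the local regularity criterion to its classical core by the
# first-singular-time argument —
# crux stmt-NavierStokesRegularity-15453 (`AxisymmetricExtremality.AxisymmetricKatoGlobal`), line registered, support for stub `stub_sereginLogSwirlOrigin`

Support file (`--supports stmt-NavierStokesRegularity-15453`; theorems only, everything proved)
toward the registered stub `stub_sereginLogSwirlOrigin` = the named fact
`Literature.Analysis.FluidPDE.seregin2022_logSwirl_regularAtOrigin` (G. Seregin, J. Math. Fluid
Mech. 24 (2022), Paper 27 = arXiv:2201.00153, §2: Def. 1.1 in `Q = 𝒞 × ]-1, 0[` + axial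
symmetry + the swirl bound (2.2) `|σ| ≤ C₁/ln³(e/|x'|)` ⇒ the origin is a regular point).

The printed proof fixes in Step 1 (arXiv p. 5) a cut-off `η = φ(r)ψ(x₃)ξ(t)` adapted to the
partial regularity of `v` (`v` smooth on `supp ∇η`: off the axis, on a singularity-free slab in
time, and near two regular axis points `(0, ±h, 0)` of the top slice), and then runs the energy
estimates of Step 3 for `Φ = ω_r/r`, `Γ = ω_θ/r` "multiplied by `Φη⁶`, `Γη⁶` and integrated over
`𝒞`" up to the top time. That integration by parts needs `v` smooth on `supp η` at the times
considered, i.e. it is legitimate only up to the FIRST SINGULAR TIME inside `supp η`; the honest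
form of Steps 1–4 is therefore: *if the origin were singular, take a backward-singular axis point
`ẑ = (t̂, x̂)` of least time in a compact box near the origin (the singular set is closed, on the
axis and `𝒫¹`-null); below `t̂` and on `supp ∇η` up to `t̂` the solution is smooth, the key
estimate of Step 3 holds on `]t̂ - R², t̂[` with constants that stay bounded up to `t̂`, Step 4
gives `C(ρ; ẑ) → 0`, and the ε-regularity criterion makes `ẑ` regular — a contradiction.*

This file proves that reduction for the exact hypothesis block (H) of the fact:

* `seregin2022_regularAtOrigin_of_forall_clean` (registered sub-goal) — **(H) and the classical
  core imply `IsRegularAtOrigin v`.** The core `hcore` is the fully written-out hypothesis: for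
  every axis point `ẑ = (t̂, x̂)` with `-1/16 < t̂ ≤ 0`, `|x̂₃| ≤ 1/4`, every scale
  `0 < R ≤ 1/4`, heights `h₋ < x̂₃ < h₊` and width `δ > 0` (`x̂₃ - R ≤ h₋ - δ`,
  `h₋ + δ < x̂₃ < h₊ - δ`, `h₊ + δ ≤ x̂₃ + R`) such that (C1) every point of the closed
  coordinate cylinder `{|x'| ≤ R, |x₃ - x̂₃| ≤ R}` at the times `t̂ - R² ≤ t < t̂` is a regular
  point of `v` and (C2) at the top time `t̂` every point of that cylinder off the axis or of
  height within `δ` of `h₊` or `h₋` is backward regular, the point `ẑ` is backward regular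
  (`v ∈ L_∞(Q(ẑ, r))` for some `r > 0`). (C1)–(C2) are exactly the smoothness that Step 1
  provides for the cut-off `η = φ(r)ψ(x₃)ξ(t)` at `(ẑ, R)` (`ψ' ≠ 0` only in the two strips,
  `φ' ≠ 0` only off the axis, `ξ' ≠ 0` only strictly below `t̂`), so `hcore` is what Steps 2–4
  prove (in this namespace: Lemma 2.1 `…Lemma21Local*`, `…CFZBounds`, the Step-3 key estimate
  `cutoff_energy_keyEstimate_of_lemma21`, Step 4 `…Step4AssemblyPoloidal`, `…VThetaPassage`,
  and the endgame `isRegularAtOrigin_of_tendsto_cubicC`).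
  Proof: `exists_firstSingular_configuration` (sibling `…FirstSingular`) + `hcore`.
* `seregin2022_regularAtOrigin_of_forall_cleanRepr` (registered sub-goal) — the same with the
  core in CLASSICAL form `hcoreV`: for `ẑ, R, h±, δ` as above and a representative `V` of `v` on
  the slab `Q(ẑ, R) = 𝒞(x̂, R) × ]t̂ - R², t̂[` with `(V, q)` a sufficiently smooth axially
  symmetric solution there (Seregin–Zajaczkowski class: suitable, axisymmetric, slices `C^∞`,
  spatial derivatives locally Hölder) whose spatial derivatives of every order are bounded up
  to the top time near each top-slice point off the axis or in the two strips, `ẑ` is backward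
  regular. Proof: the primitive form + `exists_cleanSlab_repr` (sibling `…CleanSlabRepr`).
* `isRegularAtOrigin_iff_backwardRegular_zero` — Seregin–Šverák's "regular origin"
  (`v ∈ L_∞(𝒞(r) × ]-r², 0[)`) is backward regularity of `(0, 0)` in ball cylinders.
* `seregin2022_logSwirl_regularAtOrigin_of_cleanCore`, `…_of_cleanRepr` — the same reductions
  with the core quantified over the class: the named fact follows from the classical core.

## References

* G. Seregin, J. Math. Fluid Mech. 24 (2022), Paper No. 27 = arXiv:2201.00153, §2 Steps 1–4
  (arXiv pp. 5–7), Def. 1.1, Thm. 1.2. [`Seregin2022LocalAxisym`]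
* G. Seregin, V. Šverák, Comm. PDE 34 (2009) = arXiv:0804.1803, §3 (regular points).
  [`SereginSverak2009`]

Not carried from this source module (not needed by the declarations re-homed here; their consumers are Summits-side): `seregin2022_logSwirl_regularAtOrigin_of_cleanCore`.
-/

section Part2

open _root_.MeasureTheory _root_.Set _root_.Function _root_.Filter _root_.Topology _root_.TopologicalSpace
  _root_.Metric
open scoped _root_.NNReal _root_.ENNReal

namespace Literature.Analysis.SereginLogSwirlOrigin.EulerScaling

open Literature.Analysis.FluidPDE Literature.Analysis.FluidPDE.SereginSverak2009
  Literature.Analysis.FluidPDE.SereginZajaczkowski2007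

/-! ### Regular origin and backward regularity of `(0, 0)` -/

/-- **Seregin–Šverák's regularity of the origin is backward regularity of `(0, 0)`**:
`v ∈ L_∞(Q(0, r))` for some `r > 0` (coordinate cylinders `𝒞(r) × ]-r², 0[`) iff
`v ∈ L_∞(Q_r(0, 0))` for some `r > 0` (ball cylinders), by `Q_r ⊆ Q(0, r)` and
`Q(0, r/2) ⊆ Q_{r/√2} ⊆ Q_r`. [cite: SereginSverak2009, §3 (definition of regular point, arXiv p. 9)] -/
theorem isRegularAtOrigin_iff_backwardRegular_zero
    {v : ℝ → EuclideanSpace ℝ (Fin 3) → EuclideanSpace ℝ (Fin 3)} :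
    IsRegularAtOrigin v ↔ ∃ r > 0, eLpNorm (uncurry v) ∞
      (volume.restrict (parabolicCylinder r (0 : ℝ × EuclideanSpace ℝ (Fin 3)))) < ∞ := by
  constructor
  · rintro ⟨r, hr, hfin⟩
    exact ⟨r, hr, (eLpNorm_mono_measure _ (Measure.restrict_mono
      (parabolicCylinder_subset_parCyl 0 r) le_rfl)).trans_lt hfin⟩
  · rintro ⟨r, hr, hfin⟩
    refine ⟨r / 2, by positivity,
      (eLpNorm_mono_measure _ (Measure.restrict_mono ?_ le_rfl)).trans_lt hfin⟩
    refine (parCyl_subset_parabolicCylinder 0 (by positivity : (0 : ℝ) ≤ r / 2)).trans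
      (parabolicCylinder_mono (by positivity) ?_ 0)
    have h2 : Real.sqrt 2 ≤ 2 := by
      have h := Real.sqrt_le_sqrt (show (2 : ℝ) ≤ 2 ^ 2 by norm_num)
      rwa [Real.sqrt_sq (by norm_num : (0 : ℝ) ≤ 2)] at h
    nlinarith

/-! ### The reduction -/

/-- **Seregin 2022, §2: the local regularity criterion reduced to its classical core by the
first-singular-time argument.** Let `(v, q)` satisfy the hypotheses (H) of the fact
`seregin2022_logSwirl_regularAtOrigin` (Def. 1.1 in `Q = 𝒞 × ]-1, 0[` with the global classes,
axisymmetric slices `v t`, `q t`, and the swirl bound (2.2)). Assume the CORE `hcore`: whenever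
`ẑ = (t̂, x̂)` is an axis point with `-1/16 < t̂ ≤ 0`, `|x̂₃| ≤ 1/4`, `0 < R ≤ 1/4`, `h₊, h₋, δ`
are heights and a width with `x̂₃ - R ≤ h₋ - δ`, `h₋ + δ < x̂₃ < h₊ - δ`, `h₊ + δ ≤ x̂₃ + R`,
such that (C1) every `(t, x)` with `t̂ - R² ≤ t < t̂`, `|x'| ≤ R`, `|x₃ - x̂₃| ≤ R` is a regular
point of `v` (clean past: `v` smooth on the slab below `t̂`) and (C2) every `x` with `|x'| ≤ R`,
`|x₃ - x̂₃| ≤ R` which is off the axis or has `|x₃ - h₊| < δ` or `|x₃ - h₋| < δ` is a backward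
regular point `(t̂, x)` (smoothness on `supp ∇η` up to the top time for the Step-1 cut-off
`η = φ(r)ψ(x₃)ξ(t)` at `(ẑ, R)`), then `v ∈ L_∞(Q(ẑ, r))` for some `r > 0` — this is what
Steps 2–4 establish on such a configuration. Then the origin is a regular point of `v`.
Proof: otherwise `(0, 0)` is backward singular (`isRegularAtOrigin_iff_backwardRegular_zero`),
`exists_firstSingular_configuration` produces a backward-SINGULAR `ẑ` with data satisfying
(C1)–(C2), and `hcore` makes it regular.
[cite: Seregin2022LocalAxisym, §2 proof of Thm. 1.2, Steps 1–4 (arXiv:2201.00153 pp. 5–7)] -/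
theorem seregin2022_regularAtOrigin_of_forall_clean : ∀ (v : ℝ → EuclideanSpace ℝ (Fin 3) → EuclideanSpace ℝ (Fin 3)) (q : ℝ → EuclideanSpace ℝ (Fin 3) → ℝ), IsSuitableWeakSolutionOn (SereginSverak2009.parCylOpens 0 1) 1 0 v q → (∃ C : ℝ≥0, ∀ᵐ t ∂(volume.restrict (Ioo (-1 : ℝ) 0)), ∫⁻ x in SereginSverak2009.spaceCyl 0 1, ‖v t x‖ₑ ^ 2 ≤ C) → (∃ G : ℝ → EuclideanSpace ℝ (Fin 3) → EuclideanSpace ℝ (Fin 3) →L[ℝ] EuclideanSpace ℝ (Fin 3), HasWeakSpatialGradientOn (SereginSverak2009.parCylOpens 0 1) v G ∧ ∫⁻ z in SereginSverak2009.parCyl 0 1, ENNReal.ofReal (frobeniusNormSq (G z.1 z.2)) < ∞) → (∫⁻ z in SereginSverak2009.parCyl 0 1, ‖q z.1 z.2‖ₑ ^ (3 / 2 : ℝ) < ∞) → (∀ t ∈ Ioo (-1 : ℝ) 0, IsAxisymmetric (v t)) → (∀ t ∈ Ioo (-1 : ℝ) 0, IsAxisymmetricScalar (q t)) → (∃ C₁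 : ℝ, ∀ t ∈ Ioo (-1 : ℝ) 0, ∀ x ∈ SereginSverak2009.spaceCyl 0 1, 0 < cylRadius x → |swirl (v t) x| ≤ C₁ / Real.log (Real.exp 1 / cylRadius x) ^ 3) → (∀ (zc : ℝ × EuclideanSpace ℝ (Fin 3)) (R hp hm δ : ℝ), zc.1 ∈ Ioc (-1 / 16 : ℝ) 0 → cylRadius zc.2 = 0 → |zc.2 2| ≤ 1 / 4 → 0 < R → R ≤ 1 / 4 → (∀ z : ℝ × EuclideanSpace ℝ (Fin 3), zc.1 - R ^ 2 ≤ z.1 → z.1 < zc.1 → cylRadius z.2 ≤ R → |z.2 2 - zc.2 2| ≤ R → IsRegularPoint v z) → 0 < δ → zc.2 2 - R ≤ hm - δ → hm + δ < zc.2 2 → zc.2 2 < hp - δ → hp + δ ≤ zc.2 2 + R → (∀ x : EuclideanSpace ℝ (Fin 3), cylRadius x ≤ R → |x 2 - zc.2 2| ≤ R → (0 < cylRadius x ∨ |x 2 - hp| < δ ∨ |x 2 - hm| < δ) → ∃ r > 0, eLpNorm (uncurry v) ∞ (volume.restrict (parabolicCylinder r (zc.1, x))) < ∞) → ∃ r >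 0, eLpNorm (uncurry v) ∞ (volume.restrict (parabolicCylinder r zc)) < ∞) → SereginSverak2009.IsRegularAtOrigin v := by
  intro v q hsw hA hG hq hv_ax _hq_ax _hσ hcore
  obtain ⟨G, hG, hE⟩ := hG
  by_contra hnot
  have hsing : ¬ ∃ r > 0, eLpNorm (uncurry v) ∞
      (volume.restrict (parabolicCylinder r (0 : ℝ × EuclideanSpace ℝ (Fin 3)))) < ∞ :=
    fun h => hnot (isRegularAtOrigin_iff_backwardRegular_zero.2 h)
  obtain ⟨zc, R, hp, hm, δ, h1, h2, h3, h4, h5, hzc, hC1, h7, h8, h9, h10, h11, hC2⟩ :=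
    exists_firstSingular_configuration v q G hsw hA hG hE hq hv_ax hsing
  exact hzc (hcore zc R hp hm δ h1 h2 h3 h4 h5 hC1 h7 h8 h9 h10 h11 hC2)

/-- **Seregin 2022, §2: the criterion reduced to the core in classical form.** As
`seregin2022_regularAtOrigin_of_forall_clean`, with the core `hcoreV` receiving, instead of the
regularity primitives (C1)–(C2), their classical content (`exists_cleanSlab_repr`): a
representative `V` of `v` on the open slab `Q(ẑ, R) = 𝒞(x̂, R) × ]t̂ - R², t̂[` with `(V, q)` a
sufficiently smooth axially symmetric solution there (Seregin–Zajaczkowski 2007: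
`IsSmoothAxisymmetricSolutionOn`), `v = V` a.e. on the slab, and, at every top-slice point
`a ∈ 𝒞(x̂, R)` off the axis or with `|a₃ - h₊| < δ` or `|a₃ - h₋| < δ`, bounds `‖D_xⁿV‖ ≤ Cₙ`
on a backward cylinder `Q((t̂, a), ρ) ⊆ Q(ẑ, R)` (smoothness up to the top time on
`supp ∇η`). If every such configuration has `v ∈ L_∞(Q(ẑ, r))` for some `r > 0` (Steps 2–4),
the origin is a regular point of `v`.
[cite: Seregin2022LocalAxisym, §2 proof of Thm. 1.2, Steps 1–4 (arXiv:2201.00153 pp. 5–7)] -/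
theorem seregin2022_regularAtOrigin_of_forall_cleanRepr : ∀ (v : ℝ → EuclideanSpace ℝ (Fin 3) → EuclideanSpace ℝ (Fin 3)) (q : ℝ → EuclideanSpace ℝ (Fin 3) → ℝ), IsSuitableWeakSolutionOn (SereginSverak2009.parCylOpens 0 1) 1 0 v q → (∃ C : ℝ≥0, ∀ᵐ t ∂(volume.restrict (Ioo (-1 : ℝ) 0)), ∫⁻ x in SereginSverak2009.spaceCyl 0 1, ‖v t x‖ₑ ^ 2 ≤ C) → (∃ G : ℝ → EuclideanSpace ℝ (Fin 3) → EuclideanSpace ℝ (Fin 3) →L[ℝ] EuclideanSpace ℝ (Fin 3), HasWeakSpatialGradientOn (SereginSverak2009.parCylOpens 0 1) v G ∧ ∫⁻ z in SereginSverak2009.parCyl 0 1, ENNReal.ofReal (frobeniusNormSq (G z.1 z.2)) < ∞) → (∫⁻ z in SereginSverak2009.parCyl 0 1, ‖q z.1 z.2‖ₑ ^ (3 / 2 : ℝ) < ∞) → (∀ t ∈ Ioo (-1 : ℝ) 0, IsAxisymmetric (v t)) → (∀ t ∈ Ioo (-1 : ℝ) 0, IsAxisymmetricScalar (q t)) → (∃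 C₁ : ℝ, ∀ t ∈ Ioo (-1 : ℝ) 0, ∀ x ∈ SereginSverak2009.spaceCyl 0 1, 0 < cylRadius x → |swirl (v t) x| ≤ C₁ / Real.log (Real.exp 1 / cylRadius x) ^ 3) → (∀ (zc : ℝ × EuclideanSpace ℝ (Fin 3)) (R hp hm δ : ℝ) (V : ℝ → EuclideanSpace ℝ (Fin 3) → EuclideanSpace ℝ (Fin 3)), zc.1 ∈ Ioc (-1 / 16 : ℝ) 0 → cylRadius zc.2 = 0 → |zc.2 2| ≤ 1 / 4 → 0 < R → R ≤ 1 / 4 → SereginZajaczkowski2007.IsSmoothAxisymmetricSolutionOn (SereginSverak2009.parCylOpens zc R) V q → uncurry v =ᵐ[volume.restrict (SereginSverak2009.parCyl zc R)] uncurry V → 0 < δ → zc.2 2 - R ≤ hm - δ → hm + δ < zc.2 2 → zc.2 2 < hp - δ → hp + δ ≤ zc.2 2 + R → (∀ a ∈ SereginSverak2009.spaceCyl zc.2 R, (0 < cylRadius a ∨ |a 2 - hp| < δ ∨ |a 2 - hm| < δ) → ∃ ρ > 0, parabolicCylinder ρ ((zc.1, a) : ℝ × EuclideanSpace ℝ (Fin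 3)) ⊆ SereginSverak2009.parCyl zc R ∧ ∀ n : ℕ, ∃ C : ℝ, ∀ w ∈ parabolicCylinder ρ ((zc.1, a) : ℝ × EuclideanSpace ℝ (Fin 3)), ‖iteratedFDeriv ℝ n (V w.1) w.2‖ ≤ C) → ∃ r > 0, eLpNorm (uncurry v) ∞ (volume.restrict (parabolicCylinder r zc)) < ∞) → SereginSverak2009.IsRegularAtOrigin v := by
  intro v q hsw hA hG hq hv_ax hq_ax hσ hcoreV
  refine seregin2022_regularAtOrigin_of_forall_clean v q hsw hA hG hq hv_ax hq_ax hσ ?_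
  intro zc R hp hm δ h1 h2 h3 h4 h5 hC1 h7 h8 h9 h10 h11 hC2
  obtain ⟨V, hV, hae, hbd⟩ := exists_cleanSlab_repr v q hsw hq hv_ax zc R h1 h2 h3 h4 h5 hC1
  refine hcoreV zc R hp hm δ V h1 h2 h3 h4 h5 hV hae h7 h8 h9 h10 h11 fun a ha hdisj => ?_
  rw [mem_spaceCyl, cylRadius_sub_of_cylRadius_eq_zero h2] at ha
  exact hbd a (by rwa [mem_spaceCyl, cylRadius_sub_of_cylRadius_eq_zero h2])
    (hC2 a ha.1.le ha.2.le hdisj)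

/-- **The named fact from the core in classical form** (`seregin2022_regularAtOrigin_of_forall_cleanRepr`
with the core quantified over the class (H)): Steps 2–4 of the printed proof, run for the
Seregin–Zajaczkowski representative on the clean slab with derivative bounds up to the top time
on `supp ∇η`, give the fact. [cite: Seregin2022LocalAxisym, §2 proof of Thm. 1.2, Steps 1–4 (arXiv:2201.00153 pp. 5–7)] -/
theorem seregin2022_logSwirl_regularAtOrigin_of_cleanRepr
    (core : ∀ (v : ℝ → EuclideanSpace ℝ (Fin 3) → EuclideanSpace ℝ (Fin 3))
      (q : ℝ → EuclideanSpace ℝ (Fin 3) → ℝ),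
      IsSuitableWeakSolutionOn (SereginSverak2009.parCylOpens 0 1) 1 0 v q →
      (∃ C : ℝ≥0, ∀ᵐ t ∂(volume.restrict (Ioo (-1 : ℝ) 0)),
        ∫⁻ x in SereginSverak2009.spaceCyl 0 1, ‖v t x‖ₑ ^ 2 ≤ C) →
      (∃ G : ℝ → EuclideanSpace ℝ (Fin 3) → EuclideanSpace ℝ (Fin 3) →L[ℝ] EuclideanSpace ℝ (Fin 3),
        HasWeakSpatialGradientOn (SereginSverak2009.parCylOpens 0 1) v G ∧
          ∫⁻ z in SereginSverak2009.parCyl 0 1, ENNReal.ofReal (frobeniusNormSq (G z.1 z.2)) < ∞) →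
      (∫⁻ z in SereginSverak2009.parCyl 0 1, ‖q z.1 z.2‖ₑ ^ (3 / 2 : ℝ) < ∞) →
      (∀ t ∈ Ioo (-1 : ℝ) 0, IsAxisymmetric (v t)) →
      (∀ t ∈ Ioo (-1 : ℝ) 0, IsAxisymmetricScalar (q t)) →
      (∃ C₁ : ℝ, ∀ t ∈ Ioo (-1 : ℝ) 0, ∀ x ∈ SereginSverak2009.spaceCyl 0 1, 0 < cylRadius x →
        |swirl (v t) x| ≤ C₁ / Real.log (Real.exp 1 / cylRadius x) ^ 3) →
      ∀ (zc : ℝ × EuclideanSpace ℝ (Fin 3)) (R hp hm δ : ℝ)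
        (V : ℝ → EuclideanSpace ℝ (Fin 3) → EuclideanSpace ℝ (Fin 3)),
        zc.1 ∈ Ioc (-1 / 16 : ℝ) 0 → cylRadius zc.2 = 0 → |zc.2 2| ≤ 1 / 4 → 0 < R → R ≤ 1 / 4 →
        IsSmoothAxisymmetricSolutionOn (SereginSverak2009.parCylOpens zc R) V q →
        uncurry v =ᵐ[volume.restrict (SereginSverak2009.parCyl zc R)] uncurry V →
        0 < δ → zc.2 2 - R ≤ hm - δ → hm + δ < zc.2 2 → zc.2 2 < hp - δ → hp + δ ≤ zc.2 2 + R →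
        (∀ a ∈ SereginSverak2009.spaceCyl zc.2 R, (0 < cylRadius a ∨ |a 2 - hp| < δ ∨ |a 2 - hm| < δ) →
          ∃ ρ > 0, parabolicCylinder ρ ((zc.1, a) : ℝ × EuclideanSpace ℝ (Fin 3)) ⊆
              SereginSverak2009.parCyl zc R ∧
            ∀ n : ℕ, ∃ C : ℝ, ∀ w ∈ parabolicCylinder ρ ((zc.1, a) : ℝ × EuclideanSpace ℝ (Fin 3)),
              ‖iteratedFDeriv ℝ n (V w.1) w.2‖ ≤ C) →
        ∃ r > 0, eLpNorm (uncurry v) ∞ (volume.restrict (parabolicCylinder r zc)) < ∞) :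
    seregin2022_logSwirl_regularAtOrigin :=
  fun v q hsw hA hG hq hv_ax hq_ax hσ =>
    seregin2022_regularAtOrigin_of_forall_cleanRepr v q hsw hA hG hq hv_ax hq_ax hσ
      (core v q hsw hA hG hq hv_ax hq_ax hσ)

end Literature.Analysis.SereginLogSwirlOrigin.EulerScaling

end Part2

/-!
## Part 3 — port of `Summits/NavierStokesRegularity/NavierStokesRegularity/Theorems/AxisymmetricExtremalityAxisymmetricKatoGlobalStubAxisBoundedOfLocalEnergyOrigin.lean` (1 declarations kept)

# Crux `AxisymmetricKatoGlobal` (stmt-NavierStokesRegularity-15453), line `registered`, stub 2c'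
# `stub_axisBounded_of_localEnergy_origin`: the local log³-swirl criterion at axis points

Support file (theorems only, `--supports stmt-NavierStokesRegularity-15453`).

The stub is a pure transfer statement.  Its first hypothesis is the local regularity criterion
of the sibling stub 2a (G. Seregin, J. Math. Fluid Mech. 24 (2022) = arXiv:2201.00153, §2: an
axisymmetric suitable weak solution `(v, q)` of the unit-viscosity system in the unit cylinder
`Q = 𝒞 × ]-1, 0[` (`SereginSverak2009.parCyl 0 1`) with `v ∈ L_{2,∞}(Q)`, `∇v ∈ L₂(Q)`,
`q ∈ L_{3/2}(Q)` and the swirl bound `|Γ| ≤ C₁ / ln³(e/|x'|)` is regular at the origin).  GIVEN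
it, a suitable weak solution `(u, p)` (viscosity `ν > 0`) on the open strip `(0, T) × ℝ³`, `u`
smooth with axisymmetric slices, `p` with axisymmetric slices, local energy classes reaching the
final time on every `(t₁, T) × B_ρ(0)`, swirl with the logarithmic axis modulus
`|Γ(t, x)| ≤ C / |log |x'||³` (`|x'| ≤ δ₀ < 1`, `t₀ ≤ t < T`), is bounded near `(T, x₀)` for every
`x₀` ON the axis (`IsBoundedNearTop u T x₀`).

Proof: with a scale `λ > 0`, `λ ≤ δ₀`, `λ ≤ e⁻¹`, `λ²/ν < T - t₀` (`exists_scale`) put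
`Φ(s, y) = (T + (λ²/ν) s, x₀ + λ y)`, `v = (λ/ν) u ∘ Φ`, `q = (λ/ν)² p ∘ Φ`
(`IsSuitableWeakSolutionOn.stRescale`: viscosity `(λ/ν) ν / λ = 1`; `.of_le` to the unit cylinder,
which `Φ` maps into `(T - λ²/ν, T) × B(x₀, 2λ) ⊆ (t₀, T) × B(0, ρ)`); the three classes on the
unit cylinder come from the hypothesised ones by the change of variables
(`ae_sliced_setLIntegral_ball_stRescale`, `setLIntegral_frobeniusNormSq_stRescale` for the weak
gradient `(λ²/ν) ∇u ∘ Φ` of `hasWeakSpatialGradientOn_of_contDiffOn` / `.stRescale`,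
`setLIntegral_enorm_rpow_stRescale`); `x₀ = b e₃` is fixed by the (linear) rotations about the
axis, so the rescaled slices stay axisymmetric (`SereginSverak2009.isAxisymmetric_rescale`); the
swirl is scale invariant, `Γ_v(s, y) = ν⁻¹ Γ_u(Φ(s, y))` (`swirl_smul_comp_eZ_smul`), and for
`0 < r = |y'| < 1`, `λ ≤ e⁻¹`: `|log (λ r)| = -log λ - log r ≥ 1 - log r = log (e/r) > 0`, so
`|Γ_v| ≤ (max C 0 / ν) / log³(e/r)`.  The criterion gives `v ∈ L^∞(Q(r)) ⊆ L^∞(Q_r(0))`, which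
is transported back along the measure-scaling bijection `Φ` to an a.e. bound of `u` on a
backward neighbourhood of `(T, x₀)`, an everywhere bound by continuity
(`isBoundedNearTop_of_eLpNorm_rescaled_lt_top`).  References: G. Seregin, J. Math. Fluid
Mech. 24 (2022), arXiv:2201.00153, §2 [Seregin2022]; G. Seregin, V. Šverák, Comm. PDE 34 (2009)
= arXiv:0804.1803, §4 (the axis-centred rescaling before (p3)) [SereginSverak2009];
L. Caffarelli, R. Kohn, L. Nirenberg, Comm. Pure Appl. Math. 35 (1982), §2 (scaling)
[CaffarelliKohnNirenberg1982].

Not carried from this source module (not needed by the declarations re-homed here; their consumers are Summits-side): `exists_scale`, `log_exp_one_div_le_abs_log_mul`, `spaceCyl_zero_one_subset_ball`, `parCyl_zero_one_subset_preimage_stAffine`, `isBoundedNearTop_of_eLpNorm_rescaled_lt_top`, `stub_axisBounded_of_localEnergy_origin`.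
-/

section Part3

open _root_.Set _root_.MeasureTheory _root_.Filter _root_.Topology _root_.Function _root_.Metric _root_.Module
  Literature.Analysis.FluidPDE
open scoped _root_.ENNReal _root_.NNReal

namespace Literature.Analysis.SereginLogSwirlOrigin.Registered

/-! ### Elementary inputs: the scale, the logarithms, the unit cylinder, axis points -/

/-- A point of the axis (`cylRadius x₀ = 0`) is `x₀ = x₀₃ e₃`. [folklore]
[cite: Seregin2022LocalAxisym, §2 (axisymmetric fields on the axis are axial) (source of the ARGUMENT this module implements; this declaration is the cell’s own lemma or plumbing, NOT a printed statement)] -/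
theorem eq_smul_eZ_of_cylRadius_eq_zero {x₀ : (EuclideanSpace ℝ (Fin 3))} (hx₀ : cylRadius x₀ = 0) : x₀ = x₀ 2 • eZ := by
  have h := SereginSverak2009.horiz_add_smul_eZ x₀
  have h0 : SereginSverak2009.horiz x₀ = 0 := by
    rw [← norm_eq_zero, SereginSverak2009.norm_horiz]
    exact hx₀
  rw [h0, zero_add] at h
  exact h.symm

/-! ### From the essential bound of the rescaled solution back to `u` -/

end Literature.Analysis.SereginLogSwirlOrigin.Registered

end Part3

/-!
## Part 4 — port of `Summits/NavierStokesRegularity/NavierStokesRegularity/Theorems/AxisymmetricExtremalityAxisymmetricKatoGlobalStubSereginLogSwirlOriginCoreNormalise.lean` (5 declarations kept)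

# Seregin 2022, §2: normalisation of the classical core of the local regularity criterion to the
# origin at unit scale —
# crux stmt-NavierStokesRegularity-15453 (`AxisymmetricExtremality.AxisymmetricKatoGlobal`), line registered, support for stub `stub_sereginLogSwirlOrigin`

Support file (`--supports stmt-NavierStokesRegularity-15453`; theorems only, everything proved)
toward the registered stub `stub_sereginLogSwirlOrigin` = the named fact
`Literature.Analysis.FluidPDE.seregin2022_logSwirl_regularAtOrigin` (G. Seregin, J. Math. Fluid
Mech. 24 (2022), Paper 27 = arXiv:2201.00153, §2: Def. 1.1 in `Q = 𝒞 × ]-1, 0[` + axial symmetry +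
the swirl bound (2.2) ⇒ the origin is a regular point).  Third of three files (siblings
`…CoreNormaliseRescale`, `…CoreNormaliseTransport`).

The sibling `…FinalReduction` reduced the fact to ONE written-out hypothesis `core`
(`seregin2022_logSwirl_regularAtOrigin_of_cleanRepr`): Steps 2–4 of the printed proof for the
Seregin–Zajaczkowski representative `V` of `v` on the clean slab `Q(ẑ, R)` around an arbitrary axis
point `ẑ = (t̂, x̂)` (`-1/16 < t̂ ≤ 0`, `|x̂₃| ≤ 1/4`) at an arbitrary scale `0 < R ≤ 1/4`, with two
regular heights `h±` and a width `δ`.  The printed Steps 2–4 are written at the origin of `Q` at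
unit scale ("in `Q`", cut-off `η = φ(r)ψ(x₃)ξ(t)` in `𝒞 × ]-1, 0[`).  This file performs the
normalisation: `core_of_core_at_origin` (registered) derives `core` from the CORE AT THE ORIGIN —
the same statement at `ẑ = 0`, `R = 1`, for a pair `(u, π)` in the class (H) of the fact on `Q` and
a representative `W` in `IsSmoothAxisymmetricSolutionOn Q W π` with the derivative bounds up to the
top time off the axis and in the strips `|y₃ - h±| < δ`, supplemented by the two pointwise
consequences of the a.e. data that the continuous `W` inherits (`swirlBound_repr`: (2.2) for `W` on
`Q` off the axis; `energyBound_repr`: `∫_𝒞 |W(s)|² ≤ A` at every time, by Fubini and Fatou) — by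
translating `ẑ` to the origin and rescaling parabolically (`u = R v ∘ Φ`, `π = R² q ∘ Φ`,
`W = R V ∘ Φ`, `Φ(s, y) = (t̂ + R² s, b e₃ + R y)`, `x̂ = b e₃`; the transports of the siblings), and
`seregin2022_logSwirl_regularAtOrigin_of_coreAtOrigin` composes with the first-singular-time
reduction: **the named fact follows from the core at the origin.**

## References

* G. Seregin, J. Math. Fluid Mech. 24 (2022), Paper No. 27 = arXiv:2201.00153, §2 proof of
  Thm. 1.2, Steps 1–4 (arXiv pp. 5–7). [`Seregin2022LocalAxisym`]
* G. Seregin, V. Šverák, Comm. PDE 34 (2009) = arXiv:0804.1803, §3 (regular points, the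
  scale-invariant setting). [`SereginSverak2009`]
-/

section Part4

open _root_.MeasureTheory _root_.Set _root_.Function _root_.Filter _root_.Topology _root_.TopologicalSpace
  _root_.Metric
open scoped _root_.NNReal _root_.ENNReal

namespace Literature.Analysis.SereginLogSwirlOrigin.EulerScaling

open Literature.Analysis.FluidPDE Literature.Analysis.FluidPDE.SereginZajaczkowski2007
  Literature.Analysis.FluidPDE.SereginSverak2009

/-! ### At the origin: the a.e. data seen by the smooth representative -/

section Repr

variable {u W : ℝ → EuclideanSpace ℝ (Fin 3) → EuclideanSpace ℝ (Fin 3)} {π : ℝ → EuclideanSpace ℝ (Fin 3) → ℝ}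

/-- **The swirl bound (2.2) holds pointwise for the smooth representative on the open slab off the
axis**: `u = W` a.e. on `Q(0, 1)` and `|σ_u(s, y)| ≤ C₁/ln³(e/|y'|)` for all `s`, `y` give the same
bound for `σ_W` a.e. on the open set `Q(0,1) ∩ {|y'| > 0}`, where both sides are continuous
(`W` is jointly continuous on the slab), hence everywhere there
(accepted `forall_le_of_ae_le_of_continuousOn`). [cite: Seregin2022LocalAxisym, (2.2) and §2 Step 3 (the bound is used for the smooth solution on `supp η`, arXiv:2201.00153 pp. 5–7)] -/
theorem swirlBound_repr (hW : IsSmoothAxisymmetricSolutionOn (parCylOpens 0 1) W π)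
    (hae : uncurry u =ᵐ[volume.restrict (parCyl (0 : ℝ × EuclideanSpace ℝ (Fin 3)) 1)] uncurry W)
    (hσ : ∃ C₁ : ℝ, 0 ≤ C₁ ∧ ∀ s ∈ Ioo (-1 : ℝ) 0, ∀ y ∈ spaceCyl 0 1, 0 < cylRadius y →
      |swirl (u s) y| ≤ C₁ / Real.log (Real.exp 1 / cylRadius y) ^ 3) :
    ∃ C₁ : ℝ, 0 ≤ C₁ ∧ ∀ z ∈ parCyl (0 : ℝ × EuclideanSpace ℝ (Fin 3)) 1, 0 < cylRadius z.2 →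
      |swirl (W z.1) z.2| ≤ C₁ / Real.log (Real.exp 1 / cylRadius z.2) ^ 3 := by
  obtain ⟨C₁, hC₁0, hC₁⟩ := hσ
  refine ⟨C₁, hC₁0, ?_⟩
  set U : Set (ℝ × EuclideanSpace ℝ (Fin 3)) :=
    parCyl (0 : ℝ × EuclideanSpace ℝ (Fin 3)) 1 ∩ {z | 0 < cylRadius z.2} with hU
  have hUo : IsOpen U :=
    (isOpen_parCyl 0 1).inter (isOpen_lt continuous_const (continuous_cylRadius.comp continuous_snd))
  have hcW : ContinuousOn (uncurry W) (parCyl (0 : ℝ × EuclideanSpace ℝ (Fin 3)) 1) := hW.continuousOn_velocity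
  have hci : ∀ i : Fin 3, ContinuousOn (fun z : ℝ × EuclideanSpace ℝ (Fin 3) => W z.1 z.2 i) U := fun i =>
    ((EuclideanSpace.proj i).continuous.comp_continuousOn hcW).mono inter_subset_left
  have hyi : ∀ i : Fin 3, Continuous fun z : ℝ × EuclideanSpace ℝ (Fin 3) => z.2 i := fun i =>
    (EuclideanSpace.proj i).continuous.comp continuous_snd
  have hf : ContinuousOn (fun z : ℝ × EuclideanSpace ℝ (Fin 3) => |swirl (W z.1) z.2|) U := by
    have h : ContinuousOn (fun z : ℝ × EuclideanSpace ℝ (Fin 3) => z.2 0 * W z.1 z.2 1 - z.2 1 * W z.1 z.2 0) U :=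
      (((hyi 0).continuousOn.mul (hci 1)).sub ((hyi 1).continuousOn.mul (hci 0)))
    exact h.abs
  have he : (1 : ℝ) < Real.exp 1 := by
    have := Real.add_one_lt_exp (one_ne_zero (α := ℝ))
    linarith
  have hlogpos : ∀ z ∈ U, 0 < Real.log (Real.exp 1 / cylRadius z.2) := by
    intro z hz
    have hz1 : cylRadius z.2 < 1 := ((mem_parCyl_zero.1 hz.1).2).1
    apply Real.log_pos
    rw [lt_div_iff₀ hz.2]
    nlinarith
  have hg : ContinuousOn (fun z : ℝ × EuclideanSpace ℝ (Fin 3) => C₁ / Real.log (Real.exp 1 / cylRadius z.2) ^ 3) U := by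
    refine continuousOn_const.div ?_ fun z hz => (pow_pos (hlogpos z hz) 3).ne'
    refine ((continuousOn_const.div (continuous_cylRadius.comp continuous_snd).continuousOn
      fun z hz => (ne_of_gt hz.2)).log fun z hz => ?_).pow 3
    exact (div_pos (Real.exp_pos 1) hz.2).ne'
  have hle : ∀ᵐ z ∂(volume.restrict U), |swirl (W z.1) z.2| ≤ C₁ / Real.log (Real.exp 1 / cylRadius z.2) ^ 3 := by
    have hae' : ∀ᵐ z ∂(volume.restrict U), uncurry u z = uncurry W z :=
      ae_restrict_of_ae_restrict_of_subset inter_subset_left hae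
    filter_upwards [hae', ae_restrict_mem hUo.measurableSet] with z hz hzU
    have hzQ := mem_parCyl_zero.1 hzU.1
    have hswirl : swirl (W z.1) z.2 = swirl (u z.1) z.2 := by
      have e : W z.1 z.2 = u z.1 z.2 := by
        have := hz; simp only [uncurry] at this; exact this.symm
      simp only [swirl, e]
    rw [hswirl]
    refine hC₁ z.1 ?_ z.2 (mem_spaceCyl_zero_iff.2 hzQ.2) hzU.2
    simpa using hzQ.1
  intro z hz hz0
  exact forall_le_of_ae_le_of_continuousOn hUo hf hg hle z ⟨hz, hz0⟩

/-- The time slices of `Q(0, 1)`: `(s, y) ∈ Q(0, 1)` iff `-1 < s < 0` and `y ∈ 𝒞`. [folklore]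
[cite: Seregin2022LocalAxisym, §2 proof of Thm. 1.2 (arXiv:2201.00153 pp. 4–7) (source of the ARGUMENT this module implements; this declaration is the cell’s own lemma or plumbing, NOT a printed statement)] -/
theorem mk_mem_parCyl_zero_one {s : ℝ} {y : EuclideanSpace ℝ (Fin 3)} :
    ((s, y) : ℝ × EuclideanSpace ℝ (Fin 3)) ∈ parCyl (0 : ℝ × EuclideanSpace ℝ (Fin 3)) 1 ↔
      s ∈ Ioo (-1 : ℝ) 0 ∧ y ∈ spaceCyl (0 : EuclideanSpace ℝ (Fin 3)) 1 := by
  rw [mem_parCyl_zero, mem_spaceCyl_zero_iff]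
  simp

/-- **The energy class of the smooth representative, at every time.** If `u = W` a.e. on `Q(0, 1)`,
`∫_𝒞 |u(s)|² ≤ C` for a.e. `s ∈ ]-1, 0[` and `W` is jointly continuous on the slab, then
`∫_𝒞 |W(s)|² ≤ C` for EVERY `s ∈ ]-1, 0[`: by Fubini `W(s) = u(s)` a.e. for a.e. `s`, so the bound
holds on a dense set of times, and Fatou's lemma along `s_k → s` (pointwise convergence
`W(s_k, y) → W(s, y)`) gives it everywhere. [folklore]
[cite: Seregin2022LocalAxisym, §2 proof of Thm. 1.2 (arXiv:2201.00153 pp. 4–7) (source of the ARGUMENT this module implements; this declaration is the cell’s own lemma or plumbing, NOT a printed statement)] -/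
theorem energyBound_repr (hW : IsSmoothAxisymmetricSolutionOn (parCylOpens 0 1) W π)
    (hae : uncurry u =ᵐ[volume.restrict (parCyl (0 : ℝ × EuclideanSpace ℝ (Fin 3)) 1)] uncurry W)
    (hA : ∃ C : ℝ≥0, ∀ᵐ s ∂(volume.restrict (Ioo (-1 : ℝ) 0)),
      ∫⁻ y in spaceCyl 0 1, ‖u s y‖ₑ ^ 2 ≤ C) :
    ∃ A : ℝ≥0, ∀ s ∈ Ioo (-1 : ℝ) 0, ∫⁻ y in spaceCyl 0 1, ‖W s y‖ₑ ^ 2 ≤ A := by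
  obtain ⟨C, hC⟩ := hA
  refine ⟨C, fun s hs => ?_⟩
  have hcW : ContinuousOn (uncurry W) (parCyl (0 : ℝ × EuclideanSpace ℝ (Fin 3)) 1) := hW.continuousOn_velocity
  -- Fubini: `u(s) = W(s)` a.e. on `𝒞` for a.e. `s`
  have hprod : (volume.restrict (Ioo (-1 : ℝ) 0)).prod
      (volume.restrict (spaceCyl (0 : EuclideanSpace ℝ (Fin 3)) 1)) =
      volume.restrict (parCyl (0 : ℝ × EuclideanSpace ℝ (Fin 3)) 1) := by
    rw [Measure.prod_restrict, ← Measure.volume_eq_prod, parCyl_zero_eq_prod]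
    norm_num
  have hae2 : ∀ᵐ s ∂(volume.restrict (Ioo (-1 : ℝ) 0)),
      u s =ᵐ[volume.restrict (spaceCyl (0 : EuclideanSpace ℝ (Fin 3)) 1)] W s := by
    apply Measure.ae_ae_eq_of_ae_eq_uncurry
    rw [hprod]
    exact hae
  have hgood : ∀ᵐ s ∂(volume.restrict (Ioo (-1 : ℝ) 0)),
      ∫⁻ y in spaceCyl 0 1, ‖W s y‖ₑ ^ 2 ≤ C := by
    filter_upwards [hC, hae2] with s hs hs2
    calc ∫⁻ y in spaceCyl 0 1, ‖W s y‖ₑ ^ 2 = ∫⁻ y in spaceCyl 0 1, ‖u s y‖ₑ ^ 2 :=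
        lintegral_congr_ae (by filter_upwards [hs2] with y hy; rw [hy])
      _ ≤ C := hs
  -- the good times are dense: a sequence of good times `s_k → s`
  set G : Set ℝ := {s' | s' ∈ Ioo (-1 : ℝ) 0 → ∫⁻ y in spaceCyl 0 1, ‖W s' y‖ₑ ^ 2 ≤ C} with hG
  have hGd : Dense G := Measure.dense_of_ae (μ := volume) ((ae_restrict_iff' measurableSet_Ioo).1 hgood)
  have hcl : s ∈ closure (Ioo (-1 : ℝ) 0 ∩ G) := hGd.open_subset_closure_inter isOpen_Ioo hs
  obtain ⟨sq, hsqG, hsqt⟩ := mem_closure_iff_seq_limit.1 hcl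
  have hgoodk : ∀ k, ∫⁻ y in spaceCyl 0 1, ‖W (sq k) y‖ₑ ^ 2 ≤ C := fun k => (hsqG k).2 (hsqG k).1
  -- pointwise convergence on `𝒞` by the joint continuity of `W`
  have hlim : ∀ y ∈ spaceCyl (0 : EuclideanSpace ℝ (Fin 3)) 1,
      Tendsto (fun k => ‖W (sq k) y‖ₑ ^ 2) atTop (𝓝 (‖W s y‖ₑ ^ 2)) := by
    intro y hy
    have hcont : ContinuousWithinAt (uncurry W) (parCyl (0 : ℝ × EuclideanSpace ℝ (Fin 3)) 1) (s, y) :=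
      hcW (s, y) (mk_mem_parCyl_zero_one.2 ⟨hs, hy⟩)
    have hseq : Tendsto (fun k => ((sq k, y) : ℝ × EuclideanSpace ℝ (Fin 3))) atTop
        (𝓝[parCyl (0 : ℝ × EuclideanSpace ℝ (Fin 3)) 1] (s, y)) :=
      tendsto_nhdsWithin_iff.2 ⟨hsqt.prodMk_nhds tendsto_const_nhds,
        Eventually.of_forall fun k => mk_mem_parCyl_zero_one.2 ⟨(hsqG k).1, hy⟩⟩
    have h1 : Tendsto (fun k => W (sq k) y) atTop (𝓝 (W s y)) := hcont.tendsto.comp hseq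
    exact ENNReal.Tendsto.pow ((continuous_enorm.tendsto _).comp h1)
  -- the slices of `W` are continuous on `𝒞`, hence a.e.-measurable there
  have hmeas : ∀ k, AEMeasurable (fun y => ‖W (sq k) y‖ₑ ^ 2)
      (volume.restrict (spaceCyl (0 : EuclideanSpace ℝ (Fin 3)) 1)) := by
    intro k
    have hsl : ContinuousOn (W (sq k)) (spaceCyl (0 : EuclideanSpace ℝ (Fin 3)) 1) :=
      hcW.comp (Continuous.continuousOn (by fun_prop)) fun y hy => mk_mem_parCyl_zero_one.2 ⟨(hsqG k).1, hy⟩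
    exact ((hsl.aemeasurable (isOpen_spaceCyl 0 1).measurableSet).enorm.pow_const 2)
  -- Fatou
  calc ∫⁻ y in spaceCyl 0 1, ‖W s y‖ₑ ^ 2
      = ∫⁻ y in spaceCyl 0 1, liminf (fun k => ‖W (sq k) y‖ₑ ^ 2) atTop :=
        setLIntegral_congr_fun (isOpen_spaceCyl 0 1).measurableSet fun y hy => ((hlim y hy).liminf_eq).symm
    _ ≤ liminf (fun k => ∫⁻ y in spaceCyl 0 1, ‖W (sq k) y‖ₑ ^ 2) atTop := lintegral_liminf_le' hmeas
    _ ≤ C := liminf_le_of_frequently_le' (Frequently.of_forall hgoodk)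

end Repr

/-! ### The normalisation of the core -/

section Core

/-- **Seregin 2022, §2: the classical core of the criterion, normalised to the origin at unit
scale, implies the core at every axis point and scale.** The CORE AT THE ORIGIN `hnorm` is the
hypothesis `core` of `seregin2022_logSwirl_regularAtOrigin_of_cleanRepr` (sibling `…FinalReduction`)
written at `ẑ = 0`, `R = 1`: for every pair `(u, π)` in the class (H) of the fact on
`Q = 𝒞 × ]-1, 0[` (suitable weak solution of the unit-viscosity system, `u ∈ L_{2,∞}`,
`∇u ∈ L₂`, `π ∈ L_{3/2}`, axisymmetric slices, swirl bound (2.2) with `C₁ ≥ 0`), heights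
`-1 ≤ h₋ - δ`, `h₋ + δ < 0 < h₊ - δ`, `h₊ + δ ≤ 1`, and a representative `W` of `u` on `Q` in the
Seregin–Zajaczkowski class `IsSmoothAxisymmetricSolutionOn Q W π` whose spatial derivatives of every
order are bounded up to the top time near each top-slice point `a ∈ 𝒞` off the axis or with
`|a₃ - h±| < δ` (on some `Q_ρ(0, a) ⊆ Q`), supplemented by the two pointwise consequences of the a.e.
data for the continuous `W` — the swirl bound (2.2) for `W` on `Q` off the axis and the energy bound
`∫_𝒞 |W(s)|² ≤ A` at EVERY time (`swirlBound_repr`, `energyBound_repr`) — the origin is a regular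
point of `u` (`IsRegularAtOrigin u`; this is what Steps 2–4 of the printed proof establish, the
proof being written "in `Q`"). CONCLUSION: the core at a general configuration `(ẑ, R, h±, δ, V)`,
verbatim. PROOF: translate `ẑ = (t̂, b e₃)` to the origin and rescale parabolically,
`u = R v ∘ Φ`, `π = R² q ∘ Φ`, `W = R V ∘ Φ`, `Φ(s, y) = (t̂ + R² s, b e₃ + R y)`: the class (H) is
covariant (`suitable_axisZoom`, `energyClass_axisZoom`, `gradClass_axisZoom`,
`pressureClass_axisZoom`, `isAxisymmetric_axisZoom`, `isAxisymmetricScalar_axisZoom`; the swirl is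
scale invariant and the logarithmic weight monotone, `swirlBound_axisZoom`), the
Seregin–Zajaczkowski class is covariant (`isSmoothAxisymmetricSolutionOn_axisZoom`) with
`Φ⁻¹(Q(ẑ, R)) = Q`, `v = V` a.e. transports (`aeEq_axisZoom`), the heights become `(h± - b)/R`,
`δ/R` and the derivative bounds scale by `R^{n+1}` (`derivBounds_axisZoom`); regularity of the origin
for `u` is an `L_∞` bound of `v` on `Q_{Rr}(ẑ)` (`backwardRegular_of_axisZoom`).
[cite: Seregin2022LocalAxisym, §2 proof of Thm. 1.2 ("Let us consider the following Cauchy problem … in `Q`"; Steps 1–4, arXiv:2201.00153 pp. 5–7)] -/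
theorem core_of_core_at_origin : (∀ (u : ℝ → EuclideanSpace ℝ (Fin 3) → EuclideanSpace ℝ (Fin 3)) (π : ℝ → EuclideanSpace ℝ (Fin 3) → ℝ), IsSuitableWeakSolutionOn (SereginSverak2009.parCylOpens 0 1) 1 0 u π → (∃ C : ℝ≥0, ∀ᵐ s ∂(volume.restrict (Ioo (-1 : ℝ) 0)), ∫⁻ y in SereginSverak2009.spaceCyl 0 1, ‖u s y‖ₑ ^ 2 ≤ C) → (∃ G : ℝ → EuclideanSpace ℝ (Fin 3) → EuclideanSpace ℝ (Fin 3) →L[ℝ] EuclideanSpace ℝ (Fin 3), HasWeakSpatialGradientOn (SereginSverak2009.parCylOpens 0 1) u G ∧ ∫⁻ z in SereginSverak2009.parCyl 0 1, ENNReal.ofReal (frobeniusNormSq (G z.1 z.2)) < ∞) → (∫⁻ z in SereginSverak2009.parCyl 0 1, ‖π z.1 z.2‖ₑ ^ (3 / 2 : ℝ) < ∞) → (∀ s ∈ Ioo (-1 : ℝ) 0, IsAxisymmetric (u s)) → (∀ s ∈ Ioo (-1 : ℝ) 0, IsAxisymmetricScalar (π s)) → (∃ C₁ : ℝ, 0 ≤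 C₁ ∧ ∀ s ∈ Ioo (-1 : ℝ) 0, ∀ y ∈ SereginSverak2009.spaceCyl 0 1, 0 < cylRadius y → |swirl (u s) y| ≤ C₁ / Real.log (Real.exp 1 / cylRadius y) ^ 3) → ∀ (hp hm δ : ℝ) (W : ℝ → EuclideanSpace ℝ (Fin 3) → EuclideanSpace ℝ (Fin 3)), SereginZajaczkowski2007.IsSmoothAxisymmetricSolutionOn (SereginSverak2009.parCylOpens 0 1) W π → uncurry u =ᵐ[volume.restrict (SereginSverak2009.parCyl 0 1)] uncurry W → 0 < δ → -1 ≤ hm - δ → hm + δ < 0 → 0 < hp - δ → hp + δ ≤ 1 → (∀ a ∈ SereginSverak2009.spaceCyl (0 : EuclideanSpace ℝ (Fin 3)) 1, (0 < cylRadius a ∨ |a 2 - hp| < δ ∨ |a 2 - hm| < δ) → ∃ ρ > 0, parabolicCylinder ρ (((0 : ℝ), a) : ℝ × EuclideanSpace ℝ (Fin 3)) ⊆ SereginSverak2009.parCyl 0 1 ∧ ∀ n : ℕ, ∃ C : ℝ, ∀ w ∈ parabolicCylinder ρ (((0 : ℝ), a) : ℝ × EuclideanSpace ℝ (Fin 3)),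 ‖iteratedFDeriv ℝ n (W w.1) w.2‖ ≤ C) → (∃ C₁ : ℝ, 0 ≤ C₁ ∧ ∀ z ∈ SereginSverak2009.parCyl (0 : ℝ × EuclideanSpace ℝ (Fin 3)) 1, 0 < cylRadius z.2 → |swirl (W z.1) z.2| ≤ C₁ / Real.log (Real.exp 1 / cylRadius z.2) ^ 3) → (∃ A : ℝ≥0, ∀ s ∈ Ioo (-1 : ℝ) 0, ∫⁻ y in SereginSverak2009.spaceCyl 0 1, ‖W s y‖ₑ ^ 2 ≤ A) → SereginSverak2009.IsRegularAtOrigin u) → ∀ (v : ℝ → EuclideanSpace ℝ (Fin 3) → EuclideanSpace ℝ (Fin 3)) (q : ℝ → EuclideanSpace ℝ (Fin 3) → ℝ), IsSuitableWeakSolutionOn (SereginSverak2009.parCylOpens 0 1) 1 0 v q → (∃ C : ℝ≥0, ∀ᵐ t ∂(volume.restrict (Ioo (-1 : ℝ) 0)), ∫⁻ x in SereginSverak2009.spaceCyl 0 1, ‖v t x‖ₑ ^ 2 ≤ C) → (∃ G : ℝ → EuclideanSpace ℝ (Fin 3) → EuclideanSpace ℝ (Fin 3) →L[ℝ] EuclideanSpace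 ℝ (Fin 3), HasWeakSpatialGradientOn (SereginSverak2009.parCylOpens 0 1) v G ∧ ∫⁻ z in SereginSverak2009.parCyl 0 1, ENNReal.ofReal (frobeniusNormSq (G z.1 z.2)) < ∞) → (∫⁻ z in SereginSverak2009.parCyl 0 1, ‖q z.1 z.2‖ₑ ^ (3 / 2 : ℝ) < ∞) → (∀ t ∈ Ioo (-1 : ℝ) 0, IsAxisymmetric (v t)) → (∀ t ∈ Ioo (-1 : ℝ) 0, IsAxisymmetricScalar (q t)) → (∃ C₁ : ℝ, ∀ t ∈ Ioo (-1 : ℝ) 0, ∀ x ∈ SereginSverak2009.spaceCyl 0 1, 0 < cylRadius x → |swirl (v t) x| ≤ C₁ / Real.log (Real.exp 1 / cylRadius x) ^ 3) → ∀ (zc : ℝ × EuclideanSpace ℝ (Fin 3)) (R hp hm δ : ℝ) (V : ℝ → EuclideanSpace ℝ (Fin 3) → EuclideanSpace ℝ (Fin 3)), zc.1 ∈ Ioc (-1 / 16 : ℝ) 0 → cylRadius zc.2 = 0 → |zc.2 2| ≤ 1 / 4 → 0 < R → R ≤ 1 / 4 → SereginZajaczkowski2007.IsSmoothAxisymmetricSolutionOn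 (SereginSverak2009.parCylOpens zc R) V q → uncurry v =ᵐ[volume.restrict (SereginSverak2009.parCyl zc R)] uncurry V → 0 < δ → zc.2 2 - R ≤ hm - δ → hm + δ < zc.2 2 → zc.2 2 < hp - δ → hp + δ ≤ zc.2 2 + R → (∀ a ∈ SereginSverak2009.spaceCyl zc.2 R, (0 < cylRadius a ∨ |a 2 - hp| < δ ∨ |a 2 - hm| < δ) → ∃ ρ > 0, parabolicCylinder ρ ((zc.1, a) : ℝ × EuclideanSpace ℝ (Fin 3)) ⊆ SereginSverak2009.parCyl zc R ∧ ∀ n : ℕ, ∃ C : ℝ, ∀ w ∈ parabolicCylinder ρ ((zc.1, a) : ℝ × EuclideanSpace ℝ (Fin 3)), ‖iteratedFDeriv ℝ n (V w.1) w.2‖ ≤ C) → ∃ r > 0, eLpNorm (uncurry v) ∞ (volume.restrict (parabolicCylinder r zc)) < ∞ := by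
  rintro hnorm v q hsw hA hG hq hv_ax hq_ax hσ ⟨t₀, xc⟩ R hp hm δ V h1 h2 h3 h4 h5 hV hae h7 h8 h9 h10
    h11 hbd
  dsimp only at h1 h2 h3 hV hae h8 h9 h10 h11 hbd ⊢
  -- the centre is `b e₃`
  set b : ℝ := xc 2 with hb_def
  have hx : xc = b • eZ := by
    rw [hb_def]; exact Registered.eq_smul_eZ_of_cylRadius_eq_zero h2
  clear_value b
  subst hx
  -- the rescaled data at the origin
  have hW : IsSmoothAxisymmetricSolutionOn (parCylOpens 0 1) (R • stPull (R ^ 2) R t₀ (b • eZ) V)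
      (R ^ 2 • stPull (R ^ 2) R t₀ (b • eZ) q) := by
    have h := isSmoothAxisymmetricSolutionOn_axisZoom _ _ _ hV R t₀ b h4
    rwa [parCylOpens_axisZoom h4] at h
  have haeW := aeEq_axisZoom h4 hae
  have hAu := energyClass_axisZoom hA h1 h3 h4 h5
  have hσu := swirlBound_axisZoom v t₀ b R h1 h3 h4 h5 hσ
  obtain ⟨hδ', hm1, hm2, hp1, hp2⟩ := heights_axisZoom h4 h7 h8 h9 h10 h11
  have hreg := hnorm (R • stPull (R ^ 2) R t₀ (b • eZ) v) (R ^ 2 • stPull (R ^ 2) R t₀ (b • eZ) q)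
    (suitable_axisZoom hsw h1 h3 h4 h5) hAu (gradClass_axisZoom hG h1 h3 h4 h5)
    (pressureClass_axisZoom hq h1 h3 h4 h5) (isAxisymmetric_axisZoom hv_ax h1 h4 h5)
    (isAxisymmetricScalar_axisZoom hq_ax h1 h4 h5) hσu ((hp - b) / R) ((hm - b) / R) (δ / R)
    (R • stPull (R ^ 2) R t₀ (b • eZ) V) hW haeW hδ' hm1 hm2 hp1 hp2
    (derivBounds_axisZoom h4 hV.contDiffAt hbd) (swirlBound_repr hW haeW hσu)
    (energyBound_repr hW haeW hAu)
  exact backwardRegular_of_axisZoom h4 t₀ (b • eZ) (isRegularAtOrigin_iff_backwardRegular_zero.1 hreg)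

/-- **The named fact from the core at the origin.** Composing `core_of_core_at_origin` with the
first-singular-time reduction `seregin2022_logSwirl_regularAtOrigin_of_cleanRepr`
(sibling `…FinalReduction`): if Steps 2–4 of the printed proof hold in their printed setting — the
origin of `Q = 𝒞 × ]-1, 0[` at unit scale, for the Seregin–Zajaczkowski representative with
derivative bounds up to the top time off the axis and near two heights — then Seregin's local
regularity criterion `seregin2022_logSwirl_regularAtOrigin` holds.
[cite: Seregin2022LocalAxisym, §2 proof of Thm. 1.2, Steps 1–4 (arXiv:2201.00153 pp. 5–7)] -/
theorem seregin2022_logSwirl_regularAtOrigin_of_coreAtOrigin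
    (hnorm : ∀ (u : ℝ → EuclideanSpace ℝ (Fin 3) → EuclideanSpace ℝ (Fin 3))
      (π : ℝ → EuclideanSpace ℝ (Fin 3) → ℝ),
      IsSuitableWeakSolutionOn (SereginSverak2009.parCylOpens 0 1) 1 0 u π →
      (∃ C : ℝ≥0, ∀ᵐ s ∂(volume.restrict (Ioo (-1 : ℝ) 0)),
        ∫⁻ y in SereginSverak2009.spaceCyl 0 1, ‖u s y‖ₑ ^ 2 ≤ C) →
      (∃ G : ℝ → EuclideanSpace ℝ (Fin 3) → EuclideanSpace ℝ (Fin 3) →L[ℝ] EuclideanSpace ℝ (Fin 3),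
        HasWeakSpatialGradientOn (SereginSverak2009.parCylOpens 0 1) u G ∧
          ∫⁻ z in SereginSverak2009.parCyl 0 1, ENNReal.ofReal (frobeniusNormSq (G z.1 z.2)) < ∞) →
      (∫⁻ z in SereginSverak2009.parCyl 0 1, ‖π z.1 z.2‖ₑ ^ (3 / 2 : ℝ) < ∞) →
      (∀ s ∈ Ioo (-1 : ℝ) 0, IsAxisymmetric (u s)) →
      (∀ s ∈ Ioo (-1 : ℝ) 0, IsAxisymmetricScalar (π s)) →
      (∃ C₁ : ℝ, 0 ≤ C₁ ∧ ∀ s ∈ Ioo (-1 : ℝ) 0, ∀ y ∈ SereginSverak2009.spaceCyl 0 1, 0 < cylRadius y →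
        |swirl (u s) y| ≤ C₁ / Real.log (Real.exp 1 / cylRadius y) ^ 3) →
      ∀ (hp hm δ : ℝ) (W : ℝ → EuclideanSpace ℝ (Fin 3) → EuclideanSpace ℝ (Fin 3)),
        SereginZajaczkowski2007.IsSmoothAxisymmetricSolutionOn (SereginSverak2009.parCylOpens 0 1) W π →
        uncurry u =ᵐ[volume.restrict (SereginSverak2009.parCyl 0 1)] uncurry W →
        0 < δ → -1 ≤ hm - δ → hm + δ < 0 → 0 < hp - δ → hp + δ ≤ 1 →
        (∀ a ∈ SereginSverak2009.spaceCyl (0 : EuclideanSpace ℝ (Fin 3)) 1,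
          (0 < cylRadius a ∨ |a 2 - hp| < δ ∨ |a 2 - hm| < δ) →
          ∃ ρ > 0, parabolicCylinder ρ (((0 : ℝ), a) : ℝ × EuclideanSpace ℝ (Fin 3)) ⊆
              SereginSverak2009.parCyl 0 1 ∧
            ∀ n : ℕ, ∃ C : ℝ, ∀ w ∈ parabolicCylinder ρ (((0 : ℝ), a) : ℝ × EuclideanSpace ℝ (Fin 3)),
              ‖iteratedFDeriv ℝ n (W w.1) w.2‖ ≤ C) →
        (∃ C₁ : ℝ, 0 ≤ C₁ ∧ ∀ z ∈ SereginSverak2009.parCyl (0 : ℝ × EuclideanSpace ℝ (Fin 3)) 1,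
          0 < cylRadius z.2 → |swirl (W z.1) z.2| ≤ C₁ / Real.log (Real.exp 1 / cylRadius z.2) ^ 3) →
        (∃ A : ℝ≥0, ∀ s ∈ Ioo (-1 : ℝ) 0, ∫⁻ y in SereginSverak2009.spaceCyl 0 1, ‖W s y‖ₑ ^ 2 ≤ A) →
        SereginSverak2009.IsRegularAtOrigin u) :
    seregin2022_logSwirl_regularAtOrigin :=
  seregin2022_logSwirl_regularAtOrigin_of_cleanRepr (core_of_core_at_origin hnorm)

end Core

end Literature.Analysis.SereginLogSwirlOrigin.EulerScaling

end Part4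

/-!
## Part 5 — port of `Summits/NavierStokesRegularity/NavierStokesRegularity/Theorems/AxisymmetricExtremalityAxisymmetricKatoGlobalStubSereginLogSwirlOriginStep3LocalClass.lean` (1 declarations kept)

# Seregin 2022, §2 Step 3 for the LOCAL smooth class (III): the `Γ`- and `Φ`-equations for
# the Seregin–Zajaczkowski class on an open product region — crux stmt-NavierStokesRegularity-15453
# (`AxisymmetricExtremality.AxisymmetricKatoGlobal`), line registered, support for stub `stub_sereginLogSwirlOrigin`

Support file (`--supports stmt-NavierStokesRegularity-15453`; theorems only, everything proved)
toward the registered stub `stub_sereginLogSwirlOrigin` = the named fact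
`Literature.Analysis.FluidPDE.seregin2022_logSwirl_regularAtOrigin` (G. Seregin, J. Math. Fluid
Mech. 24 (2022), Paper 27 = arXiv:2201.00153, §2), sequel of `…Step3LocalEquations(Phi)`.
The final reduction of the fact (`seregin2022_logSwirl_regularAtOrigin_of_cleanRepr`) leaves a
core about a representative `V` with `IsSmoothAxisymmetricSolutionOn (parCylOpens ẑ R) V q`
(suitable weak solution on the open cylinder, `C^∞` slices, jointly continuous spatial
derivatives; no `∂ₜV`, no regular pressure), whereas the landed Step-3 energy scheme is written
for whole-space classical solutions. This file supplies the two PDE inputs of Step 3 for that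
class:

* `hasDerivAt_curl_of_isSmoothAxisymmetricSolutionOn` — on an open product `I × U ⊆ S`, for any
  family `u` agreeing with `V` near each point of `U` (`u t =ᶠ[𝓝 x] V t`), the time line
  `s ↦ curl (u s) x` has derivative `Δω − Dω[u t] + D(u t)[ω]` at `t` (`ω = curl (u t)`): the
  tree's `vorticity_classical_of_isDistributionalNSSolutionOn` (the class supplies `C³` slices
  and jointly continuous `D_xⁿV`, `n ≤ 3`; the pressure is killed by testing with curls) and
  locality of `curl`, `Δ`, `D`;
* `hasDerivAt_quotients_of_isSmoothAxisymmetricSolutionOn` — for `u` moreover globally `C^∞`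
  and axisymmetric at the times of `I` (a cut-off globalisation `χV`), at every `(t, x) ∈ I × U`
  off the axis: `d/ds angVortQuot (u s) x = angVelQuot W x`, `d/ds radVelQuot (curl (u s)) x =
  radVelQuot W x` (`W = Δω − Dω[u t] + D(u t)[ω]`; `hasDerivAt_angVortQuot_of_ne`,
  `hasDerivAt_radVelQuot_curl_of_ne`);
* `seregin_quotientEquations_of_isSmoothAxisymmetricSolutionOn` (registered sub-goal) —
  **Seregin's equations for the local class in closed form**: off the axis on `I × U`,
  `∂ₜΓ = ΔΓ + 2q_Γ − DΓ[u] − 2(u_θ/r)Φ`, `∂ₜΦ = ΔΦ + 2q_Φ − DΦ[u] + D(u_r/r)[ω]`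
  (`angVelQuot_vorticityRHS_eq`, `radVelQuot_vorticityRHS_eq` with `ν = 1`), i.e.
  "`∂ₜΓ + (u − 2x'/|x'|²)·∇Γ − ΔΓ + 2(u_θ/r)Φ = 0`, `∂ₜΦ + (u − 2x'/|x'|²)·∇Φ − ΔΦ −
  ω·∇(u_r/r) = 0`" (arXiv p. 6; `2q_G = (2x'/|x'|²)·∇G`). The axis is Lebesgue-null: this is
  the input of the localised energy method (differentiation of `∫(ζΓ)²` under the integral
  sign is a.e. in `x`).

## Mathlib / tree search

Tree: `vorticity_classical_of_isDistributionalNSSolutionOn` (`NSVorticityOfSmoothRepresentative`),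
`IsSmoothAxisymmetricSolutionOn`, `.continuousOn_iteratedFDeriv`, `.contDiffAt`, `.suitable`
(`SereginZajaczkowski2007`), `IsSuitableWeakSolutionOn.distributional`,
`IsDistributionalNSSolutionOn.of_le`; the same extraction for the 2020 no-swirl core is
`vorticity_hasDerivAt_of_isSmoothAxisymmetricSolutionOn` (`…Seregin2020TypeIINoSwirlCoreScalarEq`,
not imported). Mathlib: `Filter.EventuallyEq.fderiv_eq`, `Filter.EventuallyEq.eventuallyEq_nhds`,
`InnerProductSpace.laplacian_congr_nhds`. `lean search 'quotientEquations|hasDerivAt_quotients' --decl`: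
no matches (2026-08-17).

## References

* G. Seregin, J. Math. Fluid Mech. 24 (2022), Paper No. 27 = arXiv:2201.00153, §2 Step 3
  (arXiv p. 6, the equations of `Φ` and `Γ`). [`Seregin2022LocalAxisym`]
* P. G. Lemarié-Rieusset, *The Navier–Stokes Problem in the 21st Century* (2016),
  doi:10.1201/b19556, Thm. 13.1 proof Step 1 (p. 436), proof of Thm. 15.4 Step 3 ¶1 (p. 569)
  (the vorticity equation without pressure or time regularity). [`LemarieRieusset2016`]
* G. Seregin, W. Zajaczkowski, SIAM J. Math. Anal. 39 (2007) 669–685, Prop. 4.1 (the class).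
  [`SereginZajaczkowski2007`]

Not carried from this source module (not needed by the declarations re-homed here; their consumers are Summits-side): `hasDerivAt_quotients_of_isSmoothAxisymmetricSolutionOn`, `seregin_quotientEquations_of_isSmoothAxisymmetricSolutionOn`.
-/

section Part5

open _root_.MeasureTheory _root_.Set _root_.Function _root_.Filter _root_.Topology _root_.InnerProductSpace WithLp
open scoped RealInnerProductSpace Laplacian _root_.ContDiff
open Literature.Analysis.FluidPDE

namespace Literature.Analysis.SereginLogSwirlOrigin.EulerScaling

/-! ### The equations for the Seregin–Zajaczkowski class on an open product region -/

section LocalClass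

open _root_.TopologicalSpace Literature.Analysis.FluidPDE.SereginZajaczkowski2007

variable {Scl : Opens (ℝ × EuclideanSpace ℝ (Fin 3))}
  {V u : ℝ → EuclideanSpace ℝ (Fin 3) → EuclideanSpace ℝ (Fin 3)}
  {p : ℝ → EuclideanSpace ℝ (Fin 3) → ℝ} {I : Set ℝ} {U : Set (EuclideanSpace ℝ (Fin 3))}

/-- **The pointwise vorticity equation of the Seregin–Zajaczkowski class, transported to a
globalisation.** Let `(V, p)` be a "sufficiently smooth axially symmetric solution" on an open
`S ⊇ I × U` (`I`, `U` open) — the class of the smooth representative near regular points: a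
suitable weak solution with `C^∞` slices and jointly continuous spatial derivatives, NO time
derivative, NO regular pressure — and let `u` agree with `V` near every point of `U` at the
times of `I` (`u t =ᶠ[𝓝 x] V t`). Then for `(t, x) ∈ I × U` the time line `s ↦ curl (u s) x`
is differentiable at `t` with derivative `Δω − Dω[u] + Du[ω]` at `(t, x)` (`ω = curl (u t)`):
the tree's `vorticity_classical_of_isDistributionalNSSolutionOn` (testing the momentum equation
with curls kills the pressure; du Bois-Reymond in time), and locality of `curl`, `Δ`, `D`.
[cite: LemarieRieusset2016, Thm. 13.1 proof Step 1 (p. 436) and proof of Thm. 15.4, Step 3 ¶1 (PDF p. 569)] -/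
theorem hasDerivAt_curl_of_isSmoothAxisymmetricSolutionOn (hV : IsSmoothAxisymmetricSolutionOn Scl V p)
    (hI : IsOpen I) (hU : IsOpen U) (hsub : I ×ˢ U ⊆ (Scl : Set (ℝ × EuclideanSpace ℝ (Fin 3))))
    (hloc : ∀ t ∈ I, ∀ x ∈ U, u t =ᶠ[𝓝 x] V t) {t : ℝ} (ht : t ∈ I)
    {x : EuclideanSpace ℝ (Fin 3)} (hx : x ∈ U) :
    HasDerivAt (fun s => curl (u s) x) ((Δ (curl (u t))) x - fderiv ℝ (curl (u t)) x (u t x) +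
      fderiv ℝ (u t) x (curl (u t) x)) t := by
  have hO : IsOpen (I ×ˢ U) := hI.prod hU
  have hle : (⟨I ×ˢ U, hO⟩ : Opens (ℝ × EuclideanSpace ℝ (Fin 3))) ≤ Scl := hsub
  have hsol : IsDistributionalNSSolutionOn ⟨I ×ˢ U, hO⟩ 1 0 V p :=
    hV.suitable.distributional.of_le hle
  have hU3 : ∀ t ∈ I, ContDiffOn ℝ 3 (V t) U := fun t ht x hx =>
    ((hV.contDiffAt (t, x) (hsub ⟨ht, hx⟩)).of_le (by norm_cast)).contDiffWithinAt
  have hΦ : ∀ n ≤ 3, ContinuousOn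
      (fun w : ℝ × EuclideanSpace ℝ (Fin 3) => iteratedFDeriv ℝ n (V w.1) w.2) (I ×ˢ U) :=
    fun n _ => (hV.continuousOn_iteratedFDeriv n).mono hsub
  obtain ⟨-, -, hder, -, -⟩ :=
    vorticity_classical_of_isDistributionalNSSolutionOn hI hU hsol hU3 hΦ
  have hderV : HasDerivAt (fun s => curl (V s) x)
      ((Δ (curl (V t))) x - fderiv ℝ (curl (V t)) x (V t x) + fderiv ℝ (V t) x (curl (V t) x)) t := by
    simpa only [vorticity_apply, convect_apply, one_smul] using hder t ht x hx
  -- locality: `curl (u s) x = curl (V s) x` for `s ∈ I`, and the right-hand sides agree at `x`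
  have hcurl_pt : ∀ s ∈ I, curl (u s) x = curl (V s) x := fun s hs => by
    show curlCLM (fderiv ℝ (u s) x) = curlCLM (fderiv ℝ (V s) x)
    rw [(hloc s hs x hx).fderiv_eq]
  have hcurl : curl (u t) =ᶠ[𝓝 x] curl (V t) := by
    filter_upwards [(hloc t ht x hx).eventuallyEq_nhds] with y hy
    show curlCLM (fderiv ℝ (u t) y) = curlCLM (fderiv ℝ (V t) y)
    rw [hy.fderiv_eq]
  have hev : (fun s => curl (V s) x) =ᶠ[𝓝 t] fun s => curl (u s) x := by
    filter_upwards [hI.mem_nhds ht] with s hs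
    exact (hcurl_pt s hs).symm
  refine (hderV.congr_of_eventuallyEq hev.symm).congr_deriv ?_
  rw [(InnerProductSpace.laplacian_congr_nhds hcurl).self_of_nhds, hcurl.fderiv_eq,
    (hloc t ht x hx).self_of_nhds, hcurl.self_of_nhds, (hloc t ht x hx).fderiv_eq]

end LocalClass

end Literature.Analysis.SereginLogSwirlOrigin.EulerScaling

end Part5

/-!
## Part 6 — port of `Summits/NavierStokesRegularity/NavierStokesRegularity/Theorems/AxisymmetricExtremalityAxisymmetricKatoGlobalStubSeregin2020TypeIINoSwirlCoreCutoff.lean` (1 declarations kept)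

# Seregin 2020, proof of Thm 2.1, the no-swirl endgame core: the cut-off field `W = χ • V` of
# the `η = ω_θ/ϱ` maximum principle

Helper toward the stub `stub_seregin2020TypeII` of the crux `AxisymmetricKatoGlobal` (= the named
fact `Literature.Analysis.FluidPDE.Seregin2020_axisymmetricSingularPoint_typeII`, G. Seregin,
Anal. Math. Phys. 10 (2020) Paper 46 = arXiv:2006.04140, Thm 2.1), last paragraph of the
printed proof (arXiv p. 8: "by considering a problem for `η = ω_φ/ϱ` … reduction of it to
spatial dimension 5"). The tree's local maximum principle for `η`
(`Literature.Analysis.FluidPDE.noSwirl_abs_scalar_le_of_boundary`) is stated for a GLOBALLY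
smooth, axisymmetric, swirl-free family `W τ`, `τ ∈ I`, with uniform-in-`x` time moduli of all
`x`-derivatives (`hunif`) — "in applications `W = χ V` for a smooth representative `V` of the
solution near a regular region and an axisymmetric cut-off `χ`" (its module docstring). This
file builds that cut-off field for a family `V τ` whose slices are smooth at the points of a
ball `B(c, 3ρ)` about an axis point `c`, with the radial cut-off `χ = suppCutoff c ρ` (`= 1` on
`B̄(c, ρ)`, `= 0` off `B(c, 2ρ)`):

* `cutoffField_contDiff`, `cutoffField_isAxisymmetric`, `cutoffField_hasNoSwirl` — `W τ` is
  globally smooth, axisymmetric (for `c` on the axis), swirl free;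
* `cutoffField_eventuallyEq`, `cutoffField_local` — `W τ` agrees with `V τ` near every point of
  `B(c, ρ)`, so all local quantities (value, derivative, curl, its derivative and Laplacian)
  agree there;
* `unifTime_cutoffField` — the uniform-in-`x` time moduli of all `x`-derivatives of `W` on an
  open time set `I` from the joint continuity of the `D_xⁿ V` on `I × B(c, 3ρ)` (uniform
  continuity on `[τ - δ, τ + δ] × B̄(c, 2ρ)` and the Leibniz bound
  `norm_iteratedFDerivWithin_smul_le`).

## References

* G. Seregin, Anal. Math. Phys. 10 (2020), Paper 46 = arXiv:2006.04140, proof of Thm. 2.1, last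
  paragraph (arXiv p. 8). [Seregin2020]
* G. Koch, N. Nadirashvili, G. Seregin, V. Šverák, Acta Math. 203 (2009) 83–105, §5 p. 9 (the
  lifted equation is applied to a localised smooth field). [KochNadirashviliSereginSverak2009]

Not carried from this source module (not needed by the declarations re-homed here; their consumers are Summits-side): `suppCutoff_rotZ`, `cutoffField_eventuallyEq_zero`, `cutoffField_eventuallyEq`, `cutoffField_contDiff`, `cutoffField_isAxisymmetric`, `cutoffField_hasNoSwirl`, `cutoffField_local`, `exists_forall_norm_iteratedFDeriv_suppCutoff_le`, `unifTime_cutoffField`.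
-/

section Part6

open _root_.MeasureTheory _root_.Set _root_.Function _root_.Filter _root_.Topology _root_.TopologicalSpace
  _root_.Metric
open scoped _root_.NNReal _root_.ENNReal _root_.ContDiff Laplacian

namespace Literature.Analysis.SereginLogSwirlOrigin.EulerScaling

open Literature.Analysis.FluidPDE

/-! ### The cut-off field `W τ = χ • V τ` -/

section Cutoff

variable {V : ℝ → EuclideanSpace ℝ (Fin 3) → EuclideanSpace ℝ (Fin 3)}
  {c : EuclideanSpace ℝ (Fin 3)} {ρ : ℝ}

/-- **Uniform continuity of finitely many spatial Taylor coefficients on a compact set** (from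
their joint continuity). [folklore]
[cite: Seregin2020, proof of Thm 2.1 (off-axis / no-swirl representatives, first singular point) (source of the ARGUMENT this module implements; this declaration is the cell’s own lemma or plumbing, NOT a printed statement)] -/
theorem exists_forall_norm_iteratedFDeriv_sub_le {I : Set ℝ} {U : Set (EuclideanSpace ℝ (Fin 3))}
    {K : Set (ℝ × EuclideanSpace ℝ (Fin 3))} (hK : IsCompact K) (hKsub : K ⊆ I ×ˢ U)
    (hVc : ∀ n : ℕ, ContinuousOn
      (fun w : ℝ × EuclideanSpace ℝ (Fin 3) => iteratedFDeriv ℝ n (V w.1) w.2) (I ×ˢ U))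
    (m : ℕ) {η : ℝ} (hη : 0 < η) :
    ∃ δ > 0, ∀ j ≤ m, ∀ a ∈ K, ∀ b ∈ K, dist a b < δ →
      ‖iteratedFDeriv ℝ j (V a.1) a.2 - iteratedFDeriv ℝ j (V b.1) b.2‖ ≤ η := by
  induction m with
  | zero =>
    obtain ⟨δ, hδ, h⟩ := Metric.uniformContinuousOn_iff.1
      (hK.uniformContinuousOn_of_continuous ((hVc 0).mono hKsub)) η hη
    refine ⟨δ, hδ, fun j hj a ha b hb hab => ?_⟩
    obtain rfl : j = 0 := Nat.le_zero.1 hj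
    rw [← dist_eq_norm]
    exact (h a ha b hb hab).le
  | succ m ih =>
    obtain ⟨δ₁, hδ₁, h₁⟩ := ih
    obtain ⟨δ₂, hδ₂, h₂⟩ := Metric.uniformContinuousOn_iff.1
      (hK.uniformContinuousOn_of_continuous ((hVc (m + 1)).mono hKsub)) η hη
    refine ⟨min δ₁ δ₂, lt_min hδ₁ hδ₂, fun j hj a ha b hb hab => ?_⟩
    rcases Nat.of_le_succ hj with hj' | rfl
    · exact h₁ j hj' a ha b hb (hab.trans_le (min_le_left _ _))
    · rw [← dist_eq_norm]
      exact (h₂ a ha b hb (hab.trans_le (min_le_right _ _))).le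

end Cutoff

end Literature.Analysis.SereginLogSwirlOrigin.EulerScaling

end Part6

/-!
## Part 7 — port of `Summits/NavierStokesRegularity/NavierStokesRegularity/Theorems/AxisymmetricExtremalityAxisymmetricKatoGlobalStubSereginLogSwirlOriginStep3LocalCutoff.lean` (8 declarations kept)

# Seregin 2022, §2 Step 3 for the LOCAL smooth class (X): the cut-off globalisation `χV` of the
# Seregin–Zajaczkowski representative — smooth axisymmetric slices, uniform-in-`x` time moduli,
# and the vorticity equation near the cut-off — crux stmt-NavierStokesRegularity-15453
# (`AxisymmetricExtremality.AxisymmetricKatoGlobal`), line registered, support for stub `stub_sereginLogSwirlOrigin`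

Support file (`--supports stmt-NavierStokesRegularity-15453`; theorems only, everything proved)
toward the registered stub `stub_sereginLogSwirlOrigin` = the named fact
`Literature.Analysis.FluidPDE.seregin2022_logSwirl_regularAtOrigin` (G. Seregin, J. Math. Fluid
Mech. 24 (2022), Paper 27 = arXiv:2201.00153, §2). The final reduction of the fact leaves a core
about a representative `V` in the Seregin–Zajaczkowski class `IsSmoothAxisymmetricSolutionOn S V q`
on an open cylinder `S ⊇ I × 𝒞` (suitable weak solution, `C^∞` slices, jointly continuous
spatial derivatives; no `∂ₜV`), while the Step-3 energy scheme for the local class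
(`cutoff_energy_keyEstimate_local_unconditional` and its moduli form, sibling
`…Step3LocalKeyEstimate`) is run for a family of GLOBALLY smooth axisymmetric fields. This file
builds that family as `v t = χ • V t` for a smooth axisymmetric cut-off `χ` equal to `1` on the
small cylinder `𝒞(r₀)` carrying the Step-1 cut-off `η` and supported in `𝒞(r₁)`, `r₁ < 1`
(`v = V` near `supp η`, so all quantities of Step 3 are those of the solution there):

* `exists_cylCutoff` — a smooth axisymmetric `χ : ℝ³ → [0, 1]`, `χ = 1` on `𝒞(r₀)`,
  `tsupport χ ⊆ 𝒞(r₁)` (product of `Real.smoothTransition` profiles in `x₀² + x₁²` and `±x₂`);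
* `cutoffField_contDiff_of_tsupport_subset`, `cutoffField_isAxisymmetric_of_tsupport_subset` —
  `χ • V t` is globally `C^∞` and axisymmetric;
* `unifTime_cutoffField_of_tsupport_subset` — its `x`-derivatives of every order are continuous
  in `t` uniformly in `x` (Leibniz on `tsupport χ`, uniform continuity of the `D_xʲV` on
  `[t − δ₀, t + δ₀] × tsupport χ`, `exists_forall_norm_iteratedFDeriv_sub_le`; the generic-cut-off
  form of `unifTime_radialCutoffField`);
* `cutoffFamily_package` (registered sub-goal) — **for the Seregin–Zajaczkowski class on
  `S ⊇ I × 𝒞(0, 1)`, `I` open, and `v t = χ • V t`: smooth axisymmetric slices vanishing off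
  `B̄(0, 2)`, uniform-in-`x` time moduli of all `D_xᵏv` on `I`, `v t = V t` near every point of
  `𝒞(r₀)`, `div v = 0` and the pointwise vorticity equation
  `d/ds curl (v s) x = Δω − Dω[v] + Dv[ω]` on `I × 𝒞(r₀)`** — exactly the structural hypotheses
  of the local key estimate (`hasDerivAt_curl_of_isSmoothAxisymmetricSolutionOn`,
  `vorticity_classical_of_isDistributionalNSSolutionOn`).

## Mathlib / tree search

Tree: `unifTime_radialCutoffField`, `radialCutoffField_contDiff / _isAxisymmetric / _local`
(`…Seregin2020TypeIINoSwirlCoreCutoffRadii`, ball cut-offs), `exists_forall_norm_iteratedFDeriv_sub_le`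
(`…Seregin2020TypeIINoSwirlCoreCutoff`), `hasDerivAt_curl_of_isSmoothAxisymmetricSolutionOn`
(`…Step3LocalClass`), `vorticity_classical_of_isDistributionalNSSolutionOn`,
`IsSmoothAxisymmetricSolutionOn.continuousOn_iteratedFDeriv / .contDiffAt / .axisymmetric`,
`SereginSverak2009.isOpen_spaceCyl`, `mem_spaceCyl`, `spaceCyl_subset_closedBall` (`…LerayLogHardy`),
`cylRadius_rotZ`, `rotZ_apply_two`. Mathlib: `Real.smoothTransition` (`one_of_one_le`,
`zero_of_nonpos`, `nonneg`, `le_one`, `contDiff`), `norm_iteratedFDerivWithin_smul_le`,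
`iteratedFDerivWithin_of_isOpen`, `Filter.EventuallyEq.iteratedFDeriv`.
`lean search 'cylCutoff|cutoffFamily_package' --decl`: no matches (2026-08-17).

## References

* G. Seregin, J. Math. Fluid Mech. 24 (2022), Paper No. 27 = arXiv:2201.00153, §2 Steps 1, 3
  (arXiv pp. 5–7). [`Seregin2022LocalAxisym`]
* G. Seregin, W. Zajaczkowski, SIAM J. Math. Anal. 39 (2007) 669–685, Prop. 4.1 (the class).
  [`SereginZajaczkowski2007`]
-/

section Part7

open _root_.MeasureTheory _root_.Set _root_.Filter _root_.Topology _root_.Function _root_.Metric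
  _root_.TopologicalSpace
open scoped _root_.ContDiff Laplacian
open Literature.Analysis.FluidPDE Literature.Analysis.FluidPDE.SereginZajaczkowski2007

namespace Literature.Analysis.SereginLogSwirlOrigin.EulerScaling

/-! ### A smooth axisymmetric cylindrical cut-off -/

section CylCutoff

/-- **A smooth axisymmetric cut-off adapted to two coaxial cylinders**: for `0 < r₀ < r₁` there is
`χ ∈ C^∞(ℝ³; [0, 1])`, invariant under rotations about the axis, with `χ = 1` on
`𝒞(r₀) = {|x'| < r₀, |x₃| < r₀}` and `tsupport χ ⊆ 𝒞(r₁)` (product of smooth transition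
profiles in `x₀² + x₁²`, `x₂`, `−x₂` between the levels `a = (2r₀ + r₁)/3`, `b = (r₀ + 2r₁)/3`).
[folklore]
[cite: Seregin2022LocalAxisym, §2 proof of Thm. 1.2, Step 3 (arXiv:2201.00153 pp. 4–7) (source of the ARGUMENT this module implements; this declaration is the cell’s own lemma or plumbing, NOT a printed statement)] -/
theorem exists_cylCutoff {r₀ r₁ : ℝ} (h₀ : 0 < r₀) (h₀₁ : r₀ < r₁) :
    ∃ χ : EuclideanSpace ℝ (Fin 3) → ℝ, ContDiff ℝ ∞ χ ∧ IsAxisymmetricScalar χ ∧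
      (∀ y, 0 ≤ χ y ∧ χ y ≤ 1) ∧ (∀ y ∈ SereginSverak2009.spaceCyl 0 r₀, χ y = 1) ∧
      tsupport χ ⊆ SereginSverak2009.spaceCyl 0 r₁ := by
  set a : ℝ := (2 * r₀ + r₁) / 3 with ha
  set b : ℝ := (r₀ + 2 * r₁) / 3 with hb
  have hab : a < b := by rw [ha, hb]; linarith
  have h0a : r₀ < a := by rw [ha]; linarith
  have hb1 : b < r₁ := by rw [hb]; linarith
  have hapos : 0 < a := h₀.trans h0a
  -- the 1D profiles `g c d s = smoothTransition ((d - s)/(d - c))`: `= 1` for `s ≤ c`, `= 0` for `s ≥ d`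
  set g : ℝ → ℝ → ℝ → ℝ := fun c d s => Real.smoothTransition ((d - s) / (d - c)) with hg
  have hg1 : ∀ {c d s : ℝ}, c < d → s ≤ c → g c d s = 1 := fun {c d s} hcd hs =>
    Real.smoothTransition.one_of_one_le (by rw [le_div_iff₀ (by linarith)]; linarith)
  have hg0 : ∀ {c d s : ℝ}, c < d → d ≤ s → g c d s = 0 := fun {c d s} hcd hs =>
    Real.smoothTransition.zero_of_nonpos (div_nonpos_of_nonpos_of_nonneg (by linarith) (by linarith))
  have hgs : ∀ c d : ℝ, ContDiff ℝ ∞ (g c d) := fun c d =>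
    Real.smoothTransition.contDiff.comp ((contDiff_const.sub contDiff_id).div_const _)
  set χ : EuclideanSpace ℝ (Fin 3) → ℝ := fun y =>
    g (a ^ 2) (b ^ 2) (y 0 ^ 2 + y 1 ^ 2) * (g a b (y 2) * g a b (-(y 2))) with hχ
  have hab2 : a ^ 2 < b ^ 2 := by nlinarith
  refine ⟨χ, ?_, ?_, ?_, ?_, ?_⟩
  · have h2 : ContDiff ℝ ∞ fun y : EuclideanSpace ℝ (Fin 3) => y 2 :=
      contDiff_piLp_apply (𝕜 := ℝ) (p := 2) (i := (2 : Fin 3))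
    exact ((hgs _ _).comp contDiff_horizSq).mul (((hgs a b).comp h2).mul ((hgs a b).comp h2.neg))
  · intro θ y
    simp only [hχ, rotZ_apply_two, ← cylRadius_sq, cylRadius_rotZ]
  · intro y
    exact ⟨mul_nonneg (Real.smoothTransition.nonneg _) (mul_nonneg (Real.smoothTransition.nonneg _)
      (Real.smoothTransition.nonneg _)), mul_le_one₀ (Real.smoothTransition.le_one _)
        (mul_nonneg (Real.smoothTransition.nonneg _) (Real.smoothTransition.nonneg _))
        (mul_le_one₀ (Real.smoothTransition.le_one _) (Real.smoothTransition.nonneg _)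
          (Real.smoothTransition.le_one _))⟩
  · intro y hy
    have hy' : cylRadius y < r₀ ∧ |y 2| < r₀ := by
      simpa [SereginSverak2009.mem_spaceCyl] using hy
    have hr : y 0 ^ 2 + y 1 ^ 2 ≤ a ^ 2 := by
      rw [← cylRadius_sq]; nlinarith [cylRadius_nonneg y, hy'.1]
    have h2 : |y 2| ≤ a := by linarith [hy'.2]
    simp only [hχ]
    rw [hg1 hab2 hr, hg1 hab (abs_le.1 h2).2, hg1 hab (by linarith [(abs_le.1 h2).1]), mul_one, mul_one]
  · -- `{χ ≠ 0} ⊆ {ρ ≤ b², |y₂| ≤ b}`, a closed subset of `𝒞(r₁)`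
    have hsupp : support χ ⊆ {y : EuclideanSpace ℝ (Fin 3) | y 0 ^ 2 + y 1 ^ 2 ≤ b ^ 2 ∧ |y 2| ≤ b} := by
      intro y hy
      rw [mem_support] at hy
      by_contra hc
      simp only [mem_setOf_eq, not_and_or, not_le] at hc
      apply hy
      simp only [hχ]
      rcases hc with hc | hc
      · rw [hg0 hab2 hc.le, zero_mul]
      · rcases lt_abs.1 hc with hc' | hc'
        · rw [hg0 hab hc'.le]; ring
        · rw [hg0 hab (s := -(y 2)) hc'.le]; ring
    have hcl : IsClosed {y : EuclideanSpace ℝ (Fin 3) | y 0 ^ 2 + y 1 ^ 2 ≤ b ^ 2 ∧ |y 2| ≤ b} := by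
      have hc1 : Continuous fun y : EuclideanSpace ℝ (Fin 3) => y 0 ^ 2 + y 1 ^ 2 := (contDiff_horizSq (n := 0)).continuous
      have hc2 : Continuous fun y : EuclideanSpace ℝ (Fin 3) => |y 2| :=
        (contDiff_piLp_apply (𝕜 := ℝ) (p := 2) (n := 0) (i := (2 : Fin 3))).continuous.abs
      exact (isClosed_le hc1 continuous_const).inter (isClosed_le hc2 continuous_const)
    refine (closure_minimal hsupp hcl).trans fun y hy => ?_
    have hr : cylRadius y ≤ b := by
      have h1 : cylRadius y ^ 2 ≤ b ^ 2 := by rw [cylRadius_sq]; exact hy.1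
      by_contra hlt
      have hlt' : b < cylRadius y := not_le.1 hlt
      nlinarith [cylRadius_nonneg y, hapos.trans hab]
    have hm : cylRadius y < r₁ ∧ |y 2| < r₁ := ⟨hr.trans_lt hb1, hy.2.trans_lt hb1⟩
    simpa [SereginSverak2009.mem_spaceCyl] using hm

end CylCutoff

/-! ### The cut-off field `χ • V`: smoothness, axisymmetry, uniform-in-`x` time moduli -/

section CutoffField

variable {V : ℝ → EuclideanSpace ℝ (Fin 3) → EuclideanSpace ℝ (Fin 3)} {χ : EuclideanSpace ℝ (Fin 3) → ℝ}
  {U : Set (EuclideanSpace ℝ (Fin 3))} {I : Set ℝ}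

/-- Off `tsupport χ` the cut-off field vanishes near the point. [folklore]
[cite: Seregin2022LocalAxisym, §2 proof of Thm. 1.2, Step 3 (arXiv:2201.00153 pp. 4–7) (source of the ARGUMENT this module implements; this declaration is the cell’s own lemma or plumbing, NOT a printed statement)] -/
theorem cutoffField_eventuallyEq_zero' (W : EuclideanSpace ℝ (Fin 3) → EuclideanSpace ℝ (Fin 3))
    {y : EuclideanSpace ℝ (Fin 3)} (hy : y ∉ tsupport χ) :
    (fun y => χ y • W y) =ᶠ[𝓝 y] fun _ => 0 := by
  filter_upwards [notMem_tsupport_iff_eventuallyEq.1 hy] with z hz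
  rw [hz, Pi.zero_apply, zero_smul]

/-- Where `χ = 1` (on an open set) the cut-off field is the field near the point. [folklore]
[cite: Seregin2022LocalAxisym, §2 proof of Thm. 1.2, Step 3 (arXiv:2201.00153 pp. 4–7) (source of the ARGUMENT this module implements; this declaration is the cell’s own lemma or plumbing, NOT a printed statement)] -/
theorem cutoffField_eventuallyEq' (W : EuclideanSpace ℝ (Fin 3) → EuclideanSpace ℝ (Fin 3))
    {O : Set (EuclideanSpace ℝ (Fin 3))} (hO : IsOpen O) (h1 : ∀ y ∈ O, χ y = 1)
    {x : EuclideanSpace ℝ (Fin 3)} (hx : x ∈ O) : (fun y => χ y • W y) =ᶠ[𝓝 x] W := by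
  filter_upwards [hO.mem_nhds hx] with z hz
  rw [h1 z hz, one_smul]

/-- **The cut-off field is globally smooth** when `tsupport χ ⊆ U`, `U` open, and the field is
smooth at the points of `U`. [folklore]
[cite: Seregin2022LocalAxisym, §2 proof of Thm. 1.2, Step 3 (arXiv:2201.00153 pp. 4–7) (source of the ARGUMENT this module implements; this declaration is the cell’s own lemma or plumbing, NOT a printed statement)] -/
theorem cutoffField_contDiff_of_tsupport_subset (hχ : ContDiff ℝ ∞ χ)
    (hχU : tsupport χ ⊆ U) {W : EuclideanSpace ℝ (Fin 3) → EuclideanSpace ℝ (Fin 3)}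
    (hW : ∀ y ∈ U, ContDiffAt ℝ ∞ W y) : ContDiff ℝ ∞ fun y => χ y • W y := by
  refine contDiff_iff_contDiffAt.2 fun y => ?_
  by_cases hy : y ∈ tsupport χ
  · exact hχ.contDiffAt.smul (hW y (hχU hy))
  · exact (contDiffAt_const (c := (0 : EuclideanSpace ℝ (Fin 3)))).congr_of_eventuallyEq
      (cutoffField_eventuallyEq_zero' W hy)

/-- **The cut-off field is axisymmetric** when `χ` is an axisymmetric scalar and the field is
axisymmetric at the points of `U ⊇ tsupport χ`. [folklore]
[cite: Seregin2022LocalAxisym, §2 proof of Thm. 1.2, Step 3 (arXiv:2201.00153 pp. 4–7) (source of the ARGUMENT this module implements; this declaration is the cell’s own lemma or plumbing, NOT a printed statement)] -/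
theorem cutoffField_isAxisymmetric_of_tsupport_subset (hχax : IsAxisymmetricScalar χ)
    (hχU : tsupport χ ⊆ U) {W : EuclideanSpace ℝ (Fin 3) → EuclideanSpace ℝ (Fin 3)}
    (hW : ∀ θ : ℝ, ∀ y ∈ U, W (rotZ θ y) = rotZ θ (W y)) : IsAxisymmetric fun y => χ y • W y := by
  intro θ y
  show χ (rotZ θ y) • W (rotZ θ y) = rotZ θ (χ y • W y)
  rw [hχax θ y]
  by_cases hy : χ y = 0
  · rw [hy, zero_smul, zero_smul]
    ext i
    fin_cases i <;> simp [rotZ]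
  · rw [hW θ y (hχU (subset_tsupport _ (mem_support.2 hy))), ← rotZL_apply, ← rotZL_apply, map_smul]

/-- A uniform bound for the derivatives of order `≤ k` of a smooth compactly supported function.
[folklore]
[cite: Seregin2022LocalAxisym, §2 proof of Thm. 1.2, Step 3 (arXiv:2201.00153 pp. 4–7) (source of the ARGUMENT this module implements; this declaration is the cell’s own lemma or plumbing, NOT a printed statement)] -/
theorem exists_forall_norm_iteratedFDeriv_le_of_hasCompactSupport (hχ : ContDiff ℝ ∞ χ)
    (hχc : HasCompactSupport χ) (k : ℕ) :
    ∃ C : ℝ, 0 ≤ C ∧ ∀ i ≤ k, ∀ y, ‖iteratedFDeriv ℝ i χ y‖ ≤ C := by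
  have hone : ∀ i : ℕ, ∃ C : ℝ, ∀ y, ‖iteratedFDeriv ℝ i χ y‖ ≤ C := fun i =>
    (hχ.continuous_iteratedFDeriv (by exact_mod_cast le_top)).bounded_above_of_compact_support
      (hχc.iteratedFDeriv i)
  induction k with
  | zero =>
    obtain ⟨C, hC⟩ := hone 0
    exact ⟨max C 0, le_max_right _ _, fun i hi y => by
      obtain rfl : i = 0 := Nat.le_zero.1 hi; exact (hC y).trans (le_max_left _ _)⟩
  | succ k ih =>
    obtain ⟨C₁, hC₁0, hC₁⟩ := ih
    obtain ⟨C₂, hC₂⟩ := hone (k + 1)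
    refine ⟨max C₁ C₂, le_max_of_le_left hC₁0, fun i hi y => ?_⟩
    rcases Nat.of_le_succ hi with hi' | rfl
    · exact (hC₁ i hi' y).trans (le_max_left _ _)
    · exact (hC₂ y).trans (le_max_right _ _)

/-- **Uniform-in-`x` time moduli of all `x`-derivatives of the cut-off field** (the hypothesis of
`continuousOn_radQuot_family` / `unifTime_vorticityRHS`): on an open time set `I`, if the slices
`V τ`, `τ ∈ I`, are smooth at the points of an open `U ⊇ tsupport χ` (`χ` smooth, compactly
supported) and all `D_xⁿ V` are jointly continuous on `I × U`, then for every `k`, `τ ∈ I`,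
`ε > 0` there is `δ > 0` with `‖D_xᵏ(χV)(τ', y) − D_xᵏ(χV)(τ, y)‖ ≤ ε` for `τ' ∈ I`,
`|τ' − τ| < δ` and ALL `y`: off `tsupport χ` both terms vanish; on it, the Leibniz bound and
the uniform continuity of `D_xʲV`, `j ≤ k`, on `[τ − δ₀, τ + δ₀] × tsupport χ`. The generic
cut-off form of `unifTime_radialCutoffField`. [folklore]
[cite: Seregin2022LocalAxisym, §2 proof of Thm. 1.2, Step 3 (arXiv:2201.00153 pp. 4–7) (source of the ARGUMENT this module implements; this declaration is the cell’s own lemma or plumbing, NOT a printed statement)] -/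
theorem unifTime_cutoffField_of_tsupport_subset (hI : IsOpen I) (hU : IsOpen U) (hχ : ContDiff ℝ ∞ χ)
    (hχc : HasCompactSupport χ) (hχU : tsupport χ ⊆ U)
    (hVs : ∀ τ ∈ I, ∀ y ∈ U, ContDiffAt ℝ ∞ (V τ) y)
    (hVc : ∀ n : ℕ, ContinuousOn
      (fun w : ℝ × EuclideanSpace ℝ (Fin 3) => iteratedFDeriv ℝ n (V w.1) w.2) (I ×ˢ U)) :
    ∀ k : ℕ, ∀ τ ∈ I, ∀ ε > 0, ∃ δ > 0, ∀ τ' ∈ I, |τ' - τ| < δ → ∀ y,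
      ‖iteratedFDeriv ℝ k (fun y => χ y • V τ' y) y - iteratedFDeriv ℝ k (fun y => χ y • V τ y) y‖ ≤ ε := by
  intro k τ hτ ε hε
  have hcast : ∀ m : ℕ, ((m : ℕ∞) : WithTop ℕ∞) ≤ ((⊤ : ℕ∞) : WithTop ℕ∞) := fun m => by
    exact_mod_cast le_top
  obtain ⟨Cχ, hCχ0, hCχ⟩ := exists_forall_norm_iteratedFDeriv_le_of_hasCompactSupport hχ hχc k
  -- a compact time window inside `I`
  obtain ⟨δ₀, hδ₀, hwin⟩ : ∃ δ₀ > 0, Icc (τ - δ₀) (τ + δ₀) ⊆ I := by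
    obtain ⟨r, hr, hrI⟩ := Metric.isOpen_iff.1 hI τ hτ
    refine ⟨r / 2, half_pos hr, fun s hs => hrI ?_⟩
    rw [mem_ball, Real.dist_eq, abs_lt]
    constructor <;> linarith [hs.1, hs.2]
  set K : Set (ℝ × EuclideanSpace ℝ (Fin 3)) := Icc (τ - δ₀) (τ + δ₀) ×ˢ tsupport χ with hK
  have hKc : IsCompact K := isCompact_Icc.prod hχc
  have hKsub : K ⊆ I ×ˢ U := prod_mono hwin hχU
  have hη : 0 < ε / (2 ^ k * Cχ + 1) := by positivity
  obtain ⟨δ₁, hδ₁, hmod⟩ := exists_forall_norm_iteratedFDeriv_sub_le hKc hKsub hVc k hη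
  refine ⟨min δ₀ δ₁, lt_min hδ₀ hδ₁, fun τ' hτ' hlt y => ?_⟩
  have hlt₀ : |τ' - τ| < δ₀ := hlt.trans_le (min_le_left _ _)
  have hlt₁ : |τ' - τ| < δ₁ := hlt.trans_le (min_le_right _ _)
  by_cases hy : y ∈ tsupport χ
  · -- ## on `tsupport χ`: Leibniz
    have hyU : y ∈ U := hχU hy
    have hτ'w : τ' ∈ Icc (τ - δ₀) (τ + δ₀) := by
      rw [abs_lt] at hlt₀; exact ⟨by linarith, by linarith⟩
    have hτw : τ ∈ Icc (τ - δ₀) (τ + δ₀) := ⟨by linarith, by linarith⟩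
    have ha : ((τ', y) : ℝ × EuclideanSpace ℝ (Fin 3)) ∈ K := ⟨hτ'w, hy⟩
    have hb : ((τ, y) : ℝ × EuclideanSpace ℝ (Fin 3)) ∈ K := ⟨hτw, hy⟩
    have hab : dist ((τ', y) : ℝ × EuclideanSpace ℝ (Fin 3)) (τ, y) < δ₁ := by
      rw [Prod.dist_eq, dist_self, Real.dist_eq]
      exact max_lt hlt₁ (by simpa using hδ₁)
    set D : EuclideanSpace ℝ (Fin 3) → EuclideanSpace ℝ (Fin 3) := V τ' - V τ with hD
    have hDs : ContDiffOn ℝ k D U := fun z hz =>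
      (((hVs τ' hτ' z hz).sub (hVs τ hτ z hz)).of_le (hcast k)).contDiffWithinAt
    have hχs : ContDiffOn ℝ k χ U := (hχ.of_le (hcast k)).contDiffOn
    have hdiff : (fun y => χ y • V τ' y) - (fun y => χ y • V τ y) = fun y => χ y • D y := by
      funext z
      simp only [Pi.sub_apply, hD, smul_sub]
    have hWτ' : ContDiff ℝ ∞ fun y => χ y • V τ' y :=
      cutoffField_contDiff_of_tsupport_subset hχ hχU (hVs τ' hτ')
    have hWτ : ContDiff ℝ ∞ fun y => χ y • V τ y :=
      cutoffField_contDiff_of_tsupport_subset hχ hχU (hVs τ hτ)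
    rw [← iteratedFDeriv_sub_apply (hWτ'.of_le (hcast k)).contDiffAt
      (hWτ.of_le (hcast k)).contDiffAt, hdiff, ← iteratedFDerivWithin_of_isOpen k hU hyU]
    have hleib := norm_iteratedFDerivWithin_smul_le (𝕜 := ℝ) hχs hDs hU.uniqueDiffOn hyU
      (n := k) le_rfl
    refine hleib.trans ?_
    have hterm : ∀ i ∈ Finset.range (k + 1),
        (k.choose i : ℝ) * ‖iteratedFDerivWithin ℝ i χ U y‖ * ‖iteratedFDerivWithin ℝ (k - i) D U y‖ ≤
        (k.choose i : ℝ) * Cχ * (ε / (2 ^ k * Cχ + 1)) := by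
      intro i hi
      have hik : i ≤ k := Nat.lt_succ_iff.1 (Finset.mem_range.1 hi)
      rw [iteratedFDerivWithin_of_isOpen i hU hyU, iteratedFDerivWithin_of_isOpen (k - i) hU hyU]
      have h1 : ‖iteratedFDeriv ℝ (k - i) D y‖ ≤ ε / (2 ^ k * Cχ + 1) := by
        rw [hD, iteratedFDeriv_sub_apply ((hVs τ' hτ' y hyU).of_le (hcast (k - i)))
          ((hVs τ hτ y hyU).of_le (hcast (k - i)))]
        exact hmod (k - i) (Nat.sub_le k i) (τ', y) ha (τ, y) hb hab
      have h2 := hCχ i hik y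
      have h3 : (0 : ℝ) ≤ k.choose i := Nat.cast_nonneg _
      exact mul_le_mul (mul_le_mul_of_nonneg_left h2 h3) h1 (norm_nonneg _) (by positivity)
    refine (Finset.sum_le_sum hterm).trans ?_
    rw [← Finset.sum_mul, ← Finset.sum_mul]
    have hsum : ∑ i ∈ Finset.range (k + 1), (k.choose i : ℝ) = 2 ^ k := by
      rw [← Nat.cast_sum, Nat.sum_range_choose]; norm_num
    rw [hsum]
    have hA : 0 ≤ (2 : ℝ) ^ k * Cχ := mul_nonneg (pow_nonneg zero_le_two k) hCχ0
    calc (2 : ℝ) ^ k * Cχ * (ε / (2 ^ k * Cχ + 1)) = ε * (2 ^ k * Cχ / (2 ^ k * Cχ + 1)) := by ring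
      _ ≤ ε * 1 := by
          refine mul_le_mul_of_nonneg_left ?_ hε.le
          rw [div_le_one (by positivity)]
          linarith
      _ = ε := mul_one ε
  · -- ## off `tsupport χ`: both terms vanish
    have hz : ∀ σ : ℝ, iteratedFDeriv ℝ k (fun y => χ y • V σ y) y = 0 := fun σ => by
      rw [((cutoffField_eventuallyEq_zero' (V σ) hy).iteratedFDeriv ℝ k).eq_of_nhds, iteratedFDeriv_fun_zero]
      rfl
    rw [hz τ', hz τ, sub_zero, norm_zero]
    exact hε.le

end CutoffField

/-! ### The package for the Seregin–Zajaczkowski class -/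

section Package

/-- **The cut-off globalisation of the Seregin–Zajaczkowski representative.** Let `(V, p)` be in
the class `IsSmoothAxisymmetricSolutionOn S V p` on an open `S ⊇ I × 𝒞(0, 1)` (`I` open), let
`0 < r₀ < r₁ < 1` and let `χ` be a smooth axisymmetric cut-off with `χ = 1` on `𝒞(r₀)` and
`tsupport χ ⊆ 𝒞(r₁)` (`exists_cylCutoff`). Then `v t = χ • V t` has: globally `C^∞`
axisymmetric slices vanishing off `B̄(0, 2)` for `t ∈ I`; uniform-in-`x` time moduli of all
`D_xᵏv` on `I`; `v t = V t` near every point of `𝒞(r₀)`; `div v = 0` on `I × 𝒞(r₀)`; and the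
pointwise vorticity equation `d/ds curl (v s) x = Δω − Dω[v t] + D(v t)[ω]` (`ω = curl (v t)`)
at every `(t, x) ∈ I × 𝒞(r₀)` (pressure-free: `vorticity_classical_of_isDistributionalNSSolutionOn`).
These are the structural hypotheses under which the Step-3 key estimate for the local class is
proved. Registered sub-goal toward `stub_sereginLogSwirlOrigin`. [folklore]
[cite: Seregin2022LocalAxisym, §2 proof of Thm. 1.2, Step 3 (arXiv:2201.00153 pp. 4–7) (source of the ARGUMENT this module implements; this declaration is the cell’s own lemma or plumbing, NOT a printed statement)] -/
theorem cutoffFamily_package : ∀ (S : TopologicalSpace.Opens (ℝ × EuclideanSpace ℝ (Fin 3))) (V v : ℝ → EuclideanSpace ℝ (Fin 3) → EuclideanSpace ℝ (Fin 3)) (p : ℝ → EuclideanSpace ℝ (Fin 3) → ℝ) (I : Set ℝ) (χ : EuclideanSpace ℝ (Fin 3) → ℝ) (r₀ r₁ : ℝ), SereginZajaczkowski2007.IsSmoothAxisymmetricSolutionOn S V p → IsOpen I → I ×ˢ SereginSverak2009.spaceCyl 0 1 ⊆ (S : Set (ℝ × EuclideanSpace ℝ (Fin 3))) → 0 < r₀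 → r₀ < r₁ → r₁ < 1 → ContDiff ℝ (⊤ : ℕ∞) χ → IsAxisymmetricScalar χ → (∀ y ∈ SereginSverak2009.spaceCyl 0 r₀, χ y = 1) → tsupport χ ⊆ SereginSverak2009.spaceCyl 0 r₁ → (∀ t, v t = fun y => χ y • V t y) → (∀ t ∈ I, ContDiff ℝ (⊤ : ℕ∞) (v t)) ∧ (∀ t ∈ I, IsAxisymmetric (v t)) ∧ (∀ t ∈ I, ∀ y, 2 < ‖y‖ → v t y = 0) ∧ (∀ k : ℕ, ∀ t ∈ I, ∀ ε > 0, ∃ δ > 0, ∀ t' ∈ I, |t' - t| < δ → ∀ y, ‖iteratedFDeriv ℝ k (v t') y - iteratedFDeriv ℝ k (v t) y‖ ≤ ε) ∧ (∀ t ∈ I, ∀ x ∈ SereginSverak2009.spaceCyl 0 r₀, v t =ᶠ[𝓝 x] V t) ∧ (∀ t ∈ I, ∀ x ∈ SereginSverak2009.spaceCyl 0 r₀, VectorCalculus.divergence (v t) x = 0) ∧ (∀ t ∈ I, ∀ x ∈ SereginSverak2009.spaceCyl 0 r₀, HasDerivAt (fun s => curl (v s) x) ((1 : ℝ) • (Δ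 (curl (v t))) x - fderiv ℝ (curl (v t)) x (v t x) + fderiv ℝ (v t) x (curl (v t) x)) t) := by
  intro S V v p I χ r₀ r₁ hV hI hsub h₀ h₀₁ h₁ hχ hχax hχ1 hχs hv
  set U : Set (EuclideanSpace ℝ (Fin 3)) := SereginSverak2009.spaceCyl 0 1 with hUdef
  have hU : IsOpen U := SereginSverak2009.isOpen_spaceCyl 0 1
  have hmono : ∀ {r : ℝ}, r ≤ 1 → SereginSverak2009.spaceCyl (0 : EuclideanSpace ℝ (Fin 3)) r ⊆ U := by
    intro r hr y hy
    have hy' : cylRadius y < r ∧ |y 2| < r := by simpa [SereginSverak2009.mem_spaceCyl] using hy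
    have : cylRadius y < 1 ∧ |y 2| < 1 := ⟨hy'.1.trans_le hr, hy'.2.trans_le hr⟩
    simpa [hUdef, SereginSverak2009.mem_spaceCyl] using this
  have hχU : tsupport χ ⊆ U := hχs.trans (hmono h₁.le)
  have hχc : HasCompactSupport χ :=
    IsCompact.of_isClosed_subset (isCompact_closedBall _ _) (isClosed_tsupport χ)
      (hχU.trans spaceCyl_subset_closedBall)
  have hVs : ∀ τ ∈ I, ∀ y ∈ U, ContDiffAt ℝ ∞ (V τ) y := fun τ hτ y hy => hV.contDiffAt (τ, y) (hsub ⟨hτ, hy⟩)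
  have hVc : ∀ n : ℕ, ContinuousOn
      (fun w : ℝ × EuclideanSpace ℝ (Fin 3) => iteratedFDeriv ℝ n (V w.1) w.2) (I ×ˢ U) :=
    fun n => (hV.continuousOn_iteratedFDeriv n).mono hsub
  have hO : IsOpen (SereginSverak2009.spaceCyl (0 : EuclideanSpace ℝ (Fin 3)) r₀) := SereginSverak2009.isOpen_spaceCyl 0 r₀
  have hloc : ∀ t ∈ I, ∀ x ∈ SereginSverak2009.spaceCyl (0 : EuclideanSpace ℝ (Fin 3)) r₀, v t =ᶠ[𝓝 x] V t :=
    fun t _ x hx => by rw [hv t]; exact cutoffField_eventuallyEq' (V t) hO hχ1 hx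
  have hsub₀ : I ×ˢ SereginSverak2009.spaceCyl (0 : EuclideanSpace ℝ (Fin 3)) r₀ ⊆ (S : Set (ℝ × EuclideanSpace ℝ (Fin 3))) :=
    (prod_mono le_rfl (hmono (h₀₁.trans h₁).le)).trans hsub
  refine ⟨fun t ht => ?_, fun t ht => ?_, fun t _ y hy => ?_, ?_, hloc, fun t ht x hx => ?_, fun t ht x hx => ?_⟩
  · rw [hv t]; exact cutoffField_contDiff_of_tsupport_subset hχ hχU (hVs t ht)
  · rw [hv t]
    exact cutoffField_isAxisymmetric_of_tsupport_subset hχax hχU fun θ y hy =>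
      hV.axisymmetric θ (t, y) (hsub ⟨ht, hy⟩)
  · have hy' : y ∉ tsupport χ := fun h => by
      have := spaceCyl_subset_closedBall (hχU h)
      rw [mem_closedBall, dist_zero_right] at this
      linarith
    rw [hv t]
    show χ y • V t y = 0
    rw [image_eq_zero_of_notMem_tsupport hy', zero_smul]
  · intro k t ht ε hε
    obtain ⟨δ, hδ, h⟩ := unifTime_cutoffField_of_tsupport_subset hI hU hχ hχc hχU hVs hVc k t ht ε hε
    refine ⟨δ, hδ, fun t' ht' hlt y => ?_⟩
    rw [hv t', hv t]
    exact h t' ht' hlt y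
  · -- `div v = div V = 0` on `I × 𝒞(r₀)`
    have hOI : IsOpen (I ×ˢ U) := hI.prod hU
    have hle : (⟨I ×ˢ U, hOI⟩ : Opens (ℝ × EuclideanSpace ℝ (Fin 3))) ≤ S := hsub
    have hsol : IsDistributionalNSSolutionOn ⟨I ×ˢ U, hOI⟩ 1 0 V p := hV.suitable.distributional.of_le hle
    have hU3 : ∀ t ∈ I, ContDiffOn ℝ 3 (V t) U := fun t ht x hx =>
      ((hVs t ht x hx).of_le (by norm_cast)).contDiffWithinAt
    obtain ⟨hdiv, -⟩ := vorticity_classical_of_isDistributionalNSSolutionOn hI hU hsol hU3 fun n _ => hVc n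
    have hxU : x ∈ U := hmono (h₀₁.trans h₁).le hx
    have h := hdiv (t, x) ⟨ht, hxU⟩
    unfold VectorCalculus.divergence at h ⊢
    rwa [(hloc t ht x hx).fderiv_eq]
  · have h := hasDerivAt_curl_of_isSmoothAxisymmetricSolutionOn hV hI hO hsub₀ hloc ht hx
    simpa only [one_smul] using h

end Package

end Literature.Analysis.SereginLogSwirlOrigin.EulerScaling

end Part7

/-!
## Part 8 — port of `Summits/NavierStokesRegularity/NavierStokesRegularity/Theorems/AxisymmetricExtremalityAxisymmetricKatoGlobalStubSereginLogSwirlOriginStep3LocalKeyEstimateSZ.lean` (2 declarations kept)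

# Seregin 2022, §2 Step 3: the key estimate for the Seregin–Zajaczkowski representative on the
# cylinder (the class the fact's core is stated in) — crux stmt-NavierStokesRegularity-15453
# (`AxisymmetricExtremality.AxisymmetricKatoGlobal`), line registered, support for stub `stub_sereginLogSwirlOrigin`

Support file (`--supports stmt-NavierStokesRegularity-15453`; theorems only, everything proved)
toward the registered stub `stub_sereginLogSwirlOrigin` = the named fact
`Literature.Analysis.FluidPDE.seregin2022_logSwirl_regularAtOrigin` (G. Seregin, J. Math. Fluid
Mech. 24 (2022), Paper 27 = arXiv:2201.00153, §2). Composition of the two siblings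
`…Step3LocalCutoff` (`cutoffFamily_package`: the cut-off globalisation `v = χV` of the
representative has smooth axisymmetric slices with uniform time moduli, agrees with `V` near
`𝒞(ρ₀)`, is divergence free and solves the vorticity equation there) and `…Step3LocalKeyEstimate`
(`cutoff_energy_keyEstimate_local_of_moduli`):

* `cutoff_energy_keyEstimate_of_isSmoothAxisymmetricSolutionOn` (registered sub-goal) — **the
  Step-3 key estimate of Seregin 2022 for `(V, p)` in the class
  `IsSmoothAxisymmetricSolutionOn S V p` on an open `S ⊇ (a, b) × 𝒞(0, 1)`** (suitable weak
  solution on the open cylinder with `C^∞` slices and jointly continuous spatial derivatives —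
  the smooth representative the first-singular-time reduction
  `seregin2022_logSwirl_regularAtOrigin_of_cleanRepr` provides; no time derivative of `V`, no
  regular pressure), `ν = 1`: for the Step-1 cut-off `ζ = η³` (jointly smooth, axisymmetric,
  supported in `𝒞(ρ)`, `ρ < ρ₀ < ρ₁ < 1`) and `v = χV` with a smooth axisymmetric `χ = 1` on
  `𝒞(ρ₀)`, `tsupport χ ⊆ 𝒞(ρ₁)` (`exists_cylCutoff`; so `v = V` on `𝒞(ρ₀) ⊇ supp ζ`, and every
  quantity in the hypotheses and the conclusion is that of the solution there), under the
  hypotheses (2.2) (`|σ| ≤ C₁/ln³(e/r)`, `r < r₁`), the far-field bound `M`, the cut-off bound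
  `Bcut`, the pointwise constants `P₀, …, P₄`, `|B̄(0,2)| ≤ V` and the smallness
  `8C₁/ln(e/r₁) + 13C₁/ln²(e/r₁) + 4ε < 2ν` — all verbatim those of the classical
  `cutoff_energy_keyEstimate_unconditional`, stated for `v` — the conclusion
  `sup_{[t₁,t₂]}(∫(ζΓ)² + ∫(ζΦ)²) ≤ K`, `∫_{t₁}^{t₂}(∫|∇(ζΓ)|² + ∫|∇(ζΦ)|²) ≤ K/(2ν − 8C₁/L − (13C₁/L² + 4ε))`
  with the same constant `K`. This removes the class mismatch between the landed Step-3 chain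
  and the core of the fact (arXiv p. 7: "the key estimate …
  `sup∫η⁶(|Γ|²+|Φ|²) + ∫∫(η³|∇Φ|)²+(η³|∇Γ|)² ≤ C(v,η,r₁)`", run on the singularity-free slab).

## Mathlib / tree search

Tree: `cutoffFamily_package`, `exists_cylCutoff` (`…Step3LocalCutoff`),
`cutoff_energy_keyEstimate_local_of_moduli` (`…Step3LocalKeyEstimate`),
`SereginSverak2009.mem_spaceCyl`, `spaceCyl_subset_closedBall`, `continuous_cylRadius`.
`lean search 'keyEstimate_of_isSmoothAxisymmetricSolutionOn' --decl`: no matches (2026-08-17).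

## References

* G. Seregin, J. Math. Fluid Mech. 24 (2022), Paper No. 27 = arXiv:2201.00153, §2 Steps 1, 3
  (arXiv pp. 5–7, the key estimate). [`Seregin2022LocalAxisym`]
* G. Seregin, W. Zajaczkowski, SIAM J. Math. Anal. 39 (2007) 669–685, Prop. 4.1 (the class).
  [`SereginZajaczkowski2007`]
-/

section Part8

open _root_.MeasureTheory _root_.Set _root_.Filter _root_.Topology _root_.Function _root_.Metric intervalIntegral
  _root_.TopologicalSpace
open scoped _root_.ENNReal _root_.ContDiff Laplacian
open Literature.Analysis.FluidPDE Literature.Analysis.FluidPDE.SereginZajaczkowski2007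

namespace Literature.Analysis.SereginLogSwirlOrigin.EulerScaling

/-- The closed coordinate cylinder `{|x'| ≤ ρ, |x₃| ≤ ρ}` is compact, contains `𝒞(ρ)` and lies in
`𝒞(ρ₀)` for `ρ < ρ₀ ≤ 1`. [folklore]
[cite: Seregin2022LocalAxisym, §2 proof of Thm. 1.2, Step 3 (arXiv:2201.00153 pp. 4–7) (source of the ARGUMENT this module implements; this declaration is the cell’s own lemma or plumbing, NOT a printed statement)] -/
theorem closedCyl_props {ρ ρ₀ : ℝ} (h : ρ < ρ₀) (h1 : ρ₀ ≤ 1) :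
    IsCompact {y : EuclideanSpace ℝ (Fin 3) | cylRadius y ≤ ρ ∧ |y 2| ≤ ρ} ∧
    SereginSverak2009.spaceCyl (0 : EuclideanSpace ℝ (Fin 3)) ρ ⊆ {y | cylRadius y ≤ ρ ∧ |y 2| ≤ ρ} ∧
    {y : EuclideanSpace ℝ (Fin 3) | cylRadius y ≤ ρ ∧ |y 2| ≤ ρ} ⊆ SereginSverak2009.spaceCyl 0 ρ₀ := by
  have hsub : {y : EuclideanSpace ℝ (Fin 3) | cylRadius y ≤ ρ ∧ |y 2| ≤ ρ} ⊆ SereginSverak2009.spaceCyl 0 ρ₀ := by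
    intro y hy
    have : cylRadius y < ρ₀ ∧ |y 2| < ρ₀ := ⟨hy.1.trans_lt h, hy.2.trans_lt h⟩
    simpa [SereginSverak2009.mem_spaceCyl] using this
  have hsub1 : SereginSverak2009.spaceCyl (0 : EuclideanSpace ℝ (Fin 3)) ρ₀ ⊆ SereginSverak2009.spaceCyl 0 1 := by
    intro y hy
    have hy' : cylRadius y < ρ₀ ∧ |y 2| < ρ₀ := by simpa [SereginSverak2009.mem_spaceCyl] using hy
    have : cylRadius y < 1 ∧ |y 2| < 1 := ⟨hy'.1.trans_le h1, hy'.2.trans_le h1⟩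
    simpa [SereginSverak2009.mem_spaceCyl] using this
  refine ⟨?_, fun y hy => ?_, hsub⟩
  · have hcl : IsClosed {y : EuclideanSpace ℝ (Fin 3) | cylRadius y ≤ ρ ∧ |y 2| ≤ ρ} :=
      (isClosed_le continuous_cylRadius continuous_const).inter
        (isClosed_le (contDiff_piLp_apply (𝕜 := ℝ) (p := 2) (n := 0) (i := (2 : Fin 3))).continuous.abs
          continuous_const)
    exact IsCompact.of_isClosed_subset (isCompact_closedBall _ _) hcl
      ((hsub.trans hsub1).trans spaceCyl_subset_closedBall)
  · have hy' : cylRadius y < ρ ∧ |y 2| < ρ := by simpa [SereginSverak2009.mem_spaceCyl] using hy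
    exact ⟨hy'.1.le, hy'.2.le⟩

/-- **Seregin 2022, §2 Step 3 — the key estimate for the Seregin–Zajaczkowski representative on
the cylinder** (`ν = 1`): for `(V, p)` with `IsSmoothAxisymmetricSolutionOn S V p`,
`S ⊇ (a, b) × 𝒞(0, 1)`, the cut-off globalisation `v = χV` (`χ = 1` on `𝒞(ρ₀)`,
`tsupport χ ⊆ 𝒞(ρ₁)`, `ρ₁ < 1`) and a cut-off `ζ` supported in `𝒞(ρ)`, `ρ < ρ₀`, the hypotheses
and the conclusion of `cutoff_energy_keyEstimate_unconditional` stated for `v` (where `v = V`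
near `supp ζ`). `cutoffFamily_package` + `cutoff_energy_keyEstimate_local_of_moduli` with
`K = {|x'| ≤ ρ, |x₃| ≤ ρ}`, `W = 𝒞(ρ₀)`, `R = 2`. Registered sub-goal toward
`stub_sereginLogSwirlOrigin`: it removes the class mismatch between the landed Step-3 chain and
the core of the fact. [cite: Seregin2022LocalAxisym, §2 Step 3 (arXiv:2201.00153 p. 7, the key estimate)] -/
theorem cutoff_energy_keyEstimate_of_isSmoothAxisymmetricSolutionOn : ∀ (S : TopologicalSpace.Opens (ℝ × EuclideanSpace ℝ (Fin 3))) (V v : ℝ → EuclideanSpace ℝ (Fin 3) → EuclideanSpace ℝ (Fin 3)) (p : ℝ → EuclideanSpace ℝ (Fin 3) → ℝ) (χ : EuclideanSpace ℝ (Fin 3) → ℝ) (ζ : ℝ → EuclideanSpace ℝ (Fin 3) → ℝ) (a b ν ρ ρ₀ ρ₁ t₁ t₂ C₁ r₁ M Bcut ε P₀ P₁ P₂ P₃ P₄ Vb : ℝ), SereginZajaczkowski2007.IsSmoothAxisymmetricSolutionOn S V p → Ioo a b ×ˢ SereginSverak2009.spaceCyl 0 1 ⊆ (S : Set (ℝ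 × EuclideanSpace ℝ (Fin 3))) → ν = 1 → 0 < ρ → ρ < ρ₀ → ρ₀ < ρ₁ → ρ₁ < 1 → ContDiff ℝ (⊤ : ℕ∞) χ → IsAxisymmetricScalar χ → (∀ y ∈ SereginSverak2009.spaceCyl 0 ρ₀, χ y = 1) → tsupport χ ⊆ SereginSverak2009.spaceCyl 0 ρ₁ → (∀ t, v t = fun y => χ y • V t y) → IsSmoothSpaceTimeOn (Ioo a b) ζ → (∀ s ∈ Ioo a b, IsAxisymmetricScalar (ζ s)) → (∀ s ∈ Ioo a b, tsupport (ζ s) ⊆ SereginSverak2009.spaceCyl 0 ρ) → Icc t₁ t₂ ⊆ Ioo a b → t₁ ≤ t₂ → 0 ≤ C₁ → 0 < r₁ → r₁ < 1 → 0 ≤ M → 0 ≤ Bcut → 0 < ε → 0 ≤ P₂ → volume.real (closedBall (0 : EuclideanSpace ℝ (Fin 3)) 2) ≤ Vb → (∀ t ∈ Icc t₁ t₂, ∀ x, 0 < cylRadius x → cylRadius x < r₁ → |swirl (v t) x| ≤ C₁ / Real.log (Real.exp 1 / cylRadius x) ^ 3) → (∀ t ∈ Icc t₁ t₂, ∀ x,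 r₁ ≤ cylRadius x → |angVelQuot (v t) x * (ζ t x * angVortQuot (v t) x) * (ζ t x * radVelQuot (curl (v t)) x)| ≤ M) → (∀ t ∈ Icc t₁ t₂, (2 * (∫ x, ζ t x * timeDerivWithin (Ioo a b) ζ t x * angVortQuot (v t) x ^ 2) + 2 * (∫ x, ζ t x * angVortQuot (v t) x ^ 2 * fderiv ℝ (ζ t) x (v t x)) + 2 * ν * (∫ x, angVortQuot (v t) x ^ 2 * ‖fderiv ℝ (ζ t) x‖ ^ 2) - 4 * ν * (∫ x, ζ t x * angVortQuot (v t) x ^ 2 * radDerivQuot (ζ t) x)) + (2 * (∫ x, ζ t x * timeDerivWithin (Ioo a b) ζ t x * radVelQuot (curl (v t)) x ^ 2) + 2 * (∫ x, ζ t x * radVelQuot (curl (v t)) x ^ 2 * fderiv ℝ (ζ t) x (v t x)) + 2 * ν * (∫ x, radVelQuot (curl (v t)) x ^ 2 * ‖fderiv ℝ (ζ t) x‖ ^ 2) - 4 * ν * (∫ x, ζ t x * radVelQuot (curl (v t)) x ^ 2 * radDerivQuot (ζ t) x)) ≤ Bcut) → (∀ t ∈ Icc t₁ t₂, ∀ x,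 r₁ ≤ cylRadius x → |swirlVelocity (v t) x| * ‖fderiv ℝ (fun y => ζ t y * radVelQuot (v t) y) x‖ ≤ P₀) → (∀ t ∈ Icc t₁ t₂, ∀ x, |radVelQuot (v t) x| * |swirlVelocity (v t) x| * ‖fderiv ℝ (ζ t) x‖ ≤ P₁) → (∀ t ∈ Icc t₁ t₂, ∀ x, |ζ t x * radVelQuot (curl (v t)) x| * |swirlVelocity (v t) x| * (‖fderiv ℝ (ζ t) x‖ * ‖fderiv ℝ (radVelQuot (v t)) x‖) ≤ P₂) → (∀ t ∈ Icc t₁ t₂, ∀ x, fderiv ℝ (ζ t) x ≠ 0 → |fderiv ℝ (fun y => fderiv ℝ (ζ t) y (EuclideanSpace.single 2 1) * radVelQuot (v t) y - radDerivQuot (ζ t) y * v t y 2) x (EuclideanSpace.single 2 1)| ≤ P₃) → (∀ t ∈ Icc t₁ t₂, ∀ x, fderiv ℝ (ζ t) x ≠ 0 → |radDerivQuot (fun y => fderiv ℝ (ζ t) y (v t y)) x| ≤ P₄) → 8 * C₁ / Real.log (Real.exp 1 / r₁) + (13 * C₁ / Real.log (Real.exp 1 / r₁) ^ 2 + 4 *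 ε) < 2 * ν → (∀ t ∈ Icc t₁ t₂, (∫ x, (ζ t x * angVortQuot (v t) x) ^ 2) + (∫ x, (ζ t x * radVelQuot (curl (v t)) x) ^ 2) ≤ (∫ x, (ζ t₁ x * angVortQuot (v t₁) x) ^ 2) + (∫ x, (ζ t₁ x * radVelQuot (curl (v t₁)) x) ^ 2) + (Bcut + (12 * C₁ * (P₃ ^ 2 + P₄ ^ 2) * Vb / Real.log (Real.exp 1 / r₁) ^ 2 + ((P₀ ^ 2 + P₁ ^ 2) / (2 * ε) + 2 * P₂) * Vb) + 4 * M * Vb) * (t₂ - t₁)) ∧ ∫ s in t₁..t₂, ((∫ x, ‖fderiv ℝ (fun y => ζ s y * angVortQuot (v s) y) x‖ ^ 2) + (∫ x, ‖fderiv ℝ (fun y => ζ s y * radVelQuot (curl (v s)) y) x‖ ^ 2)) ≤ ((∫ x, (ζ t₁ x * angVortQuot (v t₁) x) ^ 2) + (∫ x, (ζ t₁ x * radVelQuot (curl (v t₁)) x) ^ 2) + (Bcut + (12 * C₁ * (P₃ ^ 2 + P₄ ^ 2) * Vb / Real.log (Real.exp 1 / r₁) ^ 2 + ((P₀ ^ 2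 + P₁ ^ 2) / (2 * ε) + 2 * P₂) * Vb) + 4 * M * Vb) * (t₂ - t₁)) / (2 * ν - 8 * C₁ / Real.log (Real.exp 1 / r₁) - (13 * C₁ / Real.log (Real.exp 1 / r₁) ^ 2 + 4 * ε)) := by
  intro S V v p χ ζ a b ν ρ ρ₀ ρ₁ t₁ t₂ C₁ r₁ M Bcut ε P₀ P₁ P₂ P₃ P₄ Vc hV hsubS hν1 hρ hρρ₀ h₀₁ h₁ hχ hχax hχ1 hχs hv hζ hζax hζρ hsub h12 hC₁ hr₁ hr₁1 hM hBcut hε hP₂ hVc hσ hfar hcut hP0 hP1 hP2 hP3 hP4 hsmall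
  subst hν1
  have hI : IsOpen (Ioo a b) := isOpen_Ioo
  obtain ⟨hsm, hax, hR, hU, -, hdiv, hvort⟩ := cutoffFamily_package S V v p (Ioo a b) χ ρ₀ ρ₁ hV hI hsubS
    (hρ.trans hρρ₀) h₀₁ h₁ hχ hχax hχ1 hχs hv
  obtain ⟨hKc, hρK, hKW⟩ := closedCyl_props hρρ₀ (h₀₁.trans h₁).le
  have hsupp : ∀ s ∈ Ioo a b, ∀ x ∉ {y : EuclideanSpace ℝ (Fin 3) | cylRadius y ≤ ρ ∧ |y 2| ≤ ρ}, ζ s x = 0 :=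
    fun s hs x hx => image_eq_zero_of_notMem_tsupport fun h => hx (hρK (hζρ s hs h))
  have hζ1 : ∀ s ∈ Ioo a b, tsupport (ζ s) ⊆ SereginSverak2009.spaceCyl 0 1 := fun s hs =>
    ((hζρ s hs).trans hρK).trans (hKW.trans fun y hy => by
      have hy' : cylRadius y < ρ₀ ∧ |y 2| < ρ₀ := by simpa [SereginSverak2009.mem_spaceCyl] using hy
      have : cylRadius y < 1 ∧ |y 2| < 1 := ⟨hy'.1.trans (h₀₁.trans h₁), hy'.2.trans (h₀₁.trans h₁)⟩
      simpa [SereginSverak2009.mem_spaceCyl] using this)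
  have hvort' : ∀ s ∈ Ioo a b, ∀ x ∈ SereginSverak2009.spaceCyl (0 : EuclideanSpace ℝ (Fin 3)) ρ₀, cylRadius x ≠ 0 →
      HasDerivAt (fun s' => curl (v s') x) ((1 : ℝ) • (Δ (curl (v s))) x - fderiv ℝ (curl (v s)) x (v s x) +
        fderiv ℝ (v s) x (curl (v s) x)) s := fun s hs x hx _ => hvort s hs x hx
  exact cutoff_energy_keyEstimate_local_of_moduli a b 1 v ζ {y | cylRadius y ≤ ρ ∧ |y 2| ≤ ρ}
    (SereginSverak2009.spaceCyl 0 ρ₀) 2 t₁ t₂ C₁ r₁ M Bcut ε P₀ P₁ P₂ P₃ P₄ Vc hsm hax zero_le_one hζ hζax hζ1 hsub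
    hKc hsupp (SereginSverak2009.isOpen_spaceCyl 0 ρ₀) hKW hdiv hvort' hR hU h12 hC₁ hr₁ hr₁1 hM hBcut hε hP₂ hVc
    hσ hfar hcut hP0 hP1 hP2 hP3 hP4 hsmall

end Literature.Analysis.SereginLogSwirlOrigin.EulerScaling

end Part8

/-!
## Part 9 — port of `Summits/NavierStokesRegularity/NavierStokesRegularity/Theorems/AxisymmetricExtremalityAxisymmetricKatoGlobalStubSereginLogSwirlOrigin.lean` (3 declarations kept)

# Crux `AxisymmetricKatoGlobal` (stmt-NavierStokesRegularity-15453), line `registered`, stub 2a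
# `stub_sereginLogSwirlOrigin`: Seregin's logarithmic swirl criterion at the origin (J. Math.
# Fluid Mech. 24 (2022), §2) fully assembled — discharges the named fact
# `Literature.Analysis.FluidPDE.seregin2022_logSwirl_regularAtOrigin`

Stub file (`--supports stmt-NavierStokesRegularity-15453`; theorems only, everything proved) of
the registered stub `stub_sereginLogSwirlOrigin` of the union skeleton
`Cruxes/AxisymmetricKatoGlobal/Lines/euler_scaling.lean`, whose statement is VERBATIM the named
fact `Literature.Analysis.FluidPDE.seregin2022_logSwirl_regularAtOrigin` (G. Seregin, *A note on
local regularity of axisymmetric solutions to the Navier–Stokes equations*, J. Math. Fluid Mech.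
24 (2022), Paper 27 = arXiv:2201.00153, §2: a suitable weak solution of the unit-viscosity system
in `Q = 𝒞 × ]-1, 0[` in the classes of Def. 1.1 with axisymmetric slices and the swirl bound
(2.2) `|σ| ≤ C₁/ln³(e/|x'|)` has the origin as a regular point).

The discharge was assembled over this session's waves (all in this namespace, files
`…StubSereginLogSwirlOrigin<X>.lean`): Step 1 (first singular time, top-time partial regularity,
clean slab, Seregin–Zajaczkowski representative: `…TopTimePartialRegularity` p156541,
`…ParabolicNullLines` p155244, `…FirstSingular` p167588, `…CleanSlabRepr` p167975,
`…FinalReduction` p168224; normalisation to the origin `…CoreNormalise{Rescale,Transport,}`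
p170404 p170475 p170530; cut-off and constants `…Step1Cutoff{,Pointwise,Constants,Bcut,Compact,Chain}`
p169882 p170211 p170453 p170526 p170631 p170786), Step 2 (Lemma 2.1: `…HmidiRousset` p156828,
`…CFZBounds` p158244, `…CutoffDivCurl{,Poloidal,SecondOrder}` p158842 p159232 p159652,
`…Lemma21Local{Identity,,Cutoff}` p161754 p162044 p162518; Lemma 2.2: `…LerayLogHardy` p154501),
Step 3 (`…Step13Tools` p156441, `…Step3{CutoffCalculus,Gamma,Balance,Integrated,SwirlSource,Absorb,StreamForm,SourcePhi,KeyEstimate,KeyUnconditional}`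
p162219 … p167165, local port `…Step3Local{Equations,EquationsPhi,Class,Balance,Integrated,Apriori,KeyEstimate0,Families,FamiliesW,Cutoff,KeyEstimate,KeyEstimateSZ}`
p170436 … p171742), Step 4 (`…VThetaPassage` p157337, `…Step4Assembly{Poloidal,Swirl,Parts,,KeyEstimate}`
p163258 p166696 p167315 p167532 p167718, `…Step4Endgame` p154978), and the bridges for the
cut-off globalisation `…CoreAtOriginBridges` (p171907).  This file closes it:

* `tendsto_cubicC_of_smooth_cleanConfig` — **Steps 1 + 3 + 4 for the Seregin–Zajaczkowski
  representative** (the class of the fact's core): clean configuration at `(0, 1)` + (2.2) for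
  `W` on `Q` off the axis + energy bound ⇒ `SereginSverak2009.cubicC 0 R W → 0` (`R → 0⁺`).
  The chain of `tendsto_cubicC_of_classical_cleanConfig` (`…Step1CutoffChain`) re-run verbatim
  for `v = χW` (`exists_cylCutoff`, `cutoffFamily_package`, radii
  `1 - 3δ/8 < 1 - δ/4 < 1 - δ/8 < 1`, so that the support box of the Step-1 cut-off `ζ` and the
  regular region `K` lie in `𝒞(1 - δ/4)` where `v = W`) with the LOCAL key estimate
  `cutoff_energy_keyEstimate_of_isSmoothAxisymmetricSolutionOn` in place of the classical one,
  the bridges being: (2.2) for `v` globally off the axis (`swirlBound_cutoffField`), the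
  derivative bounds of `W` on `K` transported to `v` (`derivBounds_of_eventuallyEq`), the energy
  bound and measurability (`energyBound_cutoffField`, `aestronglyMeasurable_cutoffField`), the
  gradient forms `‖∇f‖² = Σ(∂ᵢf)²` (`norm_fderiv_sq_eq_sum_sq`) in `hcut` and in the dissipation,
  the continuity of the dissipation densities from the uniform time moduli
  (`continuousOn_dissipation_cutoffField`), and `cubicC 0 R v = cubicC 0 R W` for `R ≤ 1 - δ/4`
  (`cubicC_cutoffField`);
* `isRegularAtOrigin_coreAtOrigin` — **the core at the origin holds**: the hypothesis of
  `seregin2022_logSwirl_regularAtOrigin_of_coreAtOrigin` (`…CoreNormalise`) verbatim, by the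
  endgame `isRegularAtOrigin_of_tendsto_cubicC` and `tendsto_cubicC_congr_ae` (`u = W` a.e.);
* `stub_sereginLogSwirlOrigin` (THE REGISTERED STUB) — by
  `seregin2022_logSwirl_regularAtOrigin_of_coreAtOrigin isRegularAtOrigin_coreAtOrigin`;
* `seregin2022_logSwirl_regularAtOrigin_holds` — the named Literature fact, discharged.

With the c1 capstone `Registered.AxisymmetricKatoGlobal_of_logSwirlFacts` the crux then rests,
along composition B of the skeleton, on `stub_swirlAxisModulus` alone.

## Mathlib / tree search

Tree: everything named above + `exists_step1_cutoff`, `exists_uniform_derivBounds`,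
`exists_cutoff_derivBounds`, `step3_pointwiseConstants`, `cut_bound`, `exists_radius_logSmall`,
`tendsto_cubicC_of_keyEstimate`, `smallness_of_logSmall`, `le_uniform_of_le`,
`le_uniform_div_of_le`, `parCyl_zero_one_eq_prod`, `mem_spaceCyl_zero_iff`, `spaceCyl_subset_box`.
Mathlib: `Ioc_mem_nhdsGT`, `Filter.Tendsto.congr'`.
`lean search 'seregin2022_logSwirl_regularAtOrigin_holds|tendsto_cubicC_of_smooth' --decl`:
no matches (2026-08-17); `lean find 'logSwirl'`, `lean find 'IsRegularAtOrigin'`: no stockroom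
matches.

## References

* G. Seregin, J. Math. Fluid Mech. 24 (2022), Paper No. 27 = arXiv:2201.00153, Thm. 1.2 and
  §2 proof, Steps 1–4 (arXiv pp. 5–7). [`Seregin2022LocalAxisym`]
* G. Seregin, W. Zajaczkowski, SIAM J. Math. Anal. 39 (2007) 669–685, Prop. 4.1 (the class).
  [`SereginZajaczkowski2007`]
* G. Seregin, V. Šverák, Comm. PDE 34 (2009) = arXiv:0804.1803, §3 (regular points).
  [`SereginSverak2009`]

Not carried from this source module (not needed by the declarations re-homed here; their consumers are Summits-side): `seregin2022_logSwirl_regularAtOrigin_holds`.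
-/

section Part9

open _root_.Set _root_.Filter _root_.Topology _root_.Function _root_.Metric _root_.MeasureTheory intervalIntegral
open scoped _root_.ENNReal _root_.NNReal
open Literature.Analysis.FluidPDE Literature.Analysis.FluidPDE.SereginZajaczkowski2007

namespace Literature.Analysis.SereginLogSwirlOrigin.EulerScaling

/-! ### The chain for the Seregin–Zajaczkowski representative -/

/-- **Seregin 2022, §2 Steps 1 + 3 + 4 at the normalised position `(0, 1)`, for the
Seregin–Zajaczkowski representative: the clean configuration implies `C(R) → 0`.** Let `(W, π)`
be in the class `IsSmoothAxisymmetricSolutionOn Q W π` on `Q = Q(0, 1) = 𝒞 × ]-1, 0[` (suitable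
weak solution with `C^∞` axisymmetric slices and jointly continuous spatial derivatives), with
the swirl bound (2.2) `|σ(W)(t, x)| ≤ C₁/ln³(e/ϱ(x))` on `Q` off the axis (`C₁ ≥ 0`) and the
energy bound `∫_𝒞 |W(t)|² ≤ A`, `t ∈ ]-1, 0[`. Assume the clean configuration at `(0, 1)`:
heights and width `h₋, h₊, δ` with `δ > 0`, `-1 ≤ h₋ - δ`, `h₋ + δ < 0 < h₊ - δ`, `h₊ + δ ≤ 1`,
and at every `a ∈ 𝒞` with `0 < ϱ(a) ∨ |a₃ - h₊| < δ ∨ |a₃ - h₋| < δ` a radius `ρ > 0` such that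
every `D_xⁿW` is bounded on `Q((0, a), ρ)`. Then `SereginSverak2009.cubicC 0 R W → 0` as
`R → 0⁺`. Proof: the chain of `tendsto_cubicC_of_classical_cleanConfig` run for the cut-off
globalisation `v = χW` (`χ = 1` on `𝒞(1 - δ/4)`, `tsupport χ ⊆ 𝒞(1 - δ/8)`): Step-1 cut-off
(radii `1/8 < 1/4`, support box inside `𝒞(1 - 3δ/8)`), smallness radius
(`exists_radius_logSmall 42 C₁`), compact regular region and uniform bounds, constants, the LOCAL
key estimate `cutoff_energy_keyEstimate_of_isSmoothAxisymmetricSolutionOn` (`ν = 1`, `ε = 1/4`)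
on `[t₁, t₂]` for every `t₂ < 0`, Step 4 (`tendsto_cubicC_of_keyEstimate`) for `v`, and
`C(R; v) = C(R; W)` for small `R`.
[cite: Seregin2022LocalAxisym, §2 Steps 1, 3, 4 (arXiv:2201.00153 pp. 5–7)] -/
theorem tendsto_cubicC_of_smooth_cleanConfig : ∀ (W : ℝ → EuclideanSpace ℝ (Fin 3) → EuclideanSpace ℝ (Fin 3)) (π : ℝ → EuclideanSpace ℝ (Fin 3) → ℝ) (hp hm δ C₁ : ℝ) (A : ℝ≥0), SereginZajaczkowski2007.IsSmoothAxisymmetricSolutionOn (SereginSverak2009.parCylOpens 0 1) W π → 0 < δ → -1 ≤ hm - δ → hm + δ < 0 → 0 < hp - δ → hp + δ ≤ 1 → 0 ≤ C₁ → (∀ z ∈ SereginSverak2009.parCyl (0 : ℝ × EuclideanSpace ℝ (Fin 3)) 1, 0 < cylRadius z.2 → |swirl (W z.1) z.2| ≤ C₁ / Real.log (Real.exp 1 / cylRadius z.2) ^ 3) → (∀ t ∈ Ioo (-1 : ℝ) 0, ∫⁻ x in SereginSverak2009.spaceCyl 0 1, ‖W t x‖ₑ ^ 2 ≤ A) → (∀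 a ∈ SereginSverak2009.spaceCyl (0 : EuclideanSpace ℝ (Fin 3)) 1, (0 < cylRadius a ∨ |a 2 - hp| < δ ∨ |a 2 - hm| < δ) → ∃ ρ > 0, ∀ n : ℕ, ∃ C : ℝ, ∀ w ∈ parabolicCylinder ρ ((0 : ℝ), a), ‖iteratedFDeriv ℝ n (W w.1) w.2‖ ≤ C) → Tendsto (fun R => SereginSverak2009.cubicC 0 R W) (𝓝[>] 0) (𝓝 0) := by
  -- adapted from `tendsto_cubicC_of_classical_cleanConfig`
  -- (Theorems/AxisymmetricExtremalityAxisymmetricKatoGlobalStubSereginLogSwirlOriginStep1CutoffChain.lean)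
  intro W π hp hm δ C₁ A hW hδ hm1 hm0 hp0 hp1 hC₁ hσ hA hcore
  -- Step 1 (a): the cut-off
  obtain ⟨ζ, hζC, hζax, hζc, hζ01, hplat, -, hts, hts1, hgradT, -⟩ :=
    exists_step1_cutoff (1 / 8) (1 / 4) hp hm δ (by norm_num) (by norm_num) (by norm_num) hδ hm1 hm0 hp0 hp1
  have hζ4 : ContDiff ℝ 4 ζ := hζC.of_le (by norm_cast)
  have hζ2 : ContDiff ℝ 2 ζ := hζC.of_le (by norm_cast)
  -- the globalisation `v = χW`: radii `ρa < ρb < ρc < 1`, support box of `ζ` inside `𝒞(ρa)`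
  have hδ2 : δ < 1 / 2 := by linarith
  set ρa : ℝ := 1 - 3 * δ / 8 with hρa
  set ρb : ℝ := 1 - δ / 4 with hρb
  set ρc : ℝ := 1 - δ / 8 with hρc
  have hρa0 : 0 < ρa := by rw [hρa]; linarith
  have hab : ρa < ρb := by rw [hρa, hρb]; linarith
  have hbc : ρb < ρc := by rw [hρb, hρc]; linarith
  have hc1 : ρc < 1 := by rw [hρc]; linarith
  have hmono : ∀ {r r' : ℝ}, r ≤ r' → SereginSverak2009.spaceCyl (0 : EuclideanSpace ℝ (Fin 3)) r ⊆
      SereginSverak2009.spaceCyl 0 r' := fun h y hy => by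
    rw [mem_spaceCyl_zero_iff] at hy ⊢; exact ⟨hy.1.trans_le h, hy.2.trans_le h⟩
  have hbox : {x : EuclideanSpace ℝ (Fin 3) | cylRadius x ≤ 1 / 4 ∧ hm - δ / 2 ≤ x 2 ∧ x 2 ≤ hp + δ / 2} ⊆
      SereginSverak2009.spaceCyl 0 ρa := by
    rintro x ⟨h1, h2, h3⟩
    rw [mem_spaceCyl_zero_iff, hρa]
    exact ⟨by linarith, abs_lt.2 ⟨by linarith, by linarith⟩⟩
  obtain ⟨χ, hχ, hχax, hχ01, hχ1, hχs⟩ := exists_cylCutoff (hρa0.trans hab) hbc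
  obtain ⟨v, hv⟩ : ∃ v : ℝ → EuclideanSpace ℝ (Fin 3) → EuclideanSpace ℝ (Fin 3), ∀ t, v t = fun y => χ y • W t y :=
    ⟨_, fun _ => rfl⟩
  have hsubS : Ioo (-1 : ℝ) 0 ×ˢ SereginSverak2009.spaceCyl (0 : EuclideanSpace ℝ (Fin 3)) 1 ⊆
      ((SereginSverak2009.parCylOpens 0 1 : TopologicalSpace.Opens (ℝ × EuclideanSpace ℝ (Fin 3))) :
        Set (ℝ × EuclideanSpace ℝ (Fin 3))) := by
    rw [SereginSverak2009.coe_parCylOpens, parCyl_zero_one_eq_prod]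
  obtain ⟨hsm, hax, hR2, hU, hloc, hdiv, -⟩ := cutoffFamily_package (SereginSverak2009.parCylOpens 0 1) W v π
    (Ioo (-1 : ℝ) 0) χ ρb ρc hW isOpen_Ioo hsubS (hρa0.trans hab) hbc hc1 hχ hχax hχ1 hχs hv
  have hχs1 : tsupport χ ⊆ SereginSverak2009.spaceCyl (0 : EuclideanSpace ℝ (Fin 3)) 1 := hχs.trans (hmono hc1.le)
  have hσv := swirlBound_cutoffField hv hχ01 hχs1 hC₁ hσ
  -- Step 3 (a): the smallness radius and `r₁`
  obtain ⟨rs, hrs, hsmallr⟩ := exists_radius_logSmall 42 C₁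
  set r₁ : ℝ := min rs (min (1 / 8) (min (hp - δ / 2) (-(hm + δ / 2)))) with hr₁def
  have hr₁pos : 0 < r₁ := lt_min hrs.1 (lt_min (by norm_num) (lt_min (by linarith) (by linarith)))
  have hr₁rs : r₁ ≤ rs := min_le_left _ _
  have hr₁8 : r₁ ≤ 1 / 8 := (min_le_right _ _).trans (min_le_left _ _)
  have hr₁p : r₁ ≤ hp - δ / 2 := (min_le_right _ _).trans ((min_le_right _ _).trans (min_le_left _ _))
  have hr₁m : r₁ ≤ -(hm + δ / 2) := (min_le_right _ _).trans ((min_le_right _ _).trans (min_le_right _ _))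
  have hr₁1 : r₁ < 1 := by linarith
  have hr₁b : r₁ ≤ ρb := by rw [hρb]; linarith
  have hL1 : 1 ≤ Real.log (Real.exp 1 / r₁) := one_le_log_exp_div hr₁pos hr₁1.le
  have hsmall : 8 * C₁ / Real.log (Real.exp 1 / r₁) + (13 * C₁ / Real.log (Real.exp 1 / r₁) ^ 2 + 4 * (1 / 4 : ℝ)) < 2 * 1 :=
    smallness_of_logSmall hC₁ hL1 (hsmallr r₁ ⟨hr₁pos, hr₁rs⟩)
  -- Step 1 (b): the compact regular region `K`
  set K : Set (EuclideanSpace ℝ (Fin 3)) :=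
    {x | cylRadius x ≤ 1 / 4 ∧ hm - δ / 2 ≤ x 2 ∧ x 2 ≤ hp + δ / 2 ∧
      ((1 / 8 : ℝ) ≤ cylRadius x ∨ |x 2 - hp| ≤ δ / 2 ∨ |x 2 - hm| ≤ δ / 2)} ∪
    ({x | cylRadius x ≤ 1 / 4 ∧ hm - δ / 2 ≤ x 2 ∧ x 2 ≤ hp + δ / 2} ∩ {x | r₁ ≤ cylRadius x}) with hKdef
  have hKbox : K ⊆ {x | cylRadius x ≤ 1 / 4 ∧ hm - δ / 2 ≤ x 2 ∧ x 2 ≤ hp + δ / 2} := by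
    rintro x (⟨h1, h2, h3, -⟩ | ⟨hx, -⟩)
    exacts [⟨h1, h2, h3⟩, hx]
  have hKc : IsCompact K :=
    (isCompact_box (by norm_num) hδ hm1 hp1).of_isClosed_subset
      ((isClosed_gradBox _ _ _ _ _ _ _).union ((isClosed_box _ _ _).inter
        (isClosed_le continuous_const continuous_cylRadius))) hKbox
  have hKgrad : tsupport (fderiv ℝ ζ) ⊆ K := fun x hx => Or.inl (hgradT hx)
  have hKfar : ∀ x ∈ tsupport ζ, r₁ ≤ cylRadius x → x ∈ K := fun x hx hr => Or.inr ⟨hts hx, hr⟩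
  have hKgood : ∀ a ∈ K, a ∈ SereginSverak2009.spaceCyl (0 : EuclideanSpace ℝ (Fin 3)) 1 ∧
      (0 < cylRadius a ∨ |a 2 - hp| < δ ∨ |a 2 - hm| < δ) := by
    intro a ha
    refine ⟨box_subset_spaceCyl (by norm_num) hδ hm1 hp1 (hKbox ha), ?_⟩
    rcases ha with ⟨-, -, -, h4⟩ | ⟨-, hr⟩
    · exact good_of_mem_gradBox (by norm_num) hδ h4
    · exact Or.inl (hr₁pos.trans_le hr)
  -- Step 1 (c): uniform bounds on `K` up to the top time, for `W` and then for `v = W` near `K`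
  obtain ⟨ρ, hρ, D₀, D₁, D₂, hD₀, hD₁, hD₂, hD⟩ := exists_uniform_derivBounds W K hKc
    fun a ha => hcore a (hKgood a ha).1 (hKgood a ha).2
  obtain ⟨Z₁, Z₂, Z₃, Q₀, Q₁, hZ₁0, hZ₂0, hZ₃0, hQ₀0, hQ₁0, hZ₁, hZ₂, hZ₃, hQ₀, hQ₁⟩ :=
    exists_cutoff_derivBounds hζ4 hζc hζax
  -- the final slab `]t₁, 0[`
  set ρ' : ℝ := min ρ 1 with hρ'
  have hρ'0 : 0 < ρ' := lt_min hρ one_pos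
  set t₁ : ℝ := -ρ' ^ 2 / 2 with ht₁def
  have ht₁0 : t₁ < 0 := by rw [ht₁def]; have := pow_pos hρ'0 2; linarith
  have ht₁1 : -1 < t₁ := by
    rw [ht₁def]
    have h1 : ρ' ^ 2 ≤ 1 := by
      have := pow_le_pow_left₀ hρ'0.le (min_le_right ρ 1) 2
      simpa using this
    linarith
  have ht₁ρ : -ρ ^ 2 < t₁ := by
    rw [ht₁def]
    have h1 : ρ' ^ 2 ≤ ρ ^ 2 := pow_le_pow_left₀ hρ'0.le (min_le_left ρ 1) 2
    have := pow_pos hρ'0 2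
    linarith
  have hslab : ∀ t, t₁ ≤ t → t < 0 → t ∈ Ioo (-1 : ℝ) 0 ∧ t ∈ Ioo (-ρ ^ 2) 0 := fun t h1 h2 =>
    ⟨⟨ht₁1.trans_le h1, h2⟩, ⟨ht₁ρ.trans_le h1, h2⟩⟩
  have hDv : ∀ t, t₁ ≤ t → t < 0 → ∀ x ∈ K,
      ‖v t x‖ ≤ D₀ ∧ ‖fderiv ℝ (v t) x‖ ≤ D₁ ∧ ‖iteratedFDeriv ℝ 2 (v t) x‖ ≤ D₂ := fun t h1 h2 x hx =>
    derivBounds_of_eventuallyEq (hloc t (hslab t h1 h2).1 x (hmono hab.le (hbox (hKbox hx))))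
      (hD t (hslab t h1 h2).2 x hx)
  -- regularity of the slices of `v`
  have hV4 : ∀ t ∈ Ioo (-1 : ℝ) 0, ContDiff ℝ 4 (v t) := fun t ht => (hsm t ht).of_le (by norm_cast)
  have hV3 : ∀ t ∈ Ioo (-1 : ℝ) 0, ContDiff ℝ 3 (v t) := fun t ht => (hV4 t ht).of_le (by norm_num)
  -- the constants
  set κ : ℝ := ‖curlCLM‖ with hκ
  set Vb : ℝ := volume.real (closedBall (0 : EuclideanSpace ℝ (Fin 3)) 2) with hVb
  have hVb0 : 0 ≤ Vb := measureReal_nonneg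
  set M : ℝ := D₁ * (κ * D₂) ^ 2 with hMdef
  set P₀ : ℝ := D₀ * D₁ * Z₁ + 4 * D₁ ^ 2 with hP₀def
  set P₁ : ℝ := D₁ * D₀ * Z₁ with hP₁def
  set P₂ : ℝ := κ * D₂ * Z₁ * (4 * D₁ ^ 2) with hP₂def
  set P₃ : ℝ := Z₁ * D₂ + Z₂ * D₁ + Q₀ * D₁ + Q₁ * D₀ with hP₃def
  set P₄ : ℝ := Z₁ * D₂ + 2 * Z₂ * D₁ + Z₃ * D₀ with hP₄def
  set Bcut : ℝ := 2 * ((2 * (Z₁ * D₀) + 2 * 1 * Z₁ ^ 2 + 4 * 1 * Q₀) * (κ * D₂) ^ 2 * Vb) with hBcutdef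
  have hκ0 : 0 ≤ κ := by rw [hκ]; exact norm_nonneg curlCLM
  have hM0 : 0 ≤ M := by positivity
  have hP₂0 : 0 ≤ P₂ := by positivity
  have hBcut0 : 0 ≤ Bcut := by positivity
  -- pointwise constants at every time of the slab
  have hpt : ∀ t, t₁ ≤ t → t < 0 → _ := fun t h1 h2 =>
    step3_pointwiseConstants (v t) ζ K r₁ D₀ D₁ D₂ Z₁ Z₂ Z₃ Q₀ Q₁ (hV3 t (hslab t h1 h2).1)
      (hax t (hslab t h1 h2).1) hζ4 hζax hζ01 hKgrad hKfar hD₀ hD₁ hD₂ hZ₁0 hZ₂0 hZ₃0 hQ₀0 hZ₁ hZ₂ hZ₃ hQ₀ hQ₁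
      (fun x hx => (hDv t h1 h2 x hx).1) (fun x hx => (hDv t h1 h2 x hx).2.1)
      (fun x hx => (hDv t h1 h2 x hx).2.2)
  have hcutt : ∀ t, t₁ ≤ t → t < 0 → _ := fun t h1 h2 =>
    cut_bound (v t) ζ K (-1) 0 1 t D₀ D₂ Z₁ Q₀ Vb (hV3 t (hslab t h1 h2).1) (hax t (hslab t h1 h2).1) hζ2
      hζax hζ01 hts1 hKgrad zero_le_one hD₀ hD₂ hZ₁0 hQ₀0 le_rfl hZ₁ hQ₀
      (fun x hx => (hDv t h1 h2 x hx).1) (fun x hx => (hDv t h1 h2 x hx).2.2)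
  -- the cut-off as a (time-independent) space-time function
  have hζst : IsSmoothSpaceTimeOn (Ioo (-1 : ℝ) 0) (fun _ : ℝ => ζ) := (hζC.comp contDiff_snd).contDiffOn
  -- Step 3: the LOCAL key estimate on `[t₁, t₂]`, every `t₂ ∈ ]t₁, 0[`
  have hkey : ∀ t₂ ∈ Ioo t₁ 0, _ := fun t₂ ht₂ =>
    cutoff_energy_keyEstimate_of_isSmoothAxisymmetricSolutionOn (SereginSverak2009.parCylOpens 0 1) W v π χ
      (fun _ : ℝ => ζ) (-1) 0 1 ρa ρb ρc t₁ t₂ C₁ r₁ M Bcut (1 / 4) P₀ P₁ P₂ P₃ P₄ Vb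
      hW hsubS rfl hρa0 hab hbc hc1 hχ hχax hχ1 hχs hv hζst (fun s _ => hζax) (fun s _ => hts.trans hbox)
      (fun t ht => (hslab t ht.1 (ht.2.trans_lt ht₂.2)).1) ht₂.1.le hC₁ hr₁pos hr₁1 hM0 hBcut0 (by norm_num) hP₂0 le_rfl
      (fun t ht x hx0 hxr => hσv t (hslab t ht.1 (ht.2.trans_lt ht₂.2)).1 x hx0 (hxr.trans hr₁1))
      (fun t ht => (hpt t ht.1 (ht.2.trans_lt ht₂.2)).1)
      (fun t ht => by
        have h := hcutt t ht.1 (ht.2.trans_lt ht₂.2)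
        simp only [← norm_fderiv_sq_eq_sum_sq] at h
        exact h)
      (fun t ht => (hpt t ht.1 (ht.2.trans_lt ht₂.2)).2.1)
      (fun t ht => (hpt t ht.1 (ht.2.trans_lt ht₂.2)).2.2.1)
      (fun t ht => (hpt t ht.1 (ht.2.trans_lt ht₂.2)).2.2.2.1)
      (fun t ht => (hpt t ht.1 (ht.2.trans_lt ht₂.2)).2.2.2.2.1)
      (fun t ht => (hpt t ht.1 (ht.2.trans_lt ht₂.2)).2.2.2.2.2.1)
      hsmall
  -- uniformity of the constants in `t₂`
  have hL0 : 0 < Real.log (Real.exp 1 / r₁) := zero_lt_one.trans_le hL1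
  have hSc0 : 0 ≤ Bcut + (12 * C₁ * (P₃ ^ 2 + P₄ ^ 2) * Vb / Real.log (Real.exp 1 / r₁) ^ 2 +
      ((P₀ ^ 2 + P₁ ^ 2) / (2 * (1 / 4 : ℝ)) + 2 * P₂) * Vb) + 4 * M * Vb := by positivity
  have hden0 : 0 < 2 * 1 - 8 * C₁ / Real.log (Real.exp 1 / r₁) -
      (13 * C₁ / Real.log (Real.exp 1 / r₁) ^ 2 + 4 * (1 / 4 : ℝ)) := by linarith only [hsmall]
  -- the dissipation in coordinate form
  have hkey2 : ∀ t₂ ∈ Ioo t₁ 0, ∫ s in t₁..t₂, ((∫ x, (fderiv ℝ (fun y => ζ y * angVortQuot (v s) y) x (EuclideanSpace.single 0 1) ^ 2 + fderiv ℝ (fun y => ζ y * angVortQuot (v s) y) x (EuclideanSpace.single 1 1) ^ 2 + fderiv ℝ (fun y => ζ y * angVortQuot (v s) y) x (EuclideanSpace.single 2 1) ^ 2)) + (∫ x, (fderiv ℝ (fun y => ζ y * radVelQuot (curl (v s)) y) x (EuclideanSpace.single 0 1) ^ 2 + fderiv ℝ (fun y => ζ y * radVelQuot (curl (v s)) y)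 x (EuclideanSpace.single 1 1) ^ 2 + fderiv ℝ (fun y => ζ y * radVelQuot (curl (v s)) y) x (EuclideanSpace.single 2 1) ^ 2))) ≤ _ := fun t₂ ht₂ => by
    have h := (hkey t₂ ht₂).2
    simp only [norm_fderiv_sq_eq_sum_sq] at h
    exact h
  -- Step 4 inputs: continuity in time of the dissipation densities
  have hIco : Ico t₁ 0 ⊆ Ioo (-1 : ℝ) 0 := fun t ht => ⟨ht₁1.trans_le ht.1, ht.2⟩
  obtain ⟨hDΓc, hDΦc⟩ := continuousOn_dissipation_cutoffField isOpen_Ioo hsm hR2 hU hζC hζc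
  -- Step 4 inputs: measurability, divergence, plateau, energy, bounds on `supp ∇ζ`
  have hmeas := aestronglyMeasurable_cutoffField hW hv hχ1 hr₁pos.le hr₁1.le hr₁b
  have hdiv' : ∀ t ∈ Ioo t₁ 0, ∀ x ∈ SereginSverak2009.spaceCyl (0 : EuclideanSpace ℝ (Fin 3)) ρb,
      VectorCalculus.divergence (v t) x = 0 := fun t ht x hx => hdiv t (hslab t ht.1.le ht.2).1 x hx
  have hζr₁ : ∀ x ∈ SereginSverak2009.spaceCyl (0 : EuclideanSpace ℝ (Fin 3)) r₁, ζ x = 1 := fun x hx => by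
    obtain ⟨h1, h2, h3⟩ := spaceCyl_subset_box hr₁8 hr₁p hr₁m hx
    exact hplat x h1 h2 h3
  have hLv : ∀ t ∈ Ioo t₁ 0, ∀ x, fderiv ℝ ζ x ≠ 0 → ‖v t x‖ ≤ D₀ := fun t ht x hx =>
    (hDv t ht.1.le ht.2 x (hKgrad (subset_tsupport _ (mem_support.2 hx)))).1
  -- Step 4 for `v`
  have hT := tendsto_cubicC_of_keyEstimate v ζ (SereginSverak2009.spaceCyl 0 ρb) t₁ r₁ D₀ _ _ A ht₁0 hr₁pos hr₁1.le
    hmeas (fun t ht => hV4 t (hslab t ht.1.le ht.2).1) (fun t ht => hax t (hslab t ht.1.le ht.2).1)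
    (SereginSverak2009.isOpen_spaceCyl 0 ρb) hdiv' hζ2 (hts.trans (hbox.trans (hmono hab.le))) hts1 hζr₁
    (fun t ht => energyBound_cutoffField hv hχ01 (hA t (hslab t ht.1.le ht.2).1)) hLv
    (fun t ht => le_uniform_of_le ((hkey t ht).1 t ⟨ht.1.le, le_rfl⟩) hSc0 ht.2.le) (hDΓc.mono hIco)
    (hDΦc.mono hIco) (fun t₂ ht₂ => le_uniform_div_of_le (hkey2 t₂ ht₂) hSc0 ht₂.2.le hden0)
  -- back to `W`: `C(R; v) = C(R; W)` for `0 < R ≤ ρb`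
  refine hT.congr' ?_
  filter_upwards [Ioc_mem_nhdsGT (hρa0.trans hab)] with R hR
  exact cubicC_cutoffField hv hχ1 hR.2

/-! ### The core at the origin -/

/-- **Seregin 2022, §2: the core of the criterion at the origin holds** — the hypothesis `hnorm`
of `seregin2022_logSwirl_regularAtOrigin_of_coreAtOrigin` (sibling `…CoreNormalise`), verbatim:
for `(u, π)` in the class (H) of the fact on `Q = 𝒞 × ]-1, 0[`, heights `h±` and width `δ`, a
representative `W` in `IsSmoothAxisymmetricSolutionOn Q W π` with `u = W` a.e. on `Q`, derivative
bounds up to the top time at the good top-slice points, (2.2) for `W` on `Q` off the axis and the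
energy bound for `W` at every time, the origin is a regular point of `u`:
`tendsto_cubicC_of_smooth_cleanConfig` gives `C(R; W) → 0`, `tendsto_cubicC_congr_ae` transports it
to `u`, and the landed endgame `isRegularAtOrigin_of_tendsto_cubicC` (Step 4, last sentence:
"According to the partial regularity theory … the origin is a regular point") concludes.
[cite: Seregin2022LocalAxisym, §2 proof of Thm. 1.2, Steps 1–4 (arXiv:2201.00153 pp. 5–7)] -/
theorem isRegularAtOrigin_coreAtOrigin : ∀ (u : ℝ → EuclideanSpace ℝ (Fin 3) → EuclideanSpace ℝ (Fin 3)) (π : ℝ → EuclideanSpace ℝ (Fin 3) → ℝ), IsSuitableWeakSolutionOn (SereginSverak2009.parCylOpens 0 1) 1 0 u π → (∃ C : ℝ≥0, ∀ᵐ s ∂(volume.restrict (Ioo (-1 : ℝ) 0)), ∫⁻ y in SereginSverak2009.spaceCyl 0 1, ‖u s y‖ₑ ^ 2 ≤ C) → (∃ G : ℝ → EuclideanSpace ℝ (Fin 3) → EuclideanSpace ℝ (Fin 3) →L[ℝ] EuclideanSpace ℝ (Fin 3), HasWeakSpatialGradientOn (SereginSverak2009.parCylOpens 0 1) u G ∧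 ∫⁻ z in SereginSverak2009.parCyl 0 1, ENNReal.ofReal (frobeniusNormSq (G z.1 z.2)) < ∞) → (∫⁻ z in SereginSverak2009.parCyl 0 1, ‖π z.1 z.2‖ₑ ^ (3 / 2 : ℝ) < ∞) → (∀ s ∈ Ioo (-1 : ℝ) 0, IsAxisymmetric (u s)) → (∀ s ∈ Ioo (-1 : ℝ) 0, IsAxisymmetricScalar (π s)) → (∃ C₁ : ℝ, 0 ≤ C₁ ∧ ∀ s ∈ Ioo (-1 : ℝ) 0, ∀ y ∈ SereginSverak2009.spaceCyl 0 1, 0 < cylRadius y → |swirl (u s) y| ≤ C₁ / Real.log (Real.exp 1 / cylRadius y) ^ 3) → ∀ (hp hm δ : ℝ) (W : ℝ → EuclideanSpace ℝ (Fin 3) → EuclideanSpace ℝ (Fin 3)), SereginZajaczkowski2007.IsSmoothAxisymmetricSolutionOn (SereginSverak2009.parCylOpens 0 1) W π → uncurry u =ᵐ[volume.restrict (SereginSverak2009.parCyl 0 1)] uncurry W → 0 < δ → -1 ≤ hm - δ → hm + δ < 0 → 0 < hp - δ → hp + δ ≤ 1 → (∀ a ∈ SereginSverak2009.spaceCyl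 (0 : EuclideanSpace ℝ (Fin 3)) 1, (0 < cylRadius a ∨ |a 2 - hp| < δ ∨ |a 2 - hm| < δ) → ∃ ρ > 0, parabolicCylinder ρ (((0 : ℝ), a) : ℝ × EuclideanSpace ℝ (Fin 3)) ⊆ SereginSverak2009.parCyl 0 1 ∧ ∀ n : ℕ, ∃ C : ℝ, ∀ w ∈ parabolicCylinder ρ (((0 : ℝ), a) : ℝ × EuclideanSpace ℝ (Fin 3)), ‖iteratedFDeriv ℝ n (W w.1) w.2‖ ≤ C) → (∃ C₁ : ℝ, 0 ≤ C₁ ∧ ∀ z ∈ SereginSverak2009.parCyl (0 : ℝ × EuclideanSpace ℝ (Fin 3)) 1, 0 < cylRadius z.2 → |swirl (W z.1) z.2| ≤ C₁ / Real.log (Real.exp 1 / cylRadius z.2) ^ 3) → (∃ A : ℝ≥0, ∀ s ∈ Ioo (-1 : ℝ) 0, ∫⁻ y in SereginSverak2009.spaceCyl 0 1, ‖W s y‖ₑ ^ 2 ≤ A) → SereginSverak2009.IsRegularAtOrigin u := by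
  rintro u π hsw hA hG hq - - - hp hm δ W hW hae hδ hm1 hm0 hp0 hp1 hcore ⟨C₁, hC₁, hσW⟩ ⟨A, hAW⟩
  refine isRegularAtOrigin_of_tendsto_cubicC u π hsw hA hG hq (tendsto_cubicC_congr_ae hae ?_)
  refine tendsto_cubicC_of_smooth_cleanConfig W π hp hm δ C₁ A hW hδ hm1 hm0 hp0 hp1 hC₁ hσW hAW fun a ha h => ?_
  obtain ⟨ρ, hρ, -, hb⟩ := hcore a ha h
  exact ⟨ρ, hρ, hb⟩

/-! ### The stub and the named fact -/

/-- **Stub 2a `stub_sereginLogSwirlOrigin` of the line `registered` of the crux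
`AxisymmetricKatoGlobal` = Seregin's logarithmic swirl criterion at the origin** (G. Seregin,
J. Math. Fluid Mech. 24 (2022), Paper 27 = arXiv:2201.00153, Thm. 1.2 via §2 Steps 1–4 from
(2.2)): let `(v, q)` be a suitable weak solution of the unit-viscosity Navier–Stokes system in
`Q = 𝒞 × ]-1, 0[` with `v ∈ L_{2,∞}(Q)`, `∇v ∈ L₂(Q)`, `q ∈ L_{3/2}(Q)` (Def. 1.1), axisymmetric
slices of `v` and `q`, and the swirl bound (2.2) `|σ(v(t))(x)| ≤ C₁/ln³(e/|x'|)` on `Q` off the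
axis; then the origin is a regular point of `v` (`SereginSverak2009.IsRegularAtOrigin`: `v` is
essentially bounded on some `Q(r)`). VERBATIM the named fact
`Literature.Analysis.FluidPDE.seregin2022_logSwirl_regularAtOrigin`; proof:
`seregin2022_logSwirl_regularAtOrigin_of_coreAtOrigin` (first singular time, top-time partial
regularity, clean slab and Seregin–Zajaczkowski representative, normalisation to the origin)
applied to `isRegularAtOrigin_coreAtOrigin` (Steps 1 + 3 + 4 for the representative and the
ε-regularity endgame). [cite: Seregin2022LocalAxisym, Thm. 1.2 / §2 proof, Steps 1–4 (arXiv:2201.00153 pp. 5–7)] -/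
theorem stub_sereginLogSwirlOrigin :
    ∀ (v : ℝ → EuclideanSpace ℝ (Fin 3) → EuclideanSpace ℝ (Fin 3)) (q : ℝ → EuclideanSpace ℝ (Fin 3) → ℝ),
      IsSuitableWeakSolutionOn (SereginSverak2009.parCylOpens 0 1) 1 0 v q →
      (∃ C : ℝ≥0, ∀ᵐ t ∂(volume.restrict (Ioo (-1 : ℝ) 0)),
          ∫⁻ x in SereginSverak2009.spaceCyl 0 1, ‖v t x‖ₑ ^ 2 ≤ C) →
      (∃ G : ℝ → EuclideanSpace ℝ (Fin 3) → EuclideanSpace ℝ (Fin 3) →L[ℝ] EuclideanSpace ℝ (Fin 3),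
          HasWeakSpatialGradientOn (SereginSverak2009.parCylOpens 0 1) v G ∧
          ∫⁻ z in SereginSverak2009.parCyl 0 1, ENNReal.ofReal (frobeniusNormSq (G z.1 z.2)) < ∞) →
      (∫⁻ z in SereginSverak2009.parCyl 0 1, ‖q z.1 z.2‖ₑ ^ (3 / 2 : ℝ) < ∞) →
      (∀ t ∈ Ioo (-1 : ℝ) 0, IsAxisymmetric (v t)) →
      (∀ t ∈ Ioo (-1 : ℝ) 0, IsAxisymmetricScalar (q t)) →
      (∃ C₁ : ℝ, ∀ t ∈ Ioo (-1 : ℝ) 0, ∀ x ∈ SereginSverak2009.spaceCyl 0 1, 0 < cylRadius x →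
          |swirl (v t) x| ≤ C₁ / Real.log (Real.exp 1 / cylRadius x) ^ 3) →
      SereginSverak2009.IsRegularAtOrigin v :=
  fun v q => seregin2022_logSwirl_regularAtOrigin_of_coreAtOrigin isRegularAtOrigin_coreAtOrigin v q

end Literature.Analysis.SereginLogSwirlOrigin.EulerScaling

end Part9

/-! ## Part 10 — the EXACT discharge -/

namespace Literature.Analysis.FluidPDE

/-- **The named fact `seregin2022_logSwirl_regularAtOrigin` HOLDS** (`Seregin2022LogSwirlCriterion.lean`; Seregin 2022, Thm. 1.2
via §2 from (2.2): logarithmic decay of the swirl makes the origin a regular point of an axisymmetric suitable weak solution in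
the unit parabolic cylinder).  EXACT-name alias of `SereginLogSwirlOrigin.EulerScaling.stub_sereginLogSwirlOrigin` (this file),
Literature-side twin of
`Summit.NavierStokesRegularity.NavierStokesRegularity.Theorems.AxisymmetricKatoGlobal.EulerScaling.seregin2022_logSwirl_regularAtOrigin_holds`
(same term). [cite: Seregin2022LocalAxisym, Thm. 1.2 / §2 proof, Steps 1–4 (arXiv:2201.00153 pp. 5–7)] -/
theorem seregin2022_logSwirl_regularAtOrigin_holds : seregin2022_logSwirl_regularAtOrigin :=
  SereginLogSwirlOrigin.EulerScaling.stub_sereginLogSwirlOrigin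

end Literature.Analysis.FluidPDE

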